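import Literature.AlgebraicGeometry.ComplexMultiplication.CyclotomicFermatCMTypesBoundaryCasesTwoThree
import HarnessLib

/-!
# Koblitz–Rohrlich §3 PROPOSITION, CASE 2 AT `p = 7` IN FULL (the residue class `r ≡ r′ (mod N/5)`, by POSITIONED UNITS in place of
# K–R's omitted floor-separation Lemma); hence THE PROPOSITION — and Theorem 1 (ii) for boundary triples on abelian varieties — at
# every level `N` prime to `6` with `5 ∤ N` or `5² ∣ N`; and K–R's omitted LEMMA (p. 1195, first part) AS PRINTED — in the regimes (v1)
# and (v2) IN FULL for every `p > 5` (the class at `p = 7` by a digit table and a descent `N → N/5`); (v3) K–R's (6) in floor form and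
# CASE 2 FOR `p > 5` BY THE PRINTED ROAD (Lemma + (6)), and the reduction of Case 2 at `p = 5`, `5 ∥ N` to g.c.d.`(N, r) = `g.c.d.`(N, r′) = 5`;
# (v4) the LEMMA's SECOND PART (`5 ∤ N`, `y` a unit `≠ 1, 2, 2⁻¹`: a unit `u` with `|⌊5⟨u⟩/N⌋ − ⌊5⟨uy⟩/N⌋| ≥ 3`); (v5) CASE 2 AT
# `p = 5`, `5 ∥ N` (K–R p. 1196 in full: the Lemma's second part against (6), the sub-case `r ≡ 2^{±1}r′` via (7)) — hence CASE 2 OF THE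
# PROPOSITION AT EVERY LEVEL PRIME TO `6`; the one boundary configuration left is K–R's own omitted Case 3 at `p = 5`, `5² ∤ N` (p. 1197)

Layer `Literature/AlgebraicGeometry/ComplexMultiplication`, namespace `…ComplexMultiplication.CyclotomicFermatCMType`; sequel of
`CyclotomicFermatCMTypesBoundaryCasesTwoThree` (this lane, gen 39), whose honest column reads: «NOT typed: `p = 5` with `5² ∤ N` …, and
at `p = 7` with `5 ∣ N`, `7² ∤ N` the Case-2 residue class `r ≡ r′ (mod N/5)`; K–R's omitted Lemma itself (floor-separation `≥ ν + 2`)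
is not typed — our units … are a different, shorter road».  THIS FILE closes the residue class at `p = 7` — so CASE 2 AT `p = 7` holds at
every level `N = 7Q` prime to `6` with no proviso —, assembles the PROPOSITION (both boundary primes arbitrary) at every level `N` prime
to `6` that is NOT exactly divisible by `5`, with its printed-hypotheses form and THEOREM 1 (ii) there on abelian varieties, and types the
first part of K–R's omitted LEMMA as printed — v1 wherever the tree's units reach, v2 (§5) IN FULL for every `p > 5` (and `p = 5`); v3 (§6)
adds K–R's inequality (6) in its floor form, Case 2 for every `p > 5` by the printed road "Lemma versus (6)", the matching of a boundary entry
at any prime `≥ 7` at any level prime to `6`, and K–R's reduction of Case 2 at `p = 5`, `5 ∥ N` to "g.c.d.`(N, r) = `g.c.d.`(N, r′) = 5`";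
v4 (§7) types the Lemma's SECOND PART (the one K–R use at `p = 5`, `5 ∥ N`) for `y` a unit; v5 (§8) closes CASE 2 AT `p = 5`, `5 ∥ N`
exactly as printed on p. 1196 (transport of §7's unit to level `N` against §6's (6); the sub-case `r ≡ 2^{±1}r′ (mod N₀)` by (7), the unit
`u ∈ P*` with `us = N − a`, "`2 ∉ H_τ`" and the final residue count), so that CASE 2 holds at EVERY level prime to `6` for EVERY boundary
prime, and the Proposition's only untyped configuration is K–R's omitted Case 3 at `p = 5`, `5² ∤ N`.
THEOREMS ONLY (no definition, no named fact, no `sorry`, no kernel enumeration in this file beyond three `5 × 5` residue tables — `N = 35`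
is imported).

THE SOURCE.  N. Koblitz, D. Rohrlich, *Simple factors in the Jacobian of a Fermat curve*, Canad. J. Math. **30** (1978) 1183–1205 (held
`paper:koblitz1978-simple-factors-jacobian-fermat-curve`, pp. 1193–1197 read first-hand).  §3 (p. 1193): "PROPOSITION. Let `2, 3 ∤ N`,
`τ = (r, s, t)`, `τ′ = (r′, s′, t′)`, `r + s + t = N`. Suppose g.c.d.`(r, s, t, r′, s′, t′) = 1`. … Suppose `N` is not prime to `rstr′s′t′`.
In the case that `r = r′` for some ordering of the triples `τ` and `τ′`, suppose further that `N` is not prime to `sts′t′`. Finally, suppose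
`H_τ = H_{τ′}`. Then `τ′` is a permutation of `τ`."  (p. 1195:) "Case 2. There exists a prime `p` dividing `N, r, r′` but not dividing
`sts′t′`; and `r ≠ r′`.  We need the following simple lemma, whose proof is straightforward and will be omitted.  LEMMA. Let `2, 3 ∤ N`,
`1 ≤ x, y < N`, `x ≠ y`, `p | N`. Then there exists `u ∈ (ℤ/Nℤ)*` such that `|⌊⟨ux⟩/(N/p)⌋ − ⌊⟨uy⟩/(N/p)⌋| ≥ 3` if `p > 5`, `≥ 2` if
`p = 5`. … (5) `νN ≥ |Σ_{u∈P} ⟨ur⟩ + ⟨us⟩ + ⟨ut⟩ − Σ_{u∈P} ⟨ur′⟩ + ⟨us′⟩ + ⟨ut′⟩| = p|r + s₀ + t₀ − r′ − s₀′ − t₀′| ≥ …` (6) `ν + 1 ≥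
|⌊r/(N/p)⌋ − ⌊r′/(N/p)⌋|`.  First suppose `p > 5`, or `p = 5` and `5² | N` (so that `ν = 0`). By the lemma applied with `x = r, y = r′`, if we
multiply through by a suitable `u ∈ (ℤ/Nℤ)*`, without loss of generality we may assume that `|⌊r/(N/p)⌋ − ⌊r′/(N/p)⌋| ≥ ν + 2`, which
contradicts (6)."  (The printed Lemma — whose statement is OCR-damaged in the held scan and is read as above, consistently with its two uses
on pp. 1195–1196 — was confirmed by exhaustive search for all `N ≤ 130` prime to `6`, all `p ∣ N`, all `x ≠ y`; not used as an input here.)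

THE POINT.  The sibling closed Case 2 for `p ≥ 7` with a unit `u` making `⟨u(r − r′)⟩ ∈ [3N/7, N/2]`, which exists unless
`5·g.c.d.(⟨r − r′⟩, N) = N`, i.e. unless the unit multiples of `d = r − r′` are exactly `T, 2T, 3T, 4T` (`T = N/5`).  On that class a
difference alone cannot close (5) at `p = 7` (`7·2N/5 < 3N`); one must also control WHERE `⟨ur′⟩` lies — which is what K–R's Lemma does
("`⌊⟨ux⟩/(N/p)⌋`, `⌊⟨uy⟩/(N/p)⌋` far apart", not merely `⟨u(x − y)⟩` large).  §1 supplies such POSITIONED UNITS: `⟨ud⟩ = 3T` AND `⟨uy⟩ < T`,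
so that `⟨u(y + d)⟩ = ⟨uy⟩ + 3N/5` with no wrap, and `7·3N/5 = 21N/5 > 3N ≥ |E − E′| + 7|s₀′ + t₀′ − s₀ − t₀|` contradicts (5).

## What is proved

* §1 (any `N`; `T = g.c.d.(⟨d⟩, N)` with `5T = N`) **`exists_isUnit_val_mul_eq_three_mul`** (`N` prime to `3`: a unit `u₀` with `⟨u₀d⟩ =
  3T`); **`exists_isUnit_val_mul_eq_and_lt_of_five_dvd`** (`5 ∣ T`, `5 ∤ ⟨y⟩`: a unit `u` with `⟨ud⟩ = 3T`, `⟨uy⟩ < T` — `u = (1 + kT)u₀`,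
  `T² ≡ 0`, the five translates of `⟨u₀y⟩` by multiples of `T`); **`exists_isUnit_val_mul_eq_and_lt_of_not_five_dvd`** (`N` prime to `6`,
  `5 ∤ T`, `T ∤ ⟨y⟩`: the same conclusion — Chinese remainder theorem with `k ≡ 1 (mod 5)`, `k ≡ v·w₁ (mod T)`, `⟨w₁u₀y⟩_T = g₁ =
  g.c.d.(⟨u₀y⟩, T)`, `v ∈ {1,…,5}` (all units mod `T`, whose primes are `≥ 7`) with `vg₁ ≡ ⟨u₀y⟩ (mod 5)`, so `⟨uy⟩ = vg₁ ≤ 5g₁ < 7g₁ ≤ T`;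
  Mathlib's `Nat.chineseRemainder`, `ZMod.unitsMap_surjective` via the sibling `exists_isUnit_val_mul_eq_gcd`).
* §2 **`eq_of_fermatCMType_eq_of_seven_dvd_of_dvd`** (+ `_level`) = CASE 2 AT `p = 7` IN FULL: at every `N = 7Q` prime to `6`, for
  admissible primitive `τ, τ′` (six non-zero entries, sums `0`, no prime of `N` dividing a whole triple) with `H_τ = H_{τ′}`: `7 ∣ ⟨r⟩, ⟨r′⟩ ⟹
  r = r′`.  Off the class: sibling `eq_of_fermatCMType_eq_of_dvd_of_dvd_of_seven_le`.  On the class: `5 ∣ T` and `5 ∤ ⟨r′⟩` (or `5 ∤ ⟨r⟩`,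
  exchanging the triples), or `5 ∤ T` and `T ∤ ⟨r′⟩` — positioned unit + (5) (`false_of_positioned_unit_bs`, the sibling's
  `orbit_sum_compare` / orbit sums, `linarith`); `5 ∣ T`, `5 ∣ ⟨r⟩, ⟨r′⟩` — Case 2 at `p = 5` with `5² ∣ N` (sibling §5, `ν = 0`); `5 ∤ T`,
  `T ∣ ⟨r⟩, ⟨r′⟩` — every prime `q` of `T` divides `r, r′` and none of `s, t, s′, t′` (primitivity), so Case 2 at a prime `q ≥ 11` of `T` or
  at `7` with `7² ∣ N` (sibling §5) gives `r = r′`, and otherwise `T = 7`, `N = 35`, decided by the tree's kernel enumeration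
  `multiset_eq_of_fermatCMType_eq_thirtyFive` (gen 36; K–R: "easily checked by hand"; `τ′` has a unit entry by primitivity at `5`).
* §3 **`eq_or_eq_or_eq_of_fermatCMType_eq_of_seven_dvd`** (`7 ∣ ⟨r⟩ ⟹ r ∈ {r′, s′, t′}` at every `N = 7Q` prime to `6`: Case 3 is the
  sibling `fermatCMType_ne_of_seven_dvd_of_not_dvd`); at every level `N` prime to `6` with **`5 ∤ N ∨ 5² ∣ N`** and ANY boundary primes:
  **`eq_or_eq_or_eq_of_fermatCMType_eq_of_dvd_of_not_five_or_sq`** (`p ∣ N`, `p ∣ ⟨r⟩ ⟹ r ∈ {r′, s′, t′}`),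
  `multiset_eq_of_fermatCMType_eq_of_eq_of_dvd_of_not_five_or_sq` (matched form), **`multiset_eq_of_fermatCMType_eq_of_dvd_of_dvd_of_not_five_or_sq`**
  = THE PROPOSITION (a prime of `N` divides `⟨r⟩`, a prime of `N` divides `⟨s⟩` or `⟨t⟩` ⟹ `{r, s, t} = {r′, s′, t′}`),
  **`multiset_eq_of_fermatCMType_eq_of_gcd_six_of_not_five_or_sq`** (printed hypotheses "g.c.d.`(r,s,t,r′,s′,t′) = 1`", via the sibling
  `primitive_of_fermatCMType_eq_of_gcd_six`), and **`isIsogenous_iff_exists_unit_multiset_eq_of_not_five_or_sq`** = THEOREM 1 (ii) for such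
  boundary triples ON ABELIAN VARIETIES (realisations of `Φ_{H_τ}`, `Φ_{H_{τ′}}` are isogenous iff `{r′, s′, t′} = {ur, us, ut}` for a unit
  `u`; Shimura–Taniyama through the tree's `isIsogenous_fermatCMType_iff_exists_eq_mul`).  These supersede the regime forms of the sibling
  (§5: `p² ∣ N ∨ p ≥ 11`; §10: `N` prime to `30`).
* §4 K–R's LEMMA (first part) AS PRINTED, as floor inequalities `⌊⟨ux⟩/M⌋ ≥ ⌊⟨uy⟩/M⌋ + k` or the reverse (`N = pM`):
  **`exists_isUnit_div_separation_five`** (`p = 5`, `k = 2`, every `x ≠ y`: the Case-1 unit `2N/5 ≤ ⟨u(x−y)⟩ ≤ 3N/5`);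
  **`exists_isUnit_div_separation_of_seven_le`** (`p ≥ 7`, `k = 3`, for `p ≥ 11` or `5·g.c.d.(⟨x − y⟩, N) ≠ N`: a unit with `3M ≤
  ⟨u(x − y)⟩ ≤ N − 3M`); **`exists_isUnit_div_separation_seven_of_class`** (`p = 7` on the class, under §1's hypotheses on `y`: `k = 3`).
* §5 (v2) **`exists_isUnit_div_separation_seven`** = THE LEMMA (first part) AT `p = 7` IN FULL (every `N = 7M` prime to `6`, all `x ≠ y`,
  `k = 3`; strong induction on `M`: on the class, when §1's hypotheses fail for both `x` and `y`, either `25 ∤ N` and `⟨x⟩, ⟨y⟩ ∈ {0, T, …,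
  4T}` — digits `⌊7j/5⌋ = 0, 1, 2, 4, 5`, separated by a multiplier `u ≡ c (mod 5)`, `u ≡ 1 (mod T)` (`digit_table_bs`, `decide` on `5 × 5`)
  —, or `25 ∣ N` and `5 ∣ ⟨x⟩, ⟨y⟩` — descent to `(⟨x⟩/5, ⟨y⟩/5)` at level `N/5 = 7(M/5)`, the unit lifted back by `ZMod.unitsMap_surjective`
  with `⟨ux⟩ = 5⟨u′x₁⟩`, so the digits agree); **`exists_isUnit_div_separation`** = THE LEMMA (first part) for EVERY `p ≥ 7` with `N = pM`
  prime to `6` (`p = 7` or `p ≥ 11`), all `x ≠ y`, `k = 3`.  With `exists_isUnit_div_separation_five` this is K–R's omitted Lemma, first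
  part, as printed, at every `p ∣ N`.
* §6 (v3) **`div_dist_le_of_fermatCMType_eq`** = K–R's (6) IN FLOOR FORM: in the Case-2 setting (`N = pQ`, `p` prime, `τ, τ′` admissible
  primitive, `H_τ = H_{τ′}`, `p ∣ ⟨r⟩, ⟨r′⟩`), for EVERY unit `u`, `|⌊⟨ur⟩/Q⌋ − ⌊⟨ur′⟩/Q⌋| ≤ 2`, and `≤ 1` if `p ∣ Q` (from the sibling's
  `orbit_sum_compare`, the orbit sums, `⟨ur⟩ = Q⌊⟨ur⟩/Q⌋ + r₀` and `r₀ + s₀ + t₀ ∈ {Q, 2Q}` by primitivity: `N(⌊⟨ur⟩/Q⌋ + k) + E′ = N(⌊⟨ur′⟩/Q⌋ +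
  k′) + E`); **`eq_of_fermatCMType_eq_of_dvd_of_dvd_printed`** = CASE 2 FOR EVERY `p ≥ 7` AT EVERY `N = pQ` PRIME TO `6` BY THE PRINTED ROAD
  (§5's Lemma `≥ 3` against (6) `≤ 2`; a second, uniform proof of §2 and of the siblings' Case-2 theorems);
  **`eq_or_eq_or_eq_of_fermatCMType_eq_of_dvd_of_seven_le`** (a boundary entry at ANY prime `p ≥ 7` matches — `r ∈ {r′, s′, t′}` — at every
  level prime to `6`, with no condition at `5`); **`eq_or_gcd_eq_five_of_fermatCMType_eq`** = K–R's reduction at `p = 5`, `5 ∥ N` ("If there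
  is another prime `p > 5` with `p | N` and `p | r` or `p | r′` … So suppose g.c.d.`(N, r) = `g.c.d.`(N, r′) = 5`"): `5 ∣ ⟨r⟩, ⟨r′⟩ ⟹ r = r′`
  or both g.c.d.'s equal `5`.
* §7 (v4) **`exists_isUnit_div_separation_part_two`** = THE LEMMA's SECOND PART ("If `x = 1`, `y ≠ 2, (N+1)/2`, and `5 ∤ N`, then there
  exists `u ∈ (ℤ/Nℤ)*` such that `|⌊⟨ux⟩/(N/5)⌋ − ⌊⟨uy⟩/(N/5)⌋| ≥ 3`"), for `N` prime to `30` and `y` a UNIT with `y ≠ 1, 2`, `2y ≠ 1`: a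
  unit `u` with `⌊5⟨u⟩/N⌋ ≥ ⌊5⟨uy⟩/N⌋ + 3` or the reverse.  Proof (ours, `v = ⟨y⟩`): `v ∈ {3, 4}` and `2v − N ∈ {3, 5, 7, 9}` by an "inverse
  trick" `u = c·v⁻¹`, resp. `u = 2c·(2v − N)⁻¹`, `c ≤ 6`, with `⟨u⟩ ≥ 3N/5` (two `decide` tables over `N mod v`, resp. `N mod (2v − N)`);
  `5 ≤ v < N/10` and `10 ≤ 2v − N < N/10` by a {2,3}-smooth multiplier into `[3N/5, N)` (the sibling's `exists_smooth_mem_middle`); the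
  middle ranges by `u ∈ {6, 4, 3, 2, 5, 1}`; the levels `7 ≤ N < 31` by enumeration.
* §8 (v5) **`eq_of_fermatCMType_eq_of_five_dvd_of_dvd`** (+ `_level`) = CASE 2 AT `p = 5` WITH `5 ∥ N`, IN FULL (p. 1196): at `N = 5Q` prime to
  `6`, `5 ∤ Q`, admissible primitive `τ, τ′`, `H_τ = H_{τ′}`, `5 ∣ ⟨r⟩, ⟨r′⟩ ⟹ r = r′`.  Road, as printed: §6's reduction to g.c.d.`(N, r) =
  `g.c.d.`(N, r′) = 5`; `ρ = ⟨r⟩/5`, `ρ′ = ⟨r′⟩/5` are units mod `Q` and `y = ρρ′⁻¹ ∉ {1, 2, 2⁻¹}` unless `r = r′`, `r = 2r′` or `r′ = 2r`; §7's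
  unit `u` for `y` at level `Q`, multiplied by `ρ′⁻¹` and lifted to a unit `U` of level `N` (`ZMod.unitsMap_surjective`), has `⟨Ur′⟩ = 5⟨u⟩_Q`,
  `⟨Ur⟩ = 5⟨uy⟩_Q` ("`u₀ = 5u/r′` … prime to `N`"), so `|⌊⟨Ur⟩/Q⌋ − ⌊⟨Ur′⟩/Q⌋| ≥ 3` contradicts (6) (§6); the sub-case `r = 2r′` (and
  symmetrically `r′ = 2r`): normalise `⟨r⟩ = 5` (`exists_isUnit_val_mul_eq_gcd`), so `⟨r′⟩ = (N + 5)/2`; the residue relation gives (7)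
  `s₀ + t₀ = 2Q − 5`, `r₀′ + s₀′ + t₀′ = Q` (`residues_normalised_bs`); the unit `u = 1 + iQ ∈ P*` with `⟨us⟩ = N − a` (a unit BECAUSE `5 ∤
  a`; `exists_unit_P_bs`) fixes `r, r′`; for the new pair `2 ∉ H` (`⟨10⟩ + ⟨2(N − a)⟩ + ⟨2(N − b)⟩ = 2N`), so `⟨2us′⟩ = N − a′`, `⟨2ut′⟩ = N − b′`,
  `a′ + b′ = 5`, and with `a′` (or `b′`) even the residues of `r′, us′, ut′` add up to `2Q`, not `Q` (`final_count_bs`).  Assembled: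
  **`eq_of_fermatCMType_eq_of_dvd_of_dvd_all`** = CASE 2 AT EVERY LEVEL `N` PRIME TO `6`, EVERY PRIME `p ∣ N` (`p ∣ ⟨r⟩, ⟨r′⟩ ⟹ r = r′`), and
  **`eq_or_eq_or_eq_of_fermatCMType_eq_of_five_dvd_of_dvd`** (at `5 ∥ N`: `5 ∣ ⟨r⟩` and `5` dividing one of `⟨r′⟩, ⟨s′⟩, ⟨t′⟩` ⟹ `r ∈ {r′, s′,
  t′}` — everything except K–R's omitted Case 3 at `p = 5`).

## Honest column / NOT here

* After v5 the one boundary configuration of K–R's Proposition outside the tree is **CASE 3 at `p = 5` with `5 ∥ N`** — "`5 | N, r`, `5 ∤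
  str′s′t′`" —, whose proof K–R OMIT ("By a tedious examination of possible ranges of values for `r′, s′, t′`, we verified that no `τ′ ≠ τ`
  has `H_{τ′}` given by (10). This part of the proof will be omitted in the interest of brevity", p. 1197); their reduction to `τ = (5, N − a,
  N − b)` and the criterion (10) are not typed either.  Everything PRINTED in §3 is now a tree theorem.  Consequently Theorem 1 (i) at composite
  `N` is assembled here for the boundary triples at every level prime to `6` with `5 ∤ N` or `25 ∣ N` (§3), and at `5 ∥ N` whenever the
  boundary prime `5` meets both triples (§8); the junction with §2 of the paper (the relatively prime case at composite `N`, typed in the tree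
  for prime powers, two-prime levels and `N = 35` only) and the configuration "`r = r′` non-unit, `s, t, s′, t′` units" (excluded by the
  Proposition's hypothesis) remain as in the sibling's honest column.
* K–R's LEMMA, first part, is typed IN FULL (§5, v2; §4 gives the regime forms with the explicit units); the first part allows `x = 0` or
  `y = 0` here (K–R: `1 ≤ x, y`).  The second part (§7, v4) is typed for `y` a UNIT — the case of its use on p. 1196 ("Here `r′/5 ∈
  (ℤ/Nℤ)*`"); K–R state it for `1 ≤ y < N` (an exhaustive check for `N ≤ 400` confirms it for all `y`; for a non-unit `y` with `2⟨y⟩ − N = 7`,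
  `7 ∣ N` our inverse trick is unavailable and a finer smooth-number argument would be needed).  K–R's (6) is §6 (v3).  §2's Case-2 proof
  does NOT go through the Lemma and (6) — the positioned unit closes (5) directly and the two corners are re-dispatched to Case 2 at other
  primes, as K–R re-dispatch "`p = 7, a = 5`" in Case 3 (p. 1197) —; §6 (v3) gives the printed road as a second proof.  At `p = 5`, `5 ∥ N`,
  Case 2 is typed in full along the printed road (§§6–8); Case 3's "tedious examination" (10) remains OUTSIDE the tree.
* "`p ∣ x`" is read on representatives (`p ∣ ⟨x⟩`); "`τ, τ′` primitive" is K–R's "g.c.d. `= 1`" after Case 1 (sibling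
  `primitive_of_fermatCMType_eq_of_gcd_six`); the class "`r ≡ r′ (mod N/5)`" is written `5·g.c.d.(⟨r − r′⟩, N) = N`.  Nothing is computed by
  `decide` beyond the 5-by-5 residue tables of §1 and §5; no character sums.

## References

* [KoblitzRohrlich1978] N. Koblitz, D. Rohrlich, Canad. J. Math. 30 (1978) 1183–1205: Theorem 1 (p. 1185), §3 Proposition (p. 1193),
  Case 2 and the Lemma (pp. 1195–1196), Case 3 (pp. 1196–1197).
* [Shimura1998] G. Shimura, *Abelian Varieties with Complex Multiplication and Modular Functions* (1998), §6.1 Corollary, §8.4 Example (1)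
  (through `CyclotomicFermatCMTypesPrimePowerIsogenies.isIsogenous_fermatCMType_iff_exists_eq_mul`).

## Provenance

Cell `pub-hodgecm2` (COR-CM), literature seat `lit-deligne-3` gen 40 (claim KR78-CASE2-SEVEN, v1–v5; count-neutral, own lane).  HC_CM is
NOT proved and nothing here bears on it.
-/

namespace Literature.AlgebraicGeometry.ComplexMultiplication

open Literature.AlgebraicGeometry.HodgeTheory (fermatCMType)
open Finset

namespace CyclotomicFermatCMType

/-! ## §1 POSITIONED UNITS on the class `5·g.c.d.(⟨d⟩, N) = N`: a unit `u` with `⟨ud⟩ = 3N/5` AND `⟨uy⟩ < N/5` -/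

section Positioned

variable {N : ℕ} [NeZero N]

/-- A residue is a unit iff its representative is prime to the modulus. [folklore] -/
private theorem isUnit_iff_val_coprime_bs {m : ℕ} [NeZero m] (x : ZMod m) : IsUnit x ↔ x.val.Coprime m := by
  conv_lhs => rw [← ZMod.natCast_zmod_val x]
  exact ZMod.isUnit_iff_coprime x.val m

/-- `d ∣ N`, `d ∣ ⟨hx⟩`, `h` a unit ⟹ `d ∣ ⟨x⟩`. [folklore] -/
private theorem dvd_val_of_dvd_val_mul_bs {m d : ℕ} [NeZero m] (hd : d ∣ m) {h : ZMod m} (hh : IsUnit h) {x : ZMod m}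
    (hx : d ∣ (h * x).val) : d ∣ x.val := by
  rw [ZMod.val_mul, Nat.dvd_mod_iff hd] at hx
  have hc : Nat.Coprime d h.val := (Nat.Coprime.coprime_dvd_right hd ((isUnit_iff_val_coprime_bs h).1 hh)).symm
  exact hc.dvd_of_dvd_mul_left hx

/-- `q ∣ N`, `a + b + c = 0`, `q ∣ ⟨a⟩, ⟨b⟩` ⟹ `q ∣ ⟨c⟩`. [folklore] -/
private theorem dvd_val_of_add_eq_zero_bs {m q : ℕ} [NeZero m] (hq : q ∣ m) {a b c : ZMod m} (h : a + b + c = 0)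
    (ha : q ∣ a.val) (hb : q ∣ b.val) : q ∣ c.val := by
  have h1 : ((a + b).val + c.val) % m = 0 := by rw [← ZMod.val_add, h, ZMod.val_zero]
  have h2 : q ∣ (a + b).val + c.val := dvd_trans hq (Nat.dvd_of_mod_eq_zero h1)
  have h3 : q ∣ (a + b).val := by rw [ZMod.val_add, Nat.dvd_mod_iff hq]; exact dvd_add ha hb
  exact (Nat.dvd_add_right h3).1 h2

/-- `g.c.d.(⟨−x⟩, N) = g.c.d.(⟨x⟩, N)`. [folklore] -/
private theorem gcd_val_neg_bs {m : ℕ} [NeZero m] (x : ZMod m) : Nat.gcd (-x).val m = Nat.gcd x.val m := by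
  rw [ZMod.neg_val]; split_ifs with h
  · rw [h, ZMod.val_zero]
  · exact Nat.gcd_self_sub_left (ZMod.val_lt x).le

omit [NeZero N] in
/-- Every divisor `≠ 1` of a positive `n` prime to `30` is `≥ 7`. [folklore] -/
private theorem seven_le_of_dvd_bs {n m : ℕ} (hn : 0 < n) (hn2 : Nat.Coprime 2 n) (hn3 : Nat.Coprime 3 n) (hn5 : Nat.Coprime 5 n)
    (hm : m ∣ n) (hm1 : m ≠ 1) : 7 ≤ m := by
  have hm0 : m ≠ 0 := fun h => by rw [h, zero_dvd_iff] at hm; omega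
  obtain ⟨q, hq, hqm⟩ := Nat.exists_prime_and_dvd hm1
  have hqn : q ∣ n := dvd_trans hqm hm
  have h2 : q ≠ 2 := fun h => by rw [h] at hqn; exact absurd (Nat.Coprime.eq_one_of_dvd hn2 hqn) (by norm_num)
  have h3 : q ≠ 3 := fun h => by rw [h] at hqn; exact absurd (Nat.Coprime.eq_one_of_dvd hn3 hqn) (by norm_num)
  have h5 : q ≠ 5 := fun h => by rw [h] at hqn; exact absurd (Nat.Coprime.eq_one_of_dvd hn5 hqn) (by norm_num)
  have h4 : q ≠ 4 := fun h => by rw [h] at hq; exact absurd hq (by decide)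
  have h6 : q ≠ 6 := fun h => by rw [h] at hq; exact absurd hq (by decide)
  have := hq.two_le
  have hqm' := Nat.le_of_dvd (Nat.pos_of_ne_zero hm0) hqm
  omega

omit [NeZero N] in
/-- For `ρ ≢ 0 (mod 5)` and any `j`, some `k < 5` has `5 ∣ j + kρ`. [folklore] -/
private theorem exists_five_dvd_add_mul_bs (j ρ : ℕ) (hρ : ρ % 5 ≠ 0) : ∃ k, k < 5 ∧ 5 ∣ j + k * ρ := by
  have key : ∀ a < 5, ∀ b < 5, b ≠ 0 → ∃ k, k < 5 ∧ (a + k * b) % 5 = 0 := by decide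
  obtain ⟨k, hk, h⟩ := key (j % 5) (Nat.mod_lt j (by norm_num)) (ρ % 5) (Nat.mod_lt ρ (by norm_num)) hρ
  have h1 : j + k * ρ ≡ j % 5 + k * (ρ % 5) [MOD 5] :=
    Nat.ModEq.add (Nat.mod_modEq j 5).symm (Nat.ModEq.mul_left k (Nat.mod_modEq ρ 5).symm)
  exact ⟨k, hk, Nat.modEq_zero_iff_dvd.1 (h1.trans (Nat.modEq_zero_iff_dvd.2 (Nat.dvd_of_mod_eq_zero h)))⟩

omit [NeZero N] in
/-- For `g ≢ 0 (mod 5)` every class mod `5` is `v·g` for some `v ∈ {1, …, 5}`. [folklore] -/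
private theorem exists_mul_mod_five_eq_bs (g c : ℕ) (hg : g % 5 ≠ 0) : ∃ v, 1 ≤ v ∧ v ≤ 5 ∧ (v * g) % 5 = c % 5 := by
  have key : ∀ a < 5, a ≠ 0 → ∀ b < 5, ∃ v, v < 6 ∧ 1 ≤ v ∧ (v * a) % 5 = b := by decide
  obtain ⟨v, hv6, hv1, h⟩ := key (g % 5) (Nat.mod_lt g (by norm_num)) hg (c % 5) (Nat.mod_lt c (by norm_num))
  exact ⟨v, hv1, by omega, (Nat.ModEq.mul_left v (Nat.mod_modEq g 5).symm).trans (h : v * (g % 5) ≡ c [MOD 5])⟩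

/-- **The base unit on the class**: for `N` prime to `3`, `d ≠ 0` with `5·g.c.d.(⟨d⟩, N) = N` (`T = N/5`; the unit multiples of `d`
are `T, 2T, 3T, 4T`), a unit `u₀` with `⟨u₀d⟩ = 3T` (the unit of `exists_isUnit_val_mul_eq_gcd` times `3`).
[cite: KoblitzRohrlich1978, §3 Proposition, Case 2 (pp. 1195–1196: the class on which the omitted Lemma is needed at `p = 7`)] -/
theorem exists_isUnit_val_mul_eq_three_mul (hN3 : Nat.Coprime 3 N) {d : ZMod N} (hd : d ≠ 0) {T : ℕ}
    (hT : Nat.gcd d.val N = T) (h5T : 5 * T = N) : ∃ u : ZMod N, IsUnit u ∧ (u * d).val = 3 * T := by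
  have hN0 : N ≠ 0 := NeZero.ne N
  obtain ⟨u₁, hu₁, hg⟩ := exists_isUnit_val_mul_eq_gcd hd
  rw [hT] at hg
  have h3 : IsUnit ((3 : ℕ) : ZMod N) := (ZMod.isUnit_iff_coprime 3 N).2 hN3
  refine ⟨(3 : ℕ) * u₁, h3.mul hu₁, ?_⟩
  have e : ((3 : ℕ) : ZMod N) * u₁ * d = ((3 * T : ℕ) : ZMod N) := by
    rw [mul_assoc, Nat.cast_mul, ← hg, ZMod.natCast_zmod_val]
  rw [e, ZMod.val_natCast, Nat.mod_eq_of_lt (by omega)]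

/-- **Positioned unit, `5² ∣ N`**: `N` prime to `3`, `d ≠ 0` on the class (`5·g.c.d.(⟨d⟩, N) = N`, `T = N/5`) with `5 ∣ T`, and `y`
with `5 ∤ ⟨y⟩`: a unit `u` with **`⟨ud⟩ = 3T` and `⟨uy⟩ < T`** — `u = (1 + kT)u₀`: `1 + kT` is a unit fixing `u₀d` (`T² ≡ 0`), and
`k ↦ ⟨(1 + kT)u₀y⟩ = ⟨u₀y⟩ + k⟨Tu₀y⟩` runs through the five translates of `⟨u₀y⟩` by multiples of `T` (`5 ∤ ⟨u₀y⟩`), one of which is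
`< T` (our replacement, on this class, of K–R's omitted LEMMA "there exists `u ∈ (ℤ/Nℤ)*` such that `|⌊⟨ux⟩/(N/p)⌋ − ⌊⟨uy⟩/(N/p)⌋| ≥ 3`",
p. 1195, which controls the positions of `⟨ux⟩, ⟨uy⟩` and not only their difference). [cite: KoblitzRohrlich1978, §3 Case 2, Lemma (p. 1195)] -/
theorem exists_isUnit_val_mul_eq_and_lt_of_five_dvd (hN3 : Nat.Coprime 3 N) {d y : ZMod N} (hd : d ≠ 0) {T : ℕ}
    (hT : Nat.gcd d.val N = T) (h5T : 5 * T = N) (h5 : 5 ∣ T) (hy : ¬5 ∣ y.val) :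
    ∃ u : ZMod N, IsUnit u ∧ (u * d).val = 3 * T ∧ (u * y).val < T := by
  subst h5T
  have hN0 : 5 * T ≠ 0 := NeZero.ne _
  have hT0 : 0 < T := by omega
  obtain ⟨u₀, hu₀, hu₀d⟩ := exists_isUnit_val_mul_eq_three_mul hN3 hd hT rfl
  set z := u₀ * y with hz
  have hz5 : ¬5 ∣ z.val := fun h => hy (dvd_val_of_dvd_val_mul_bs (dvd_mul_right 5 T) hu₀ h)
  have hρ : z.val % 5 ≠ 0 := fun h => hz5 (Nat.dvd_of_mod_eq_zero h)
  obtain ⟨k, -, hk⟩ := exists_five_dvd_add_mul_bs (z.val / T) z.val hρ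
  obtain ⟨T', hT'⟩ := h5
  -- the unit `w = 1 + kT`
  have hcop : Nat.Coprime (1 + k * T) (5 * T) := by
    refine Nat.Coprime.mul_right ?_ ?_
    · rw [hT', show 1 + k * (5 * T') = 1 + (k * T') * 5 by ring, Nat.coprime_add_mul_right_left]
      exact Nat.coprime_one_left 5
    · rw [Nat.coprime_add_mul_right_left]
      exact Nat.coprime_one_left T
  have hw : IsUnit (((1 + k * T : ℕ) : ZMod (5 * T))) := (ZMod.isUnit_iff_coprime _ _).2 hcop
  refine ⟨((1 + k * T : ℕ) : ZMod (5 * T)) * u₀, hw.mul hu₀, ?_, ?_⟩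
  · -- `⟨ud⟩ = 3T`: `(1 + kT)·3T = 3T + N·(3kT′)`
    have e : ((1 + k * T : ℕ) : ZMod (5 * T)) * u₀ * d = (((1 + k * T) * (3 * T) : ℕ) : ZMod (5 * T)) := by
      rw [mul_assoc, Nat.cast_mul (1 + k * T), ← hu₀d, ZMod.natCast_zmod_val]
    rw [e, ZMod.val_natCast]
    have h1 : (1 + k * T) * (3 * T) = 3 * T + 5 * T * (3 * k * T') := by
      have : T * T = T * (5 * T') := by rw [← hT']
      nlinarith [this]
    rw [h1, Nat.add_mul_mod_self_left, Nat.mod_eq_of_lt (by omega)]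
  · -- `⟨uy⟩ < T`: `(1 + kT)·⟨z⟩ = f + T(j + k⟨z⟩) = f + N·m` with `⟨z⟩ = f + Tj`, `5 ∣ j + k⟨z⟩`
    have e : ((1 + k * T : ℕ) : ZMod (5 * T)) * u₀ * y = (((1 + k * T) * z.val : ℕ) : ZMod (5 * T)) := by
      rw [mul_assoc, Nat.cast_mul (1 + k * T), ZMod.natCast_zmod_val]
    rw [e, ZMod.val_natCast]
    have hzT : z.val % T + T * (z.val / T) = z.val := Nat.mod_add_div z.val T
    have hfT : z.val % T < T := Nat.mod_lt _ hT0
    obtain ⟨m, hm⟩ := hk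
    have h1 : (1 + k * T) * z.val = z.val % T + 5 * T * m := by
      have h2 : (1 + k * T) * z.val = z.val % T + T * (z.val / T + k * z.val) := by nlinarith [hzT]
      rw [h2, hm]; ring
    have h3 : (z.val % T + 5 * T * m) % (5 * T) = z.val % T := by
      rw [Nat.add_mul_mod_self_left, Nat.mod_eq_of_lt (by omega)]
    rw [h1, h3]
    exact hfT

/-- **Positioned unit, `5² ∤ N`**: `N` prime to `6`, `d ≠ 0` on the class (`T = N/5 = g.c.d.(⟨d⟩, N)`) with `5 ∤ T`, and `y` with
`T ∤ ⟨y⟩`: a unit `u` with **`⟨ud⟩ = 3T` and `⟨uy⟩ < T`** — by the Chinese remainder theorem (`N = 5·T`, `(5, T) = 1`): `u = k·u₀` with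
`k ≡ 1 (mod 5)` (fixing `⟨u₀d⟩ = 3T` and `⟨u₀y⟩ mod 5`) and `k ≡ v·w₁ (mod T)`, where `⟨w₁u₀y⟩_T = g₁ = g.c.d.(⟨u₀y⟩, T)` and
`v ∈ {1, …, 5}` — all units modulo `T`, whose primes are `≥ 7` — is chosen with `vg₁ ≡ ⟨u₀y⟩ (mod 5)`; then `⟨uy⟩ = vg₁ ≤ 5g₁ < 7g₁ ≤ T`.
[cite: KoblitzRohrlich1978, §3 Case 2, Lemma (p. 1195)] -/
theorem exists_isUnit_val_mul_eq_and_lt_of_not_five_dvd (hN2 : Nat.Coprime 2 N) (hN3 : Nat.Coprime 3 N) {d y : ZMod N}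
    (hd : d ≠ 0) {T : ℕ} (hT : Nat.gcd d.val N = T) (h5T : 5 * T = N) (h5 : ¬5 ∣ T) (hy : ¬T ∣ y.val) :
    ∃ u : ZMod N, IsUnit u ∧ (u * d).val = 3 * T ∧ (u * y).val < T := by
  subst h5T
  have hN0 : 5 * T ≠ 0 := NeZero.ne _
  have hT0 : 0 < T := by omega
  haveI : NeZero T := ⟨hT0.ne'⟩
  obtain ⟨u₀, hu₀, hu₀d⟩ := exists_isUnit_val_mul_eq_three_mul hN3 hd hT rfl
  set z := u₀ * y with hz
  have hTN : T ∣ 5 * T := dvd_mul_left T 5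
  have hzT : ¬T ∣ z.val := fun h => hy (dvd_val_of_dvd_val_mul_bs hTN hu₀ h)
  have hT2 : Nat.Coprime 2 T := Nat.Coprime.coprime_dvd_right hTN hN2
  have hT3 : Nat.Coprime 3 T := Nat.Coprime.coprime_dvd_right hTN hN3
  have hT5 : Nat.Coprime 5 T := (Nat.Prime.coprime_iff_not_dvd (by norm_num)).2 h5
  -- modulo `T`: `z̄ ≠ 0`, `g₁ = g.c.d.(⟨z̄⟩, T)`, a unit `w₁` with `⟨w₁z̄⟩ = g₁`, and `7g₁ ≤ T`
  set zT : ZMod T := ((z.val : ℕ) : ZMod T) with hzTdef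
  have hzT0 : zT ≠ 0 := fun h => hzT ((ZMod.natCast_eq_zero_iff _ _).1 h)
  obtain ⟨w₁, hw₁, hg₁⟩ := exists_isUnit_val_mul_eq_gcd hzT0
  set g₁ := Nat.gcd zT.val T with hg₁def
  have hg0 : 0 < g₁ := Nat.gcd_pos_of_pos_left T (Nat.pos_of_ne_zero fun h => hzT0 ((ZMod.val_eq_zero zT).1 h))
  have hg5 : g₁ % 5 ≠ 0 := fun h => h5 (dvd_trans (Nat.dvd_of_mod_eq_zero h) (Nat.gcd_dvd_right _ _))
  obtain ⟨Y, hY⟩ : g₁ ∣ T := Nat.gcd_dvd_right _ _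
  have hY1 : Y ≠ 1 := fun h => by
    rw [h, mul_one] at hY
    have hdz : T ∣ zT.val := (dvd_of_eq hY).trans (Nat.gcd_dvd_left zT.val T)
    exact hzT0 ((ZMod.val_eq_zero zT).1 (Nat.eq_zero_of_dvd_of_lt hdz (ZMod.val_lt zT)))
  have h7g : 7 * g₁ ≤ T := by
    have h7Y : 7 ≤ Y := seven_le_of_dvd_bs hT0 hT2 hT3 hT5 ⟨g₁, by rw [hY, mul_comm]⟩ hY1
    calc 7 * g₁ = g₁ * 7 := mul_comm _ _
      _ ≤ g₁ * Y := Nat.mul_le_mul_left g₁ h7Y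
      _ = T := hY.symm
  -- `v ∈ {1,…,5}` with `vg₁ ≡ ⟨z⟩ (mod 5)`; `a = ⟨v·w₁⟩_T` is prime to `T`
  obtain ⟨v, hv1, hv5, hv⟩ := exists_mul_mod_five_eq_bs g₁ z.val hg5
  have hvT : Nat.Coprime v T := by
    interval_cases v
    · exact Nat.coprime_one_left T
    · exact hT2
    · exact hT3
    · exact (show (4 : ℕ) = 2 * 2 by norm_num) ▸ Nat.Coprime.mul_left hT2 hT2
    · exact hT5
  set a : ℕ := ((v : ZMod T) * w₁).val with ha
  have haT : Nat.Coprime a T := (isUnit_iff_val_coprime_bs _).1 (((ZMod.isUnit_iff_coprime v T).2 hvT).mul hw₁)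
  -- CRT: `k ≡ 1 (mod 5)`, `k ≡ a (mod T)`; `k` is prime to `N = 5T`
  obtain ⟨k, hk5, hkT⟩ := Nat.chineseRemainder hT5 1 a
  have hkN : Nat.Coprime k (5 * T) := by
    refine Nat.Coprime.mul_right ?_ ?_
    · have h1 : Nat.gcd 5 k = 1 := by rw [Nat.gcd_rec, (hk5 : k % 5 = 1 % 5)]; norm_num
      exact Nat.Coprime.symm h1
    · have h1 : Nat.gcd T k = 1 := by rw [Nat.gcd_rec, (hkT : k % T = a % T), ← Nat.gcd_rec]; exact haT.symm
      exact Nat.Coprime.symm h1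
  have hw : IsUnit ((k : ℕ) : ZMod (5 * T)) := (ZMod.isUnit_iff_coprime k (5 * T)).2 hkN
  refine ⟨(k : ZMod (5 * T)) * u₀, hw.mul hu₀, ?_, ?_⟩
  · -- `⟨ud⟩ = 3T`: `k·3T ≡ 3T (mod 5T)` as `k ≡ 1 (mod 5)`
    have e : ((k : ℕ) : ZMod (5 * T)) * u₀ * d = ((k * (3 * T) : ℕ) : ZMod (5 * T)) := by
      rw [mul_assoc, Nat.cast_mul, ← hu₀d, ZMod.natCast_zmod_val]
    rw [e, ZMod.val_natCast]
    have h1 : k * (3 * T) ≡ 1 * (3 * T) [MOD 5 * (3 * T)] := Nat.ModEq.mul_right' _ hk5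
    have h2 : k * (3 * T) ≡ 3 * T [MOD 5 * T] := by
      rw [one_mul, show 5 * (3 * T) = 5 * T * 3 by ring] at h1
      exact Nat.ModEq.of_mul_right 3 h1
    rw [(h2 : k * (3 * T) % (5 * T) = 3 * T % (5 * T)), Nat.mod_eq_of_lt (by omega)]
  · -- `⟨uy⟩ = vg₁ < T`: `k⟨z⟩ ≡ vg₁` modulo `5` and modulo `T`
    have e : ((k : ℕ) : ZMod (5 * T)) * u₀ * y = ((k * z.val : ℕ) : ZMod (5 * T)) := by
      rw [mul_assoc, Nat.cast_mul, ZMod.natCast_zmod_val]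
    rw [e, ZMod.val_natCast]
    have hm5 : k * z.val ≡ v * g₁ [MOD 5] := by
      have h1 : k * z.val ≡ 1 * z.val [MOD 5] := Nat.ModEq.mul_right _ hk5
      rw [one_mul] at h1
      exact h1.trans ((hv : v * g₁ ≡ z.val [MOD 5]).symm)
    have hmT : k * z.val ≡ v * g₁ [MOD T] := by
      have h1 : k * z.val ≡ a * z.val [MOD T] := Nat.ModEq.mul_right _ hkT
      refine h1.trans ?_
      rw [← ZMod.natCast_eq_natCast_iff]
      push_cast
      have h2 : w₁ * zT = ((g₁ : ℕ) : ZMod T) := by rw [← hg₁, ZMod.natCast_zmod_val]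
      rw [ha, ZMod.natCast_zmod_val, mul_assoc, ← hzTdef, h2]
    have hmN : k * z.val ≡ v * g₁ [MOD 5 * T] := (Nat.modEq_and_modEq_iff_modEq_mul hT5).1 ⟨hm5, hmT⟩
    have hlt : v * g₁ < T :=
      calc v * g₁ ≤ 5 * g₁ := Nat.mul_le_mul_right _ hv5
        _ < 7 * g₁ := by omega
        _ ≤ T := h7g
    rw [(hmN : k * z.val % (5 * T) = v * g₁ % (5 * T)), Nat.mod_eq_of_lt (by omega)]
    exact hlt

end Positioned

/-! ## §2 CASE 2 AT `p = 7` IN FULL: `7 ∣ ⟨r⟩, ⟨r′⟩`, `H_τ = H_{τ′}` ⟹ `r = r′` at every `N = 7Q` prime to `6` -/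

section SevenTwo

variable {Q : ℕ} [NeZero (7 * Q)]

omit [NeZero (7 * Q)] in
/-- `p ∤ ⟨x⟩`, `h` a unit ⟹ `p ∤ ⟨hx⟩` modulo `N = pQ`. [folklore] -/
private theorem not_dvd_val_mul_bs {p : ℕ} [NeZero (p * Q)] (hp : p.Prime) {h : ZMod (p * Q)} (hh : IsUnit h)
    (x : ZMod (p * Q)) (hx : ¬p ∣ x.val) : ¬p ∣ (h * x).val := by
  intro hd
  rw [ZMod.val_mul, Nat.dvd_mod_iff (dvd_mul_right p Q)] at hd
  rcases (Nat.Prime.dvd_mul hp).1 hd with h1 | h1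
  · have hc := (isUnit_iff_val_coprime_bs h).1 hh
    exact (Nat.Prime.coprime_iff_not_dvd hp).1 (Nat.Coprime.coprime_dvd_right (dvd_mul_right p Q) hc).symm h1
  · exact hx h1

omit [NeZero (7 * Q)] in
/-- `p·(x mod Q) + p ≤ pQ` for `Q > 0`. [folklore] -/
private theorem mul_mod_add_le_bs {p : ℕ} (hQ : 0 < Q) (x : ℕ) : p * (x % Q) + p ≤ p * Q := by
  have := Nat.mod_lt x hQ
  calc p * (x % Q) + p = p * (x % Q + 1) := by ring
    _ ≤ p * Q := Nat.mul_le_mul_left p this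

/-- **The contradiction from a positioned unit** (K–R's (5) at `p = 7` on the class): for admissible primitive `τ, τ′` with `H_τ = H_{τ′}`,
`7 ∣ ⟨r⟩, ⟨r′⟩`, and a unit `u` with `⟨u(r − r′)⟩ = 3T` (`5T = N`) and `⟨ur′⟩ < 2T`, there is NO wrap: `⟨ur⟩ = ⟨ur′⟩ + 3N/5`, so the orbit
sums over `uP` (sibling `orbit_sum_compare`: they differ by `E − E′` with `|E − E′| ≤ N`, the `s, t` parts by `< 2N`) cannot absorb
`7·(⟨ur⟩ − ⟨ur′⟩) = 21N/5 > 3N`. [cite: KoblitzRohrlich1978, §3 Proposition, Case 2 (pp. 1195–1196, (5)–(6))] -/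
private theorem false_of_positioned_unit_bs {r s t r' s' t' : ZMod (7 * Q)} (hr : r ≠ 0) (hrst : r + s + t = 0) (hr' : r' ≠ 0)
    (hrst' : r' + s' + t' = 0)
    (hprim : ∀ q : ℕ, q.Prime → q ∣ 7 * Q → ¬(q ∣ r.val ∧ q ∣ s.val ∧ q ∣ t.val))
    (hprim' : ∀ q : ℕ, q.Prime → q ∣ 7 * Q → ¬(q ∣ r'.val ∧ q ∣ s'.val ∧ q ∣ t'.val))
    (h7r : 7 ∣ r.val) (h7r' : 7 ∣ r'.val) (hEq : fermatCMType (7 * Q) r s t = fermatCMType (7 * Q) r' s' t')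
    {u : ZMod (7 * Q)} (hu : IsUnit u) {T : ℕ} (h5T : 5 * T = 7 * Q) (hD : (u * (r - r')).val = 3 * T)
    (hlt : (u * r').val < 2 * T) : False := by
  have h7 : (7 : ℕ).Prime := by norm_num
  have hN0 : 0 < 7 * Q := Nat.pos_of_ne_zero (NeZero.ne _)
  have hQ0 : 0 < Q := by omega
  have h7s : ¬7 ∣ s.val := fun h => hprim 7 h7 (dvd_mul_right 7 Q) ⟨h7r, h, (dvd_val_iff_of_add_eq_zero hrst h7r).1 h⟩
  have h7t : ¬7 ∣ t.val := fun h => h7s ((dvd_val_iff_of_add_eq_zero hrst h7r).2 h)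
  have h7s' : ¬7 ∣ s'.val := fun h => hprim' 7 h7 (dvd_mul_right 7 Q) ⟨h7r', h, (dvd_val_iff_of_add_eq_zero hrst' h7r').1 h⟩
  have h7t' : ¬7 ∣ t'.val := fun h => h7s' ((dvd_val_iff_of_add_eq_zero hrst' h7r').2 h)
  have hsplit : (u * r).val = (u * r').val + (u * (r - r')).val ∨
      (u * r).val + 7 * Q = (u * r').val + (u * (r - r')).val := by
    have e : u * r = u * r' + u * (r - r') := by ring
    rcases Nat.lt_or_ge ((u * r').val + (u * (r - r')).val) (7 * Q) with h | h
    · left; rw [e, ZMod.val_add_of_lt h]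
    · right; rw [e]; exact (ZMod.val_add_val_of_le h).symm
  obtain ⟨E, E', hcmp, hE, -⟩ := orbit_sum_compare h7 hr hrst hr' hrst' hprim hprim' hEq hu
  simp only [sum_add_distrib] at hcmp
  have hTr := sum_val_orbit_mul_of_dvd u r h7r
  have hTr' := sum_val_orbit_mul_of_dvd u r' h7r'
  have hTs := two_mul_sum_val_orbit_mul h7 u s (not_dvd_val_mul_bs h7 hu s h7s)
  have hTt := two_mul_sum_val_orbit_mul h7 u t (not_dvd_val_mul_bs h7 hu t h7t)
  have hTs' := two_mul_sum_val_orbit_mul h7 u s' (not_dvd_val_mul_bs h7 hu s' h7s')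
  have hTt' := two_mul_sum_val_orbit_mul h7 u t' (not_dvd_val_mul_bs h7 hu t' h7t')
  have hs₀' := mul_mod_add_le_bs (p := 7) hQ0 (u * s').val
  have ht₀' := mul_mod_add_le_bs (p := 7) hQ0 (u * t').val
  have hnn₁ := Nat.zero_le (7 * ((u * s).val % Q))
  have hnn₂ := Nat.zero_le (7 * ((u * t).val % Q))
  rcases hsplit with e | e <;> rcases hE with ⟨rfl, rfl⟩ | ⟨hE1, hE2, hE1', hE2'⟩ <;> linarith

/-- **KOBLITZ–ROHRLICH §3 PROPOSITION, CASE 2 AT `p = 7`, IN FULL** ("There exists a prime `p` dividing `N, r, r′` but not dividing `sts′t′`;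
and `r ≠ r′`. … By the lemma applied with `x = r, y = r′`, if we multiply through by a suitable `u ∈ (ℤ/Nℤ)*`, without loss of generality
we may assume that `|⌊r/(N/p)⌋ − ⌊r′/(N/p)⌋| ≥ ν + 2`, which contradicts (6)", pp. 1195–1196): at every level `N = 7Q` prime to `6`, for
admissible primitive triples `τ = (r, s, t)`, `τ′ = (r′, s′, t′)` (all six entries non-zero) with `H_τ = H_{τ′}`, `7 ∣ ⟨r⟩` and `7 ∣ ⟨r′⟩`
force **`r = r′`** — with no hypothesis on `ν` or on `5`.  Off the residue class `r ≡ r′ (mod N/5)` this is the sibling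
`eq_of_fermatCMType_eq_of_dvd_of_dvd_of_seven_le` (gen 39).  On the class (`5 ∣ N`, `T = N/5 = g.c.d.(⟨r − r′⟩, N)`): if `5 ∣ T` and
`5 ∤ ⟨r′⟩` (or `5 ∤ ⟨r⟩`), or `5 ∤ T` and `T ∤ ⟨r′⟩`, the positioned unit of §1 contradicts (5) (`false_of_positioned_unit_bs`); if `5 ∣ T`
and `5 ∣ ⟨r⟩, ⟨r′⟩`, this is Case 2 at `p = 5` with `5² ∣ N` (sibling, `ν = 0`); if `5 ∤ T` and `T ∣ ⟨r⟩, ⟨r′⟩`, every prime `q` of `T`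
divides `r, r′` and not `s, t, s′, t′`, so Case 2 at a prime `q ≥ 11` of `T`, or at `7` when `7² ∣ N`, gives `r = r′`, and otherwise
`T = 7`, `N = 35`, where the tree's kernel enumeration `multiset_eq_of_fermatCMType_eq_thirtyFive` (K–R: "easily checked by hand")
decides. [cite: KoblitzRohrlich1978, §3 Proposition, Case 2 (pp. 1195–1196)] -/
theorem eq_of_fermatCMType_eq_of_seven_dvd_of_dvd (hN2 : Nat.Coprime 2 (7 * Q)) (hN3 : Nat.Coprime 3 (7 * Q))
    {r s t r' s' t' : ZMod (7 * Q)} (hr : r ≠ 0) (hs : s ≠ 0) (ht : t ≠ 0) (hrst : r + s + t = 0)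
    (hr' : r' ≠ 0) (hs' : s' ≠ 0) (ht' : t' ≠ 0) (hrst' : r' + s' + t' = 0)
    (hprim : ∀ q : ℕ, q.Prime → q ∣ 7 * Q → ¬(q ∣ r.val ∧ q ∣ s.val ∧ q ∣ t.val))
    (hprim' : ∀ q : ℕ, q.Prime → q ∣ 7 * Q → ¬(q ∣ r'.val ∧ q ∣ s'.val ∧ q ∣ t'.val))
    (h7r : 7 ∣ r.val) (h7r' : 7 ∣ r'.val) (hEq : fermatCMType (7 * Q) r s t = fermatCMType (7 * Q) r' s' t') : r = r' := by
  by_contra hne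
  have h7 : (7 : ℕ).Prime := by norm_num
  have h5p : (5 : ℕ).Prime := by norm_num
  have hN0 : 0 < 7 * Q := Nat.pos_of_ne_zero (NeZero.ne _)
  -- off the class `r ≡ r′ (mod N/5)`: the near-half unit (sibling, gen 39)
  by_cases hcl : 5 * Nat.gcd (r - r').val (7 * Q) = 7 * Q
  swap
  · exact hne (eq_of_fermatCMType_eq_of_dvd_of_dvd_of_seven_le h7 le_rfl hN2 hN3 hr hrst hr' hrst' hprim hprim' h7r h7r' hcl hEq)
  -- on the class: `T = N/5`
  set T := Nat.gcd (r - r').val (7 * Q) with hTdef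
  have hd : r - r' ≠ 0 := sub_ne_zero.2 hne
  have hTN : T ∣ 7 * Q := Nat.gcd_dvd_right _ _
  have hTd : T ∣ (r - r').val := Nat.gcd_dvd_left _ _
  have h7s' : ¬7 ∣ s'.val := fun h => hprim' 7 h7 (dvd_mul_right 7 Q) ⟨h7r', h, (dvd_val_iff_of_add_eq_zero hrst' h7r').1 h⟩
  have h7t' : ¬7 ∣ t'.val := fun h => h7s' ((dvd_val_iff_of_add_eq_zero hrst' h7r').2 h)
  -- `r` is not `s′` or `t′` (they are prime to `7`), so "`r ∈ {r′, s′, t′}`" means `r = r′`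
  have hexcl : (r = r' ∨ r = s' ∨ r = t') → False := fun h =>
    h.elim hne fun h => h.elim (fun h => h7s' (h ▸ h7r)) fun h => h7t' (h ▸ h7r)
  by_cases h5T : 5 ∣ T
  · -- `5² ∣ N`
    have h25 : 5 * 5 ∣ 7 * Q := by rw [← hcl]; exact Nat.mul_dvd_mul_left 5 h5T
    have h5N : 5 ∣ 7 * Q := dvd_trans (dvd_mul_left 5 5) h25
    by_cases h5r' : 5 ∣ r'.val
    · by_cases h5r : 5 ∣ r.val
      · -- `5 ∣ r, r′`: Case 2 at `p = 5` with `ν = 0` (sibling)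
        exact hexcl (eq_or_eq_or_eq_of_fermatCMType_eq_of_dvd_level h5p le_rfl h5N (Or.inl h25) hN2 hN3 hr hrst hr' hs' ht'
          hrst' hprim hprim' h5r hEq)
      · -- `5 ∤ r`: position `r` below `T` along `d = r′ − r` and exchange the triples
        have hT' : Nat.gcd (r' - r).val (7 * Q) = T := by rw [← neg_sub, gcd_val_neg_bs]
        obtain ⟨u, hu, hD, hlt⟩ :=
          exists_isUnit_val_mul_eq_and_lt_of_five_dvd hN3 (sub_ne_zero.2 (Ne.symm hne)) hT' hcl h5T h5r
        exact false_of_positioned_unit_bs hr' hrst' hr hrst hprim' hprim h7r' h7r hEq.symm hu hcl hD (by omega)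
    · obtain ⟨u, hu, hD, hlt⟩ := exists_isUnit_val_mul_eq_and_lt_of_five_dvd hN3 hd rfl hcl h5T h5r'
      exact false_of_positioned_unit_bs hr hrst hr' hrst' hprim hprim' h7r h7r' hEq hu hcl hD (by omega)
  · -- `5² ∤ N`
    by_cases hTr' : T ∣ r'.val
    · -- `T ∣ r` as well; Case 2 at the primes of `T`
      have hTr : T ∣ r.val := by
        have h1 : ((r - r') + r').val = ((r - r').val + r'.val) % (7 * Q) := ZMod.val_add _ _
        rw [sub_add_cancel] at h1
        rw [h1, Nat.dvd_mod_iff hTN]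
        exact dvd_add hTd hTr'
      have hexq : ∀ q : ℕ, q.Prime → q ∣ T → (r = r' ∨ r = s' ∨ r = t') → False := by
        intro q hq hqT h
        have hqN : q ∣ 7 * Q := dvd_trans hqT hTN
        have hqr : q ∣ r.val := dvd_trans hqT hTr
        have hqr' : q ∣ r'.val := dvd_trans hqT hTr'
        rcases h with h | h | h
        · exact hne h
        · exact hprim' q hq hqN ⟨hqr', h ▸ hqr, dvd_val_of_add_eq_zero_bs hqN hrst' hqr' (h ▸ hqr)⟩
        · exact hprim' q hq hqN ⟨hqr', dvd_val_of_add_eq_zero_bs hqN (show r' + t' + s' = 0 by rw [← hrst']; ring) hqr' (h ▸ hqr),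
            h ▸ hqr⟩
      by_cases hbig : ∃ q : ℕ, q.Prime ∧ q ∣ T ∧ 11 ≤ q
      · obtain ⟨q, hq, hqT, hq11⟩ := hbig
        exact hexq q hq hqT (eq_or_eq_or_eq_of_fermatCMType_eq_of_dvd_level hq (by omega) (dvd_trans hqT hTN) (Or.inr hq11)
          hN2 hN3 hr hrst hr' hs' ht' hrst' hprim hprim' (dvd_trans hqT hTr) hEq)
      by_cases h49 : 7 * 7 ∣ 7 * Q
      · exact hexcl (eq_or_eq_or_eq_of_fermatCMType_eq_of_dvd_level h7 (by norm_num) (dvd_mul_right 7 Q) (Or.inl h49)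
          hN2 hN3 hr hrst hr' hs' ht' hrst' hprim hprim' h7r hEq)
      -- all primes of `T` are `7`, `7² ∤ T`, `7 ∣ T`: `T = 7`, `N = 35`
      have h7d : 7 ∣ (r - r').val :=
        dvd_val_of_add_eq_zero_bs (dvd_mul_right 7 Q) (show r' + -r + (r - r') = 0 by ring) h7r'
          (by rw [ZMod.neg_val, if_neg hr]; exact Nat.dvd_sub (dvd_mul_right 7 Q) h7r)
      have h7T : 7 ∣ T := Nat.dvd_gcd h7d (dvd_mul_right 7 Q)
      obtain ⟨m, hm⟩ := h7T
      have hm1 : m = 1 := by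
        refine Nat.eq_one_iff_not_exists_prime_dvd.2 fun q hq hqm => ?_
        have hqT : q ∣ T := by rw [hm]; exact dvd_mul_of_dvd_right hqm 7
        have hqN : q ∣ 7 * Q := dvd_trans hqT hTN
        have hq2 : q ≠ 2 := fun h => by rw [h] at hqN; exact absurd (Nat.Coprime.eq_one_of_dvd hN2 hqN) (by norm_num)
        have hq3 : q ≠ 3 := fun h => by rw [h] at hqN; exact absurd (Nat.Coprime.eq_one_of_dvd hN3 hqN) (by norm_num)
        have hq5 : q ≠ 5 := fun h => h5T (h ▸ hqT)
        have hq7 : q ≠ 7 := fun h => h49 (dvd_trans (by rw [hm]; exact Nat.mul_dvd_mul_left 7 (h ▸ hqm)) hTN)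
        have hq11 : q < 11 := by by_contra h11; exact hbig ⟨q, hq, hqT, by omega⟩
        have := hq.two_le
        interval_cases q <;> first | omega | exact absurd hq (by norm_num)
      have hQ5 : Q = 5 := by rw [hm, hm1] at hcl; omega
      subst hQ5
      -- at `N = 35`: `τ′` has a unit entry (`7 ∤ s′, t′`; primitivity at `5`), and the enumeration makes `τ′` a permutation of `τ`
      have hu35 : ∀ x : ZMod (7 * 5), ¬7 ∣ x.val → ¬5 ∣ x.val → IsUnit x := fun x h7x h5x =>
        (isUnit_iff_val_coprime_bs x).2
          (Nat.Coprime.mul_right ((Nat.Prime.coprime_iff_not_dvd h7).2 h7x).symm ((Nat.Prime.coprime_iff_not_dvd h5p).2 h5x).symm)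
      have hunit : IsUnit s' ∨ IsUnit t' := by
        by_contra hno
        push Not at hno
        have h5s' : 5 ∣ s'.val := by_contra fun h => hno.1 (hu35 s' h7s' h)
        have h5t' : 5 ∣ t'.val := by_contra fun h => hno.2 (hu35 t' h7t' h)
        exact hprim' 5 h5p (dvd_mul_left 5 7)
          ⟨dvd_val_of_add_eq_zero_bs (dvd_mul_left 5 7) (show s' + t' + r' = 0 by rw [← hrst']; ring) h5s' h5t', h5s', h5t'⟩
      have hm35 : ({r', s', t'} : Multiset (ZMod (7 * 5))) = {r, s, t} :=
        multiset_eq_of_fermatCMType_eq_thirtyFive hr hs ht hrst hr' hs' ht' hrst' (Or.inr (Or.inr (Or.inr (Or.inr hunit)))) hEq.symm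
      have hmem : r ∈ ({r', s', t'} : Multiset (ZMod (7 * 5))) := by rw [hm35]; simp
      simp only [Multiset.insert_eq_cons, Multiset.mem_cons, Multiset.mem_singleton] at hmem
      exact hexcl hmem
    · -- `T ∤ r′`: the positioned unit of §1 (CRT)
      obtain ⟨u, hu, hD, hlt⟩ := exists_isUnit_val_mul_eq_and_lt_of_not_five_dvd hN2 hN3 hd rfl hcl h5T hTr'
      exact false_of_positioned_unit_bs hr hrst hr' hrst' hprim hprim' h7r h7r' hEq hu hcl hD (by omega)

/-- **Case 2 at `p = 7`, general-level form**: `N` prime to `6`, `7 ∣ N`, admissible primitive `τ, τ′` (six non-zero entries), `H_τ = H_{τ′}`,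
`7 ∣ ⟨r⟩, ⟨r′⟩` ⟹ `r = r′`. [cite: KoblitzRohrlich1978, §3 Proposition, Case 2 (pp. 1195–1196)] -/
theorem eq_of_fermatCMType_eq_of_seven_dvd_of_dvd_level {N : ℕ} [NeZero N] (hN2 : Nat.Coprime 2 N) (hN3 : Nat.Coprime 3 N)
    (h7N : 7 ∣ N) {r s t r' s' t' : ZMod N} (hr : r ≠ 0) (hs : s ≠ 0) (ht : t ≠ 0) (hrst : r + s + t = 0)
    (hr' : r' ≠ 0) (hs' : s' ≠ 0) (ht' : t' ≠ 0) (hrst' : r' + s' + t' = 0)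
    (hprim : ∀ q : ℕ, q.Prime → q ∣ N → ¬(q ∣ r.val ∧ q ∣ s.val ∧ q ∣ t.val))
    (hprim' : ∀ q : ℕ, q.Prime → q ∣ N → ¬(q ∣ r'.val ∧ q ∣ s'.val ∧ q ∣ t'.val))
    (h7r : 7 ∣ r.val) (h7r' : 7 ∣ r'.val) (hEq : fermatCMType N r s t = fermatCMType N r' s' t') : r = r' := by
  obtain ⟨Q, rfl⟩ := h7N
  exact eq_of_fermatCMType_eq_of_seven_dvd_of_dvd hN2 hN3 hr hs ht hrst hr' hs' ht' hrst' hprim hprim' h7r h7r' hEq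

end SevenTwo

/-! ## §3 THE PROPOSITION AT EVERY LEVEL `N` PRIME TO `6` NOT EXACTLY DIVISIBLE BY `5` (`5 ∤ N` or `5² ∣ N`): no regime clause -/

section Assembly

variable {Q : ℕ} [NeZero (7 * Q)]

/-- `H_{(a,b,c)} = H_{(b,a,c)}`. [cite: KoblitzRohrlich1978, §1 (p. 1184: "`H_{r,s,t}` depends on `{r, s, t}` only up to permutation")] -/
private theorem fermatCMType_swap₁₂_bs {m : ℕ} [NeZero m] (a b c : ZMod m) : fermatCMType m a b c = fermatCMType m b a c := by
  ext x; simp only [fermatCMType, mem_filter, mem_univ, true_and]; constructor <;> rintro ⟨h1, h2⟩ <;> exact ⟨h1, by omega⟩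

/-- `H_{(a,b,c)} = H_{(c,b,a)}`. [cite: KoblitzRohrlich1978, §1 (p. 1184)] -/
private theorem fermatCMType_swap₁₃_bs {m : ℕ} [NeZero m] (a b c : ZMod m) : fermatCMType m a b c = fermatCMType m c b a := by
  ext x; simp only [fermatCMType, mem_filter, mem_univ, true_and]; constructor <;> rintro ⟨h1, h2⟩ <;> exact ⟨h1, by omega⟩

/-- `H_{(a,b,c)} = H_{(a,c,b)}`. [cite: KoblitzRohrlich1978, §1 (p. 1184)] -/
private theorem fermatCMType_swap₂₃_bs {m : ℕ} [NeZero m] (a b c : ZMod m) : fermatCMType m a b c = fermatCMType m a c b := by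
  ext x; simp only [fermatCMType, mem_filter, mem_univ, true_and]; constructor <;> rintro ⟨h1, h2⟩ <;> exact ⟨h1, by omega⟩

/-- **A boundary entry at `7` matches, at every `N = 7Q` prime to `6`** (Cases 2 and 3 at `p = 7`, both now complete): admissible primitive
`τ, τ′` (six non-zero entries), `H_τ = H_{τ′}`, `7 ∣ ⟨r⟩` ⟹ **`r = r′ ∨ r = s′ ∨ r = t′`** — Case 3 (`7 ∤ r′s′t′` is impossible) is the
sibling `fermatCMType_ne_of_seven_dvd_of_not_dvd` (gen 39), Case 2 is §2 applied to the suitably permuted `τ′`.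
[cite: KoblitzRohrlich1978, §3 Proposition, Cases 2–3 (pp. 1195–1197)] -/
theorem eq_or_eq_or_eq_of_fermatCMType_eq_of_seven_dvd (hN2 : Nat.Coprime 2 (7 * Q)) (hN3 : Nat.Coprime 3 (7 * Q))
    {r s t r' s' t' : ZMod (7 * Q)} (hr : r ≠ 0) (hs : s ≠ 0) (ht : t ≠ 0) (hrst : r + s + t = 0)
    (hr' : r' ≠ 0) (hs' : s' ≠ 0) (ht' : t' ≠ 0) (hrst' : r' + s' + t' = 0)
    (hprim : ∀ q : ℕ, q.Prime → q ∣ 7 * Q → ¬(q ∣ r.val ∧ q ∣ s.val ∧ q ∣ t.val))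
    (hprim' : ∀ q : ℕ, q.Prime → q ∣ 7 * Q → ¬(q ∣ r'.val ∧ q ∣ s'.val ∧ q ∣ t'.val))
    (h7r : 7 ∣ r.val) (hEq : fermatCMType (7 * Q) r s t = fermatCMType (7 * Q) r' s' t') : r = r' ∨ r = s' ∨ r = t' := by
  by_cases h1 : 7 ∣ r'.val
  · exact Or.inl (eq_of_fermatCMType_eq_of_seven_dvd_of_dvd hN2 hN3 hr hs ht hrst hr' hs' ht' hrst' hprim hprim' h7r h1 hEq)
  by_cases h2 : 7 ∣ s'.val
  · exact Or.inr (Or.inl (eq_of_fermatCMType_eq_of_seven_dvd_of_dvd hN2 hN3 hr hs ht hrst hs' hr' ht'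
      (by rw [add_comm s' r']; exact hrst') hprim (fun q hq hqN h => hprim' q hq hqN ⟨h.2.1, h.1, h.2.2⟩) h7r h2
      (hEq.trans (fermatCMType_swap₁₂_bs r' s' t'))))
  by_cases h3 : 7 ∣ t'.val
  · exact Or.inr (Or.inr (eq_of_fermatCMType_eq_of_seven_dvd_of_dvd hN2 hN3 hr hs ht hrst ht' hs' hr'
      (by rw [show t' + s' + r' = r' + s' + t' by ring]; exact hrst') hprim (fun q hq hqN h => hprim' q hq hqN ⟨h.2.2, h.2.1, h.1⟩)
      h7r h3 (hEq.trans (fermatCMType_swap₁₃_bs r' s' t'))))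
  exact absurd hEq (fermatCMType_ne_of_seven_dvd_of_not_dvd hN2 hN3 hr hs ht hrst hr' hs' ht' hrst' hprim hprim' h7r h1 h2 h3)

variable {N : ℕ} [NeZero N]

omit [NeZero N] in
/-- Every prime divisor of an `N` prime to `6` is `≥ 5`. [folklore] -/
private theorem five_le_of_prime_dvd_bs (hN2 : Nat.Coprime 2 N) (hN3 : Nat.Coprime 3 N) {p : ℕ} (hp : p.Prime) (hpN : p ∣ N) :
    5 ≤ p := by
  have h2 : p ≠ 2 := fun h => by rw [h] at hpN; exact absurd (Nat.Coprime.eq_one_of_dvd hN2 hpN) (by norm_num)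
  have h3 : p ≠ 3 := fun h => by rw [h] at hpN; exact absurd (Nat.Coprime.eq_one_of_dvd hN3 hpN) (by norm_num)
  have h4 : p ≠ 4 := fun h => by rw [h] at hp; exact absurd hp (by decide)
  have := hp.two_le
  omega

omit [NeZero N] in
/-- A prime `≥ 5` other than `5` and `7` is `≥ 11`. [folklore] -/
private theorem eleven_le_of_ne_bs {q : ℕ} (hq : q.Prime) (hq5 : 5 ≤ q) (hne5 : q ≠ 5) (hne7 : q ≠ 7) : 11 ≤ q := by
  have h6 : q ≠ 6 := fun h => by rw [h] at hq; exact absurd hq (by decide)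
  have h8 : q ≠ 8 := fun h => by rw [h] at hq; exact absurd hq (by decide)
  have h9 : q ≠ 9 := fun h => by rw [h] at hq; exact absurd hq (by decide)
  have h10 : q ≠ 10 := fun h => by rw [h] at hq; exact absurd hq (by decide)
  omega

omit [NeZero (7 * Q)] in
/-- **A boundary entry matches, at every level `N` prime to `6` with `5 ∤ N` or `5² ∣ N`** (no regime clause on the prime): for a prime
`p ∣ N` with `p ∣ ⟨r⟩`, admissible primitive `τ, τ′` (six non-zero entries) and `H_τ = H_{τ′}`: **`r = r′ ∨ r = s′ ∨ r = t′`** —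
`p = 5` forces `5² ∣ N` (`ν = 0`, sibling §5), `p = 7` is the preceding theorem, `p ≥ 11` is the sibling §5.  The only boundary
configuration of K–R's Proposition NOT covered in the tree is thus `p = 5` with `5 ∥ N` (K–R's "`N = 5N₀, 5 ∤ N₀`", p. 1196, and the
omitted "tedious examination" with (10), p. 1197). [cite: KoblitzRohrlich1978, §3 Proposition, Cases 2–3 (pp. 1195–1197)] -/
theorem eq_or_eq_or_eq_of_fermatCMType_eq_of_dvd_of_not_five_or_sq (hN2 : Nat.Coprime 2 N) (hN3 : Nat.Coprime 3 N)
    (h5 : ¬5 ∣ N ∨ 5 * 5 ∣ N) {p : ℕ} (hp : p.Prime) (hpN : p ∣ N) {r s t r' s' t' : ZMod N}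
    (hr : r ≠ 0) (hs : s ≠ 0) (ht : t ≠ 0) (hrst : r + s + t = 0) (hr' : r' ≠ 0) (hs' : s' ≠ 0) (ht' : t' ≠ 0) (hrst' : r' + s' + t' = 0)
    (hprim : ∀ q : ℕ, q.Prime → q ∣ N → ¬(q ∣ r.val ∧ q ∣ s.val ∧ q ∣ t.val))
    (hprim' : ∀ q : ℕ, q.Prime → q ∣ N → ¬(q ∣ r'.val ∧ q ∣ s'.val ∧ q ∣ t'.val))
    (hpr : p ∣ r.val) (hEq : fermatCMType N r s t = fermatCMType N r' s' t') : r = r' ∨ r = s' ∨ r = t' := by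
  have hp5 : 5 ≤ p := five_le_of_prime_dvd_bs hN2 hN3 hp hpN
  by_cases hp5' : p = 5
  · subst hp5'
    have h25 : 5 * 5 ∣ N := h5.resolve_left (not_not.2 hpN)
    exact eq_or_eq_or_eq_of_fermatCMType_eq_of_dvd_level hp le_rfl hpN (Or.inl h25) hN2 hN3 hr hrst hr' hs' ht' hrst' hprim hprim'
      hpr hEq
  by_cases hp7 : p = 7
  · subst hp7
    obtain ⟨Q, rfl⟩ := hpN
    exact eq_or_eq_or_eq_of_fermatCMType_eq_of_seven_dvd hN2 hN3 hr hs ht hrst hr' hs' ht' hrst' hprim hprim' hpr hEq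
  exact eq_or_eq_or_eq_of_fermatCMType_eq_of_dvd_level hp hp5 hpN (Or.inr (eleven_le_of_ne_bs hp hp5 hp5' hp7)) hN2 hN3 hr hrst hr'
    hs' ht' hrst' hprim hprim' hpr hEq

omit [NeZero (7 * Q)] in
/-- The matched form at such levels: `r = r′` and a prime `p ∣ N` dividing `⟨s⟩` ⟹ `{r, s, t} = {r′, s′, t′}` ("In the case that `r = r′`
…, suppose further that `N` is not prime to `sts′t′` … Then `τ′` is a permutation of `τ`").
[cite: KoblitzRohrlich1978, §3 Proposition (p. 1193), Cases 2–3 (pp. 1195–1197)] -/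
theorem multiset_eq_of_fermatCMType_eq_of_eq_of_dvd_of_not_five_or_sq (hN2 : Nat.Coprime 2 N) (hN3 : Nat.Coprime 3 N)
    (h5 : ¬5 ∣ N ∨ 5 * 5 ∣ N) {p : ℕ} (hp : p.Prime) (hpN : p ∣ N) {r s t r' s' t' : ZMod N}
    (hr : r ≠ 0) (hs : s ≠ 0) (ht : t ≠ 0) (hrst : r + s + t = 0) (hr' : r' ≠ 0) (hs' : s' ≠ 0) (ht' : t' ≠ 0) (hrst' : r' + s' + t' = 0)
    (hprim : ∀ q : ℕ, q.Prime → q ∣ N → ¬(q ∣ r.val ∧ q ∣ s.val ∧ q ∣ t.val))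
    (hprim' : ∀ q : ℕ, q.Prime → q ∣ N → ¬(q ∣ r'.val ∧ q ∣ s'.val ∧ q ∣ t'.val))
    (hEq : fermatCMType N r s t = fermatCMType N r' s' t') (hrr' : r = r') (hps : p ∣ s.val) :
    ({r, s, t} : Multiset (ZMod N)) = {r', s', t'} := by
  have hstr : s + t + r = 0 := by rw [show s + t + r = r + s + t by ring]; exact hrst
  have hEq₁ : fermatCMType N s t r = fermatCMType N r' s' t' :=
    ((fermatCMType_swap₁₃_bs s t r).trans (fermatCMType_swap₂₃_bs r t s)).trans hEq
  rcases eq_or_eq_or_eq_of_fermatCMType_eq_of_dvd_of_not_five_or_sq hN2 hN3 h5 hp hpN hs ht hr hstr hr' hs' ht' hrst'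
      (fun q hq hqN h => hprim q hq hqN ⟨h.2.2, h.1, h.2.1⟩) hprim' hps hEq₁ with h | h | h
  · have hpr : p ∣ r.val := by rw [hrr', ← h]; exact hps
    exact absurd ⟨hpr, hps, dvd_val_of_add_eq_zero_bs hpN hrst hpr hps⟩ (hprim p hp hpN)
  · subst hrr' h
    have htt' : t = t' := by linear_combination hrst - hrst'
    rw [htt']
  · subst hrr' h
    have hts' : t = s' := by linear_combination hrst - hrst'
    rw [hts', Multiset.pair_comm]

omit [NeZero (7 * Q)] in
/-- **KOBLITZ–ROHRLICH §3 PROPOSITION AT EVERY LEVEL `N` PRIME TO `6` WITH `5 ∤ N` OR `5² ∣ N`, NO REGIME CLAUSE**: for admissible primitive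
`τ = (r, s, t)`, `τ′ = (r′, s′, t′)` modulo `N` (non-zero entries, `r + s + t = 0 = r′ + s′ + t′`, no prime of `N` dividing all of `⟨r⟩, ⟨s⟩,
⟨t⟩`, resp. `⟨r′⟩, ⟨s′⟩, ⟨t′⟩`) with `H_τ = H_{τ′}`, a prime of `N` dividing `⟨r⟩` ("`N` is not prime to `rstr′s′t′`") and a prime of `N`
dividing `⟨s⟩` or `⟨t⟩` ("in the case that `r = r′` for some ordering …, `N` is not prime to `sts′t′`"): **`{r, s, t} = {r′, s′, t′}`** —
"`τ′` is a permutation of `τ`".  (The variant in which the second prime divides the two unmatched entries of `τ′` is this theorem with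
`τ, τ′` exchanged.)  This supersedes the siblings' regime forms (`p² ∣ N ∨ p ≥ 11`, gen 39 §5; `N` prime to `30`, gen 39 §10); the one level
shape still outside the tree is `5 ∥ N`. [cite: KoblitzRohrlich1978, §3 Proposition (p. 1193), Cases 1–3 (pp. 1193–1197)] -/
theorem multiset_eq_of_fermatCMType_eq_of_dvd_of_dvd_of_not_five_or_sq (hN2 : Nat.Coprime 2 N) (hN3 : Nat.Coprime 3 N)
    (h5 : ¬5 ∣ N ∨ 5 * 5 ∣ N) {p : ℕ} (hp : p.Prime) (hpN : p ∣ N) {q : ℕ} (hq : q.Prime) (hqN : q ∣ N) {r s t r' s' t' : ZMod N}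
    (hr : r ≠ 0) (hs : s ≠ 0) (ht : t ≠ 0) (hrst : r + s + t = 0) (hr' : r' ≠ 0) (hs' : s' ≠ 0) (ht' : t' ≠ 0) (hrst' : r' + s' + t' = 0)
    (hprim : ∀ q : ℕ, q.Prime → q ∣ N → ¬(q ∣ r.val ∧ q ∣ s.val ∧ q ∣ t.val))
    (hprim' : ∀ q : ℕ, q.Prime → q ∣ N → ¬(q ∣ r'.val ∧ q ∣ s'.val ∧ q ∣ t'.val))
    (hEq : fermatCMType N r s t = fermatCMType N r' s' t') (hpr : p ∣ r.val) (hqst : q ∣ s.val ∨ q ∣ t.val) :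
    ({r, s, t} : Multiset (ZMod N)) = {r', s', t'} := by
  -- Step 1 (Cases 2–3 at `p`): `r` is an entry of `τ′`; permute `τ′` so that it comes first
  obtain ⟨r₁, s₁, t₁, hr₁, hs₁, ht₁, hrst₁, hprim₁, hEq', hperm, hrr₁⟩ : ∃ r₁ s₁ t₁ : ZMod N, r₁ ≠ 0 ∧ s₁ ≠ 0 ∧ t₁ ≠ 0 ∧
      r₁ + s₁ + t₁ = 0 ∧ (∀ q : ℕ, q.Prime → q ∣ N → ¬(q ∣ r₁.val ∧ q ∣ s₁.val ∧ q ∣ t₁.val)) ∧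
      fermatCMType N r s t = fermatCMType N r₁ s₁ t₁ ∧ ({r₁, s₁, t₁} : Multiset (ZMod N)) = {r', s', t'} ∧ r = r₁ := by
    rcases eq_or_eq_or_eq_of_fermatCMType_eq_of_dvd_of_not_five_or_sq hN2 hN3 h5 hp hpN hr hs ht hrst hr' hs' ht' hrst' hprim
      hprim' hpr hEq with h | h | h
    · exact ⟨r', s', t', hr', hs', ht', hrst', hprim', hEq, rfl, h⟩
    · exact ⟨s', r', t', hs', hr', ht', by rw [add_comm s' r']; exact hrst', fun q hq hqN h' => hprim' q hq hqN ⟨h'.2.1, h'.1, h'.2.2⟩,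
        hEq.trans (fermatCMType_swap₁₂_bs r' s' t'), Multiset.cons_swap s' r' {t'}, h⟩
    · exact ⟨t', s', r', ht', hs', hr', by rw [show t' + s' + r' = r' + s' + t' by ring]; exact hrst',
        fun q hq hqN h' => hprim' q hq hqN ⟨h'.2.2, h'.2.1, h'.1⟩, hEq.trans (fermatCMType_swap₁₃_bs r' s' t'),
        calc ({t', s', r'} : Multiset (ZMod N)) = {t', r', s'} := by rw [Multiset.pair_comm s' r']
          _ = {r', t', s'} := Multiset.cons_swap t' r' {s'}
          _ = {r', s', t'} := by rw [Multiset.pair_comm t' s'], h⟩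
  rw [← hperm]
  -- Step 2 (Cases 2–3 at `q`): the second boundary prime matches the rest
  rcases hqst with hqs | hqt
  · exact multiset_eq_of_fermatCMType_eq_of_eq_of_dvd_of_not_five_or_sq hN2 hN3 h5 hq hqN hr hs ht hrst hr₁ hs₁ ht₁ hrst₁ hprim
      hprim₁ hEq' hrr₁ hqs
  · have h := multiset_eq_of_fermatCMType_eq_of_eq_of_dvd_of_not_five_or_sq hN2 hN3 h5 hq hqN hr ht hs
      (by rw [show r + t + s = r + s + t by ring]; exact hrst) hr₁ hs₁ ht₁ hrst₁ (fun q hq hqN h' => hprim q hq hqN ⟨h'.1, h'.2.2, h'.2.1⟩)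
      hprim₁ ((fermatCMType_swap₂₃_bs r t s).trans hEq') hrr₁ hqt
    rw [← h, Multiset.pair_comm]

omit [NeZero (7 * Q)] in
/-- **The Proposition with its printed hypotheses at such levels**: `2, 3 ∤ N` and `5 ∤ N ∨ 5² ∣ N`; "g.c.d.`(r, s, t, r′, s′, t′) = 1`" (no
prime of `N` divides all six representatives; under `H_τ = H_{τ′}` Case 1 makes both triples primitive, sibling
`primitive_of_fermatCMType_eq_of_gcd_six`), "`N` not prime to `rstr′s′t′`" (a prime of `N` divides `⟨r⟩`), "in the case `r = r′` …, `N` not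
prime to `sts′t′`" (a prime of `N` divides `⟨s⟩` or `⟨t⟩`), `H_τ = H_{τ′}` ⟹ **`{r, s, t} = {r′, s′, t′}`**.
[cite: KoblitzRohrlich1978, §3 Proposition (p. 1193), Cases 1–3 (pp. 1193–1197)] -/
theorem multiset_eq_of_fermatCMType_eq_of_gcd_six_of_not_five_or_sq (hN2 : Nat.Coprime 2 N) (hN3 : Nat.Coprime 3 N)
    (h5 : ¬5 ∣ N ∨ 5 * 5 ∣ N) {p : ℕ} (hp : p.Prime) (hpN : p ∣ N) {q : ℕ} (hq : q.Prime) (hqN : q ∣ N) {r s t r' s' t' : ZMod N}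
    (hr : r ≠ 0) (hs : s ≠ 0) (ht : t ≠ 0) (hrst : r + s + t = 0) (hr' : r' ≠ 0) (hs' : s' ≠ 0) (ht' : t' ≠ 0) (hrst' : r' + s' + t' = 0)
    (hsix : ∀ q : ℕ, q.Prime → q ∣ N → ¬(q ∣ r.val ∧ q ∣ s.val ∧ q ∣ t.val ∧ q ∣ r'.val ∧ q ∣ s'.val ∧ q ∣ t'.val))
    (hpr : p ∣ r.val) (hqst : q ∣ s.val ∨ q ∣ t.val) (hEq : fermatCMType N r s t = fermatCMType N r' s' t') :
    ({r, s, t} : Multiset (ZMod N)) = {r', s', t'} := by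
  obtain ⟨hprim, hprim'⟩ := primitive_of_fermatCMType_eq_of_gcd_six hN2 hN3 hr hs ht hrst hr' hs' ht' hrst' hsix hEq
  exact multiset_eq_of_fermatCMType_eq_of_dvd_of_dvd_of_not_five_or_sq hN2 hN3 h5 hp hpN hq hqN hr hs ht hrst hr' hs' ht' hrst' hprim
    hprim' hEq hpr hqst

/-! ### On abelian varieties: Theorem 1 (ii) for boundary triples at such levels -/

/-- `p`-divisibility of representatives is invariant under unit multiples (`p ∣ N`). [folklore] -/
private theorem dvd_val_mul_iff_of_isUnit_bs {p : ℕ} (hpN : p ∣ N) {u : ZMod N} (hu : IsUnit u) (x : ZMod N) :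
    p ∣ (u * x).val ↔ p ∣ x.val := by
  refine ⟨dvd_val_of_dvd_val_mul_bs hpN hu, fun h => ?_⟩
  rw [ZMod.val_mul]
  exact (Nat.dvd_mod_iff hpN).2 (dvd_mul_of_dvd_right h _)

open Literature.AlgebraicGeometry.Motives (AbelianVariety)
open Literature.AlgebraicGeometry.HodgeTheory (complexBetti)
open Literature.AlgebraicGeometry.Pohlmann1968.Cyclotomic (cmTypeOfResidues)
open CyclotomicCMTypeResidueSets (IsCMResidueSet)
open NumberField

variable {L : Type} [Field L] [NumberField L] [IsCyclotomicExtension {N} ℚ L]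
  {A A' : AbelianVariety ℂ} {ι : 𝓞 L →+* CategoryTheory.End A} {θ : L →+* Module.End ℂ (complexBetti A.X 1)}
  {ι' : 𝓞 L →+* CategoryTheory.End A'} {θ' : L →+* Module.End ℂ (complexBetti A'.X 1)}

omit [NeZero (7 * Q)] in
/-- **THEOREM 1 (ii) FOR BOUNDARY TRIPLES AT EVERY `N` PRIME TO `6` WITH `5 ∤ N` OR `5² ∣ N`, ON ABELIAN VARIETIES** ("The only isogenies
between the lattices `L_{r,s,t}` are the obvious equalities"): realisations `A`, `A′` of the full-level types `Φ_{H_τ}`, `Φ_{H_{τ′}}` of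
`ℚ(ζ_N)` (`τ, τ′` admissible primitive, a prime of `N` dividing `⟨r⟩`, a prime of `N` dividing `⟨s⟩` or `⟨t⟩`) are ISOGENOUS **iff
`{r′, s′, t′} = {ur, us, ut}` for a unit `u`** (Shimura–Taniyama: `A ∼ A′ ⟺ H_{τ′} = H_{uτ}`, tree `isIsogenous_fermatCMType_iff_exists_eq_mul`;
then the Proposition for `uτ`). [cite: KoblitzRohrlich1978, Theorem 1 (ii) (p. 1185), §3 Proposition (pp. 1193–1197)]
[cite: Shimura1998, §6.1 Corollary and §8.4 Example (1)] -/
theorem isIsogenous_iff_exists_unit_multiset_eq_of_not_five_or_sq [IsCMField L] (hN2 : Nat.Coprime 2 N) (hN3 : Nat.Coprime 3 N)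
    (h5 : ¬5 ∣ N ∨ 5 * 5 ∣ N) {p : ℕ} (hp : p.Prime) (hpN : p ∣ N) {q : ℕ} (hq : q.Prime) (hqN : q ∣ N) {r s t r' s' t' : ZMod N}
    (hr : r ≠ 0) (hs : s ≠ 0) (ht : t ≠ 0) (hrst : r + s + t = 0) (hr' : r' ≠ 0) (hs' : s' ≠ 0) (ht' : t' ≠ 0) (hrst' : r' + s' + t' = 0)
    (hprim : ∀ q : ℕ, q.Prime → q ∣ N → ¬(q ∣ r.val ∧ q ∣ s.val ∧ q ∣ t.val))
    (hprim' : ∀ q : ℕ, q.Prime → q ∣ N → ¬(q ∣ r'.val ∧ q ∣ s'.val ∧ q ∣ t'.val))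
    (hpr : p ∣ r.val) (hqst : q ∣ s.val ∨ q ∣ t.val)
    (hS : IsCMResidueSet N (fermatCMType N r s t)) (hS' : IsCMResidueSet N (fermatCMType N r' s' t'))
    (hA : IsCMTypeRealisation (cmTypeOfResidues (L := L) (fermatCMType N r s t) hS.cm) A ι θ)
    (hA' : IsCMTypeRealisation (cmTypeOfResidues (L := L) (fermatCMType N r' s' t') hS'.cm) A' ι' θ') :
    AbelianVariety.IsIsogenous A A' ↔ ∃ u : ZMod N, IsUnit u ∧ ({r', s', t'} : Multiset (ZMod N)) = {u * r, u * s, u * t} := by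
  rw [isIsogenous_fermatCMType_iff_exists_eq_mul hS hS' hA hA']
  refine ⟨fun ⟨u, hu, hEq⟩ => ⟨u, hu, ?_⟩, fun ⟨u, hu, h⟩ => ⟨u, hu, fermatCMType_eq_of_multiset_eq h⟩⟩
  have hur : u * r ≠ 0 := fun h => hr (hu.mul_right_eq_zero.1 h)
  have hus : u * s ≠ 0 := fun h => hs (hu.mul_right_eq_zero.1 h)
  have hut : u * t ≠ 0 := fun h => ht (hu.mul_right_eq_zero.1 h)
  have hsum : u * r + u * s + u * t = 0 := by rw [← mul_add, ← mul_add, hrst, mul_zero]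
  have hprimu : ∀ q : ℕ, q.Prime → q ∣ N → ¬(q ∣ (u * r).val ∧ q ∣ (u * s).val ∧ q ∣ (u * t).val) := fun q hq hqN h =>
    hprim q hq hqN ⟨(dvd_val_mul_iff_of_isUnit_bs hqN hu r).1 h.1, (dvd_val_mul_iff_of_isUnit_bs hqN hu s).1 h.2.1,
      (dvd_val_mul_iff_of_isUnit_bs hqN hu t).1 h.2.2⟩
  exact (multiset_eq_of_fermatCMType_eq_of_dvd_of_dvd_of_not_five_or_sq hN2 hN3 h5 hp hpN hq hqN hur hus hut hsum hr' hs' ht' hrst'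
    hprimu hprim' hEq.symm ((dvd_val_mul_iff_of_isUnit_bs hpN hu r).2 hpr)
    (hqst.imp (fun h => (dvd_val_mul_iff_of_isUnit_bs hqN hu s).2 h) fun h => (dvd_val_mul_iff_of_isUnit_bs hqN hu t).2 h)).symm

end Assembly

/-! ## §4 K–R's omitted LEMMA (p. 1195), first part, AS PRINTED — in the regimes `p = 5`, `p ≥ 11`, `p = 7` off the class, and on the
class under the hypotheses of §1: a unit `u` with `|⌊⟨ux⟩/(N/p)⌋ − ⌊⟨uy⟩/(N/p)⌋| ≥ 3` (`≥ 2` if `p = 5`) -/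

section FloorSeparation

/-- `b + kM ≤ a ⟹ ⌊b/M⌋ + k ≤ ⌊a/M⌋`. [folklore] -/
private theorem div_add_le_div_bs {M : ℕ} (hM : 0 < M) {a b k : ℕ} (h : b + k * M ≤ a) : b / M + k ≤ a / M :=
  calc b / M + k = (b + k * M) / M := (Nat.add_mul_div_right b k hM).symm
    _ ≤ a / M := Nat.div_le_div_right h

/-- **K–R's LEMMA at `p = 5`** ("LEMMA. Let `2, 3 ∤ N`, `1 ≤ x, y < N`, `x ≠ y`, `p | N`. Then there exists `u ∈ (ℤ/Nℤ)*` such that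
`|⌊⟨ux⟩/(N/p)⌋ − ⌊⟨uy⟩/(N/p)⌋| ≥ 3` if `p > 5`, `≥ 2` if `p = 5`", p. 1195, proof omitted there): at `N = 5M` prime to `6`, for `x ≠ y`
a unit `u` with **`⌊⟨ux⟩/M⌋ ≥ ⌊⟨uy⟩/M⌋ + 2` or `⌊⟨uy⟩/M⌋ ≥ ⌊⟨ux⟩/M⌋ + 2`** — the Case-1 unit with `2N/5 ≤ ⟨u(x − y)⟩ ≤ 3N/5` (sibling
`exists_isUnit_val_mul_mem_middle`) puts `⟨ux⟩` and `⟨uy⟩` at distance `≥ 2M`. [cite: KoblitzRohrlich1978, §3 Case 2, Lemma (p. 1195)] -/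
theorem exists_isUnit_div_separation_five {M : ℕ} [NeZero (5 * M)] (hN2 : Nat.Coprime 2 (5 * M)) (hN3 : Nat.Coprime 3 (5 * M))
    {x y : ZMod (5 * M)} (hxy : x ≠ y) :
    ∃ u : ZMod (5 * M), IsUnit u ∧ ((u * y).val / M + 2 ≤ (u * x).val / M ∨ (u * x).val / M + 2 ≤ (u * y).val / M) := by
  have hN0 : 0 < 5 * M := Nat.pos_of_ne_zero (NeZero.ne _)
  have hM : 0 < M := by omega
  obtain ⟨u, hu, h1, h2⟩ := exists_isUnit_val_mul_mem_middle hN2 hN3 (sub_ne_zero.2 hxy)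
  refine ⟨u, hu, ?_⟩
  have e : u * x = u * y + u * (x - y) := by ring
  rcases Nat.lt_or_ge ((u * y).val + (u * (x - y)).val) (5 * M) with h | h
  · left
    have h3 : (u * x).val = (u * y).val + (u * (x - y)).val := by rw [e, ZMod.val_add_of_lt h]
    exact div_add_le_div_bs hM (by linarith)
  · right
    have h3 : (u * x).val + 5 * M = (u * y).val + (u * (x - y)).val := by rw [e]; exact (ZMod.val_add_val_of_le h).symm
    exact div_add_le_div_bs hM (by linarith)

/-- **K–R's LEMMA for `p ≥ 7` in the regimes `p ≥ 11` or `x ≢ y (mod N/5)`** (same citation): at `N = pM` prime to `6`, `p ≥ 7`, for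
`x ≠ y` with `p ≥ 11` or `5·g.c.d.(⟨x − y⟩, N) ≠ N`, a unit `u` with **`⌊⟨ux⟩/M⌋ ≥ ⌊⟨uy⟩/M⌋ + 3` or `⌊⟨uy⟩/M⌋ ≥ ⌊⟨ux⟩/M⌋ + 3`** — a unit
with `3M ≤ ⟨u(x − y)⟩ ≤ N − 3M` (the Case-1 unit `[2N/5, 3N/5]` when `p ≥ 11`; the near-half unit `[3N/7, N/2]` of the sibling
`exists_isUnit_val_mul_near_half` when `N/g.c.d. ≥ 7`).  The residue class `x ≡ y (mod N/5)` at `p = 7` is the next theorem.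
[cite: KoblitzRohrlich1978, §3 Case 2, Lemma (p. 1195)] -/
theorem exists_isUnit_div_separation_of_seven_le {p M : ℕ} [NeZero (p * M)] (hp7 : 7 ≤ p) (hN2 : Nat.Coprime 2 (p * M))
    (hN3 : Nat.Coprime 3 (p * M)) {x y : ZMod (p * M)} (hxy : x ≠ y) (hreg : 11 ≤ p ∨ 5 * Nat.gcd (x - y).val (p * M) ≠ p * M) :
    ∃ u : ZMod (p * M), IsUnit u ∧ ((u * y).val / M + 3 ≤ (u * x).val / M ∨ (u * x).val / M + 3 ≤ (u * y).val / M) := by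
  have hN0 : 0 < p * M := Nat.pos_of_ne_zero (NeZero.ne _)
  have hM : 0 < M := Nat.pos_of_ne_zero fun h => by rw [h, mul_zero] at hN0; exact lt_irrefl 0 hN0
  have hpM := Nat.mul_le_mul_right M hp7
  -- a unit with `3M ≤ ⟨u(x − y)⟩ ≤ N − 3M`
  obtain ⟨u, hu, hlo, hhi⟩ : ∃ u : ZMod (p * M), IsUnit u ∧ 3 * M ≤ (u * (x - y)).val ∧ (u * (x - y)).val + 3 * M ≤ p * M := by
    rcases hreg with h11 | h5
    · obtain ⟨u, hu, h1, h2⟩ := exists_isUnit_val_mul_mem_middle hN2 hN3 (sub_ne_zero.2 hxy)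
      have h11M := Nat.mul_le_mul_right M h11
      exact ⟨u, hu, by linarith, by linarith⟩
    · obtain ⟨u, hu, h1, h2⟩ := exists_isUnit_val_mul_near_half hN2 hN3 (sub_ne_zero.2 hxy) h5
      exact ⟨u, hu, by linarith, by linarith⟩
  refine ⟨u, hu, ?_⟩
  have e : u * x = u * y + u * (x - y) := by ring
  rcases Nat.lt_or_ge ((u * y).val + (u * (x - y)).val) (p * M) with h | h
  · left
    have h3 : (u * x).val = (u * y).val + (u * (x - y)).val := by rw [e, ZMod.val_add_of_lt h]
    exact div_add_le_div_bs hM (by linarith)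
  · right
    have h3 : (u * x).val + p * M = (u * y).val + (u * (x - y)).val := by rw [e]; exact (ZMod.val_add_val_of_le h).symm
    exact div_add_le_div_bs hM (by linarith)

/-- **K–R's LEMMA at `p = 7` ON the class `x ≡ y (mod N/5)`, under the hypotheses of §1** (same citation): at `N = 7M` prime to `6` with
`5·g.c.d.(⟨x − y⟩, N) = N` (`T = N/5`), if `5 ∣ T` and `5 ∤ ⟨y⟩`, or `5 ∤ T` and `T ∤ ⟨y⟩`, the positioned unit `u` of §1 (`⟨u(x − y)⟩ = 3T`,
`⟨uy⟩ < T`) gives `⟨ux⟩ = ⟨uy⟩ + 3N/5` without wrap, hence **`⌊⟨ux⟩/M⌋ ≥ ⌊⟨uy⟩/M⌋ + 3`** (indeed `+ 4`, as `3N/5 = 21M/5`).  NOT covered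
(honest column): `5 ∣ T` with `5 ∣ ⟨x⟩, ⟨y⟩` (descends to level `N/5`) and `5 ∤ T` with `T ∣ ⟨x⟩, ⟨y⟩` (`x, y ∈ {T, 2T, 3T, 4T}`, by the
digits `1, 2, 4, 5` of these). [cite: KoblitzRohrlich1978, §3 Case 2, Lemma (p. 1195)] -/
theorem exists_isUnit_div_separation_seven_of_class {M : ℕ} [NeZero (7 * M)] (hN2 : Nat.Coprime 2 (7 * M))
    (hN3 : Nat.Coprime 3 (7 * M)) {x y : ZMod (7 * M)} (hxy : x ≠ y) {T : ℕ} (hT : Nat.gcd (x - y).val (7 * M) = T)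
    (h5T : 5 * T = 7 * M) (hy : (5 ∣ T ∧ ¬5 ∣ y.val) ∨ (¬5 ∣ T ∧ ¬T ∣ y.val)) :
    ∃ u : ZMod (7 * M), IsUnit u ∧ (u * y).val / M + 3 ≤ (u * x).val / M := by
  have hN0 : 0 < 7 * M := Nat.pos_of_ne_zero (NeZero.ne _)
  have hM : 0 < M := by omega
  obtain ⟨u, hu, hD, hlt⟩ : ∃ u : ZMod (7 * M), IsUnit u ∧ (u * (x - y)).val = 3 * T ∧ (u * y).val < T := by
    rcases hy with ⟨h5, hy⟩ | ⟨h5, hy⟩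
    · exact exists_isUnit_val_mul_eq_and_lt_of_five_dvd hN3 (sub_ne_zero.2 hxy) hT h5T h5 hy
    · exact exists_isUnit_val_mul_eq_and_lt_of_not_five_dvd hN2 hN3 (sub_ne_zero.2 hxy) hT h5T h5 hy
  refine ⟨u, hu, ?_⟩
  have e : u * x = u * y + u * (x - y) := by ring
  have h3 : (u * x).val = (u * y).val + (u * (x - y)).val := by rw [e, ZMod.val_add_of_lt (by linarith)]
  exact div_add_le_div_bs hM (by linarith)

end FloorSeparation

/-! ## §5 (v2) K–R's LEMMA (first part) IN FULL for `p > 5`: the class `x ≡ y (mod N/5)` at `p = 7` completed (digits of `T, 2T, 3T, 4T`;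
descent to level `N/5` when `25 ∣ N` and `5 ∣ ⟨x⟩, ⟨y⟩`) -/

section LemmaFull

/-- Arithmetic of the descent `N = 5T`, `⟨x⟩ = 5x₁`, `a ≡ a′ (mod T)`: `⟨ax⟩ = 5·⟨a′x₁⟩_T`. [folklore] -/
private theorem mul_mod_descent_bs {a b n T b₁ a' : ℕ} (hn : n = 5 * T) (hb : b = 5 * b₁) (ha : a % T = a' % T) :
    a * b % n = 5 * (a' * b₁ % T) := by
  subst hn hb
  rw [show a * (5 * b₁) = 5 * (a * b₁) by ring, Nat.mul_mod_mul_left, Nat.mul_mod, ha, ← Nat.mul_mod]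

/-- Arithmetic on the multiples of `T = N/5`: `⟨k·aT⟩ = ((ca) mod 5)·T` for `k ≡ c (mod 5)`. [folklore] -/
private theorem mul_mod_table_bs {k b n T a c : ℕ} (hn : n = 5 * T) (hb : b = a * T) (hk : k % 5 = c % 5) :
    k * b % n = (c * a % 5) * T := by
  subst hn hb
  rw [show k * (a * T) = (k * a) * T by ring, Nat.mul_mod_mul_right, Nat.mul_mod, hk, ← Nat.mul_mod]

/-- The digits `⌊7j/5⌋ = 0, 1, 2, 4, 5` of `0, T, 2T, 3T, 4T` (`T = 7M/5`): two distinct residues mod `5` are carried by a common multiplier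
`c ∈ {1, 2, 3, 4}` to residues whose digits differ by `≥ 3`. [folklore] -/
private theorem digit_table_bs : ∀ a < 5, ∀ b < 5, a ≠ b → ∃ c, c < 5 ∧ 1 ≤ c ∧
    (7 * (c * b % 5) / 5 + 3 ≤ 7 * (c * a % 5) / 5 ∨ 7 * (c * a % 5) / 5 + 3 ≤ 7 * (c * b % 5) / 5) := by
  decide

/-- **K–R's LEMMA (first part) AT `p = 7`, IN FULL** ("Let `2, 3 ∤ N`, `1 ≤ x, y < N`, `x ≠ y`, `p | N`. Then there exists `u ∈ (ℤ/Nℤ)*` such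
that `|⌊⟨ux⟩/(N/p)⌋ − ⌊⟨uy⟩/(N/p)⌋| ≥ 3` if `p > 5`", p. 1195, "whose proof is straightforward and will be omitted"): at every `N = 7M` prime to
`6` and for all `x ≠ y` (zero allowed), a unit `u` with **`⌊⟨ux⟩/M⌋ ≥ ⌊⟨uy⟩/M⌋ + 3` or `⌊⟨uy⟩/M⌋ ≥ ⌊⟨ux⟩/M⌋ + 3`**.  Proof (ours; strong
induction on `M`): off the class `x ≡ y (mod N/5)` §4; on the class (`T = N/5`), by §4/§1 unless both `⟨x⟩, ⟨y⟩` are divisible by `5` (when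
`25 ∣ N`) or by `T` (when `25 ∤ N`); in the latter case `⟨x⟩, ⟨y⟩ ∈ {0, T, …, 4T}` have digits among `0, 1, 2, 4, 5` and a multiplier
`u ≡ c (mod 5)`, `u ≡ 1 (mod T)` separates them (`digit_table_bs`); in the former, `x = 5x₁`, `y = 5y₁` and a unit `u′` for `(x₁, y₁)` at
level `N/5 = 7·(M/5)` (induction) lifts to a unit `u` of level `N` (`ZMod.unitsMap_surjective`) with `⟨ux⟩ = 5⟨u′x₁⟩`, `⌊⟨ux⟩/M⌋ =
⌊⟨u′x₁⟩/(M/5)⌋`. [cite: KoblitzRohrlich1978, §3 Case 2, Lemma (p. 1195)] -/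
theorem exists_isUnit_div_separation_seven : ∀ (M : ℕ) [NeZero (7 * M)], Nat.Coprime 2 (7 * M) → Nat.Coprime 3 (7 * M) →
    ∀ {x y : ZMod (7 * M)}, x ≠ y →
      ∃ u : ZMod (7 * M), IsUnit u ∧ ((u * y).val / M + 3 ≤ (u * x).val / M ∨ (u * x).val / M + 3 ≤ (u * y).val / M) := by
  intro M
  induction M using Nat.strong_induction_on with
  | _ M ih =>
  intro _ hN2 hN3 x y hxy
  have hN0 : 0 < 7 * M := Nat.pos_of_ne_zero (NeZero.ne _)
  -- off the class `x ≡ y (mod N/5)`: §4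
  by_cases hcl : 5 * Nat.gcd (x - y).val (7 * M) = 7 * M
  swap
  · exact exists_isUnit_div_separation_of_seven_le le_rfl hN2 hN3 hxy (Or.inr hcl)
  -- on the class: `g.c.d. = T = 7M′`, `M = 5M′`
  have h7g : 7 ∣ Nat.gcd (x - y).val (7 * M) :=
    Nat.Coprime.dvd_of_dvd_mul_left (by norm_num : Nat.Coprime 7 5) (by rw [hcl]; exact dvd_mul_right 7 M)
  obtain ⟨M', hg⟩ := h7g
  have hM : M = 5 * M' := by omega
  subst hM
  have hM' : 0 < M' := by omega
  have hg' : Nat.gcd (y - x).val (7 * (5 * M')) = 7 * M' := by rw [← neg_sub, gcd_val_neg_bs]; exact hg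
  have h5T : 5 * (7 * M') = 7 * (5 * M') := by ring
  by_cases h5 : 5 ∣ 7 * M'
  · -- `25 ∣ N`
    by_cases hy5 : 5 ∣ y.val
    · by_cases hx5 : 5 ∣ x.val
      · -- descent to level `N/5 = 7M′`
        haveI : NeZero (7 * M') := ⟨by omega⟩
        have hTN : 7 * M' ∣ 7 * (5 * M') := ⟨5, by ring⟩
        have hT2 : Nat.Coprime 2 (7 * M') := Nat.Coprime.coprime_dvd_right hTN hN2
        have hT3 : Nat.Coprime 3 (7 * M') := Nat.Coprime.coprime_dvd_right hTN hN3
        set x₁ := x.val / 5 with hx₁def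
        set y₁ := y.val / 5 with hy₁def
        have hx : x.val = 5 * x₁ := (Nat.mul_div_cancel' hx5).symm
        have hy : y.val = 5 * y₁ := (Nat.mul_div_cancel' hy5).symm
        have hx₁ : x₁ < 7 * M' := by have := ZMod.val_lt x; omega
        have hy₁ : y₁ < 7 * M' := by have := ZMod.val_lt y; omega
        have hx'v : ((x₁ : ℕ) : ZMod (7 * M')).val = x₁ := by rw [ZMod.val_natCast, Nat.mod_eq_of_lt hx₁]
        have hy'v : ((y₁ : ℕ) : ZMod (7 * M')).val = y₁ := by rw [ZMod.val_natCast, Nat.mod_eq_of_lt hy₁]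
        have hx'y' : ((x₁ : ℕ) : ZMod (7 * M')) ≠ ((y₁ : ℕ) : ZMod (7 * M')) := fun h => hxy (by
          have h1 := congrArg ZMod.val h
          rw [hx'v, hy'v] at h1
          exact ZMod.val_injective _ (by rw [hx, hy, h1]))
        obtain ⟨u', hu', hsep⟩ := ih M' (by omega) hT2 hT3 hx'y'
        -- lift `u′` to a unit of level `N`
        obtain ⟨U, hU⟩ := ZMod.unitsMap_surjective hTN hu'.unit
        have hUv : (U : ZMod (7 * (5 * M'))).val % (7 * M') = u'.val % (7 * M') := by
          have h1 : ZMod.castHom hTN (ZMod (7 * M')) (U : ZMod (7 * (5 * M'))) = (hu'.unit : ZMod (7 * M')) := by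
            rw [← hU]; rfl
          rw [IsUnit.unit_spec, ZMod.castHom_apply, ZMod.cast_eq_val] at h1
          have h2 := congrArg ZMod.val h1
          rw [ZMod.val_natCast] at h2
          rw [h2, Nat.mod_eq_of_lt (ZMod.val_lt u')]
        have hUx : ((U : ZMod (7 * (5 * M'))) * x).val = 5 * (u' * ((x₁ : ℕ) : ZMod (7 * M'))).val := by
          rw [ZMod.val_mul, ZMod.val_mul, hx'v]
          exact mul_mod_descent_bs (by ring) hx hUv
        have hUy : ((U : ZMod (7 * (5 * M'))) * y).val = 5 * (u' * ((y₁ : ℕ) : ZMod (7 * M'))).val := by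
          rw [ZMod.val_mul, ZMod.val_mul, hy'v]
          exact mul_mod_descent_bs (by ring) hy hUv
        refine ⟨U, U.isUnit, ?_⟩
        rw [hUx, hUy, Nat.mul_div_mul_left _ _ (by norm_num : 0 < 5), Nat.mul_div_mul_left _ _ (by norm_num : 0 < 5)]
        exact hsep
      · -- `5 ∣ ⟨y⟩`, `5 ∤ ⟨x⟩`: position `x` (exchange the roles)
        obtain ⟨u, hu, h⟩ := exists_isUnit_div_separation_seven_of_class hN2 hN3 (Ne.symm hxy) hg' h5T (Or.inl ⟨h5, hx5⟩)
        exact ⟨u, hu, Or.inr h⟩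
    · obtain ⟨u, hu, h⟩ := exists_isUnit_div_separation_seven_of_class hN2 hN3 hxy hg h5T (Or.inl ⟨h5, hy5⟩)
      exact ⟨u, hu, Or.inl h⟩
  · -- `25 ∤ N`
    by_cases hyT : 7 * M' ∣ y.val
    · by_cases hxT : 7 * M' ∣ x.val
      · -- `⟨x⟩, ⟨y⟩ ∈ {0, T, 2T, 3T, 4T}`: the digit table
        set a := x.val / (7 * M') with hadef
        set b := y.val / (7 * M') with hbdef
        have hx : x.val = a * (7 * M') := (Nat.div_mul_cancel hxT).symm
        have hy : y.val = b * (7 * M') := (Nat.div_mul_cancel hyT).symm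
        have ha : a < 5 := by
          have := ZMod.val_lt x
          by_contra h
          have h5a : 5 * (7 * M') ≤ a * (7 * M') := Nat.mul_le_mul_right _ (by omega)
          omega
        have hb : b < 5 := by
          have := ZMod.val_lt y
          by_contra h
          have h5b : 5 * (7 * M') ≤ b * (7 * M') := Nat.mul_le_mul_right _ (by omega)
          omega
        have hab : a ≠ b := fun h => hxy (ZMod.val_injective _ (by rw [hx, hy, h]))
        obtain ⟨c, hc5, hc1, hsep⟩ := digit_table_bs a ha b hb hab
        have h57 : Nat.Coprime 5 (7 * M') := (Nat.Prime.coprime_iff_not_dvd (by norm_num)).2 h5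
        obtain ⟨k, hk5, hkT⟩ := Nat.chineseRemainder h57 c 1
        have hkN : Nat.Coprime k (7 * (5 * M')) := by
          rw [← h5T]
          refine Nat.Coprime.mul_right ?_ ?_
          · have hc : Nat.gcd 5 c = 1 := by interval_cases c <;> norm_num
            have h1 : Nat.gcd 5 k = 1 := by
              rw [Nat.gcd_rec, (hk5 : k % 5 = c % 5), Nat.mod_eq_of_lt hc5, Nat.gcd_comm]
              exact hc
            exact Nat.Coprime.symm h1
          · have h1 : Nat.gcd (7 * M') k = 1 := by
              rw [Nat.gcd_rec, (hkT : k % (7 * M') = 1 % (7 * M')), ← Nat.gcd_rec]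
              exact Nat.gcd_one_right _
            exact Nat.Coprime.symm h1
        have hu : IsUnit ((k : ℕ) : ZMod (7 * (5 * M'))) := (ZMod.isUnit_iff_coprime k _).2 hkN
        have hkx : (((k : ℕ) : ZMod (7 * (5 * M'))) * x).val = (c * a % 5) * (7 * M') := by
          rw [ZMod.val_mul, ZMod.val_natCast, Nat.mod_mul_mod]
          exact mul_mod_table_bs (by ring) hx hk5
        have hky : (((k : ℕ) : ZMod (7 * (5 * M'))) * y).val = (c * b % 5) * (7 * M') := by
          rw [ZMod.val_mul, ZMod.val_natCast, Nat.mod_mul_mod]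
          exact mul_mod_table_bs (by ring) hy hk5
        have hdig : ∀ j : ℕ, j * (7 * M') / (5 * M') = 7 * j / 5 := fun j => by
          rw [show j * (7 * M') = (7 * j) * M' by ring, Nat.mul_div_mul_right _ _ hM']
        refine ⟨(k : ℕ), hu, ?_⟩
        rw [hkx, hky, hdig, hdig]
        exact hsep
      · obtain ⟨u, hu, h⟩ := exists_isUnit_div_separation_seven_of_class hN2 hN3 (Ne.symm hxy) hg' h5T (Or.inr ⟨h5, hxT⟩)
        exact ⟨u, hu, Or.inr h⟩
    · obtain ⟨u, hu, h⟩ := exists_isUnit_div_separation_seven_of_class hN2 hN3 hxy hg h5T (Or.inr ⟨h5, hyT⟩)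
      exact ⟨u, hu, Or.inl h⟩

/-- **K–R's LEMMA (first part) for every `p > 5`, IN FULL**: at `N = pM` prime to `6`, `p ≥ 7` (then `p = 7` or `p ≥ 11`, as `8, 9, 10` do
not divide an `N` prime to `6`), for all `x ≠ y` a unit `u` with **`|⌊⟨ux⟩/M⌋ − ⌊⟨uy⟩/M⌋| ≥ 3`** (as the disjunction of the two one-sided
inequalities); with `exists_isUnit_div_separation_five` (`p = 5`, `≥ 2`) this is the Lemma's first part as printed, for every `p ∣ N`.
[cite: KoblitzRohrlich1978, §3 Case 2, Lemma (p. 1195)] -/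
theorem exists_isUnit_div_separation {p M : ℕ} [NeZero (p * M)] (hp7 : 7 ≤ p) (hN2 : Nat.Coprime 2 (p * M))
    (hN3 : Nat.Coprime 3 (p * M)) {x y : ZMod (p * M)} (hxy : x ≠ y) :
    ∃ u : ZMod (p * M), IsUnit u ∧ ((u * y).val / M + 3 ≤ (u * x).val / M ∨ (u * x).val / M + 3 ≤ (u * y).val / M) := by
  by_cases h7 : p = 7
  · subst h7
    exact exists_isUnit_div_separation_seven M hN2 hN3 hxy
  have h8 : p ≠ 8 := fun h => by
    subst h; exact absurd (Nat.Coprime.eq_one_of_dvd hN2 (dvd_mul_of_dvd_left (by norm_num : 2 ∣ 8) M)) (by norm_num)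
  have h9 : p ≠ 9 := fun h => by
    subst h; exact absurd (Nat.Coprime.eq_one_of_dvd hN3 (dvd_mul_of_dvd_left (by norm_num : 3 ∣ 9) M)) (by norm_num)
  have h10 : p ≠ 10 := fun h => by
    subst h; exact absurd (Nat.Coprime.eq_one_of_dvd hN2 (dvd_mul_of_dvd_left (by norm_num : 2 ∣ 10) M)) (by norm_num)
  exact exists_isUnit_div_separation_of_seven_le hp7 hN2 hN3 hxy (Or.inl (by omega))

end LemmaFull

/-! ## §6 (v3) K–R's inequality (6) in floor form, CASE 2 FOR `p > 5` BY THE PRINTED ROAD (Lemma + (6)), matching at every boundary prime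
`≥ 7`, and the reduction of Case 2 at `p = 5`, `5 ∥ N` to "g.c.d.`(N, r) = `g.c.d.`(N, r′) = 5`" -/

section PrintedRoad

variable {p Q : ℕ} [NeZero (p * Q)]

/-- `r ≠ 0` with `p ∣ ⟨r⟩` modulo `N = pQ` forces `Q ≥ 2`. [folklore] -/
private theorem two_le_of_dvd_val_bs {r : ZMod (p * Q)} (hr : r ≠ 0) (hpr : p ∣ r.val) : 2 ≤ Q := by
  have h0 : 0 < r.val := Nat.pos_of_ne_zero fun h => hr ((ZMod.val_eq_zero r).1 h)
  have h1 := Nat.le_of_dvd h0 hpr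
  have h2 := ZMod.val_lt r
  by_contra hQ
  push Not at hQ
  interval_cases Q <;> omega

/-- The residues `r₀ + s₀ + t₀` of a primitive admissible triple at a unit `u` (`x₀ = ⟨ux⟩ mod Q`, `N = pQ`, `Q ≥ 2`) add up to `Q` or `2Q`
("`r₀′ + s₀′ + t₀′ = N/p` or `2N/p`", p. 1194; `= 0` is excluded by primitivity: `Q` would divide `⟨r⟩, ⟨s⟩, ⟨t⟩`).
[cite: KoblitzRohrlich1978, §3 Case 1 (p. 1194) and Case 2 (p. 1195, (5)–(6))] -/
private theorem exists_residue_sum_eq_bs {r s t : ZMod (p * Q)} (hrst : r + s + t = 0)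
    (hprim : ∀ q : ℕ, q.Prime → q ∣ p * Q → ¬(q ∣ r.val ∧ q ∣ s.val ∧ q ∣ t.val)) (hQ2 : 2 ≤ Q) {u : ZMod (p * Q)}
    (hu : IsUnit u) : ∃ k, 1 ≤ k ∧ k ≤ 2 ∧ (u * r).val % Q + (u * s).val % Q + (u * t).val % Q = Q * k := by
  have hQ0 : 0 < Q := by omega
  have hQN : Q ∣ p * Q := dvd_mul_left Q p
  have hsum : u * r + u * s + u * t = 0 := by rw [← mul_add, ← mul_add, hrst, mul_zero]
  -- `Q ∣ ⟨ur⟩ + ⟨us⟩ + ⟨ut⟩`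
  have h3 : Q ∣ (u * r).val + (u * s).val + (u * t).val := by
    have h1 : ((u * r + u * s).val + (u * t).val) % (p * Q) = 0 := by rw [← ZMod.val_add, hsum, ZMod.val_zero]
    have h2 : Q ∣ (u * r + u * s).val + (u * t).val := dvd_trans hQN (Nat.dvd_of_mod_eq_zero h1)
    rw [ZMod.val_add] at h2
    have h4 := Nat.mod_add_div ((u * r).val + (u * s).val) (p * Q)
    have h5 : (u * r).val + (u * s).val + (u * t).val =
        ((u * r).val + (u * s).val) % (p * Q) + (u * t).val + (p * Q) * (((u * r).val + (u * s).val) / (p * Q)) := by omega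
    rw [h5]
    exact dvd_add h2 (dvd_mul_of_dvd_left hQN _)
  -- hence `Q ∣ r₀ + s₀ + t₀`
  have h4 : Q ∣ (u * r).val % Q + (u * s).val % Q + (u * t).val % Q :=
    (Nat.modEq_zero_iff_dvd).1 ((((Nat.mod_modEq _ Q).add (Nat.mod_modEq _ Q)).add (Nat.mod_modEq _ Q)).trans
      ((Nat.modEq_zero_iff_dvd).2 h3))
  obtain ⟨k, hk⟩ := h4
  have hr₀ := Nat.mod_lt (u * r).val hQ0
  have hs₀ := Nat.mod_lt (u * s).val hQ0
  have ht₀ := Nat.mod_lt (u * t).val hQ0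
  have hk2 : k ≤ 2 := by
    by_contra h
    have : Q * 3 ≤ Q * k := Nat.mul_le_mul_left Q (by omega)
    omega
  have hk1 : 1 ≤ k := by
    by_contra h
    have hk0 : k = 0 := by omega
    rw [hk0, mul_zero] at hk
    have hQr : Q ∣ r.val := dvd_val_of_dvd_val_mul_bs hQN hu (Nat.dvd_of_mod_eq_zero (by omega))
    have hQs : Q ∣ s.val := dvd_val_of_dvd_val_mul_bs hQN hu (Nat.dvd_of_mod_eq_zero (by omega))
    have hQt : Q ∣ t.val := dvd_val_of_dvd_val_mul_bs hQN hu (Nat.dvd_of_mod_eq_zero (by omega))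
    obtain ⟨q, hq, hqQ⟩ := Nat.exists_prime_and_dvd (by omega : Q ≠ 1)
    exact hprim q hq (dvd_trans hqQ hQN) ⟨dvd_trans hqQ hQr, dvd_trans hqQ hQs, dvd_trans hqQ hQt⟩
  exact ⟨k, hk1, hk2, hk⟩

/-- **K–R's inequality (6), in its floor form** ("(5) `νN ≥ |Σ_{u∈P} ⟨ur⟩ + ⟨us⟩ + ⟨ut⟩ − Σ_{u∈P} ⟨ur′⟩ + ⟨us′⟩ + ⟨ut′⟩| = p|r + s₀ + t₀ − r′ − s₀′
− t₀′| ≥` … (6) `ν + 1 ≥ |⌊r/(N/p)⌋ − ⌊r′/(N/p)⌋|`", p. 1195): in the Case-2 setting — `N = pQ`, `p` prime, `τ, τ′` admissible and primitive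
with `H_τ = H_{τ′}`, `p ∣ ⟨r⟩, ⟨r′⟩` — for EVERY unit `u`: **`|⌊⟨ur⟩/Q⌋ − ⌊⟨ur′⟩/Q⌋| ≤ 2`, and `≤ 1` when `p ∣ Q` (`ν = 0`)**.  Road: the sibling's
`orbit_sum_compare` (the two orbit sums over `uP` differ by `E − E′`, `|E − E′| ≤ N`, `= 0` if `p ∣ Q`) and orbit sums (`Σ⟨u′r⟩ = p⟨ur⟩`,
`2Σ⟨u′s⟩ = 2ps₀ + Q·p(p−1)`), with `⟨ur⟩ = Q⌊⟨ur⟩/Q⌋ + r₀` and `r₀ + s₀ + t₀ ∈ {Q, 2Q}` (`exists_residue_sum_eq_bs`): `N(⌊⟨ur⟩/Q⌋ + k) + E′ =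
N(⌊⟨ur′⟩/Q⌋ + k′) + E`. [cite: KoblitzRohrlich1978, §3 Proposition, Case 2 (p. 1195, (5)–(6))] -/
theorem div_dist_le_of_fermatCMType_eq (hp : p.Prime) {r s t r' s' t' : ZMod (p * Q)} (hr : r ≠ 0) (hrst : r + s + t = 0)
    (hr' : r' ≠ 0) (hrst' : r' + s' + t' = 0) (hprim : ∀ q : ℕ, q.Prime → q ∣ p * Q → ¬(q ∣ r.val ∧ q ∣ s.val ∧ q ∣ t.val))
    (hprim' : ∀ q : ℕ, q.Prime → q ∣ p * Q → ¬(q ∣ r'.val ∧ q ∣ s'.val ∧ q ∣ t'.val)) (hpr : p ∣ r.val) (hpr' : p ∣ r'.val)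
    (hEq : fermatCMType (p * Q) r s t = fermatCMType (p * Q) r' s' t') {u : ZMod (p * Q)} (hu : IsUnit u) :
    ((u * r).val / Q ≤ (u * r').val / Q + 2 ∧ (u * r').val / Q ≤ (u * r).val / Q + 2) ∧
      (p ∣ Q → (u * r).val / Q ≤ (u * r').val / Q + 1 ∧ (u * r').val / Q ≤ (u * r).val / Q + 1) := by
  have hN0 : 0 < p * Q := Nat.pos_of_ne_zero (NeZero.ne _)
  have hQ2 : 2 ≤ Q := two_le_of_dvd_val_bs hr hpr
  have hps : ¬p ∣ s.val := fun h => hprim p hp (dvd_mul_right p Q) ⟨hpr, h, (dvd_val_iff_of_add_eq_zero hrst hpr).1 h⟩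
  have hpt : ¬p ∣ t.val := fun h => hps ((dvd_val_iff_of_add_eq_zero hrst hpr).2 h)
  have hps' : ¬p ∣ s'.val := fun h => hprim' p hp (dvd_mul_right p Q) ⟨hpr', h, (dvd_val_iff_of_add_eq_zero hrst' hpr').1 h⟩
  have hpt' : ¬p ∣ t'.val := fun h => hps' ((dvd_val_iff_of_add_eq_zero hrst' hpr').2 h)
  obtain ⟨E, E', hcmp, hE, hE0⟩ := orbit_sum_compare hp hr hrst hr' hrst' hprim hprim' hEq hu
  simp only [sum_add_distrib] at hcmp
  have hTr := sum_val_orbit_mul_of_dvd u r hpr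
  have hTr' := sum_val_orbit_mul_of_dvd u r' hpr'
  have hTs := two_mul_sum_val_orbit_mul hp u s (not_dvd_val_mul_bs hp hu s hps)
  have hTt := two_mul_sum_val_orbit_mul hp u t (not_dvd_val_mul_bs hp hu t hpt)
  have hTs' := two_mul_sum_val_orbit_mul hp u s' (not_dvd_val_mul_bs hp hu s' hps')
  have hTt' := two_mul_sum_val_orbit_mul hp u t' (not_dvd_val_mul_bs hp hu t' hpt')
  obtain ⟨k, hk1, hk2, hk⟩ := exists_residue_sum_eq_bs hrst hprim hQ2 hu
  obtain ⟨k', hk1', hk2', hk'⟩ := exists_residue_sum_eq_bs hrst' hprim' hQ2 hu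
  -- `p⟨ur⟩ = pQ·D + p·r₀`, `p(r₀ + s₀ + t₀) = pQ·k`
  have hRp : p * (u * r).val = p * Q * ((u * r).val / Q) + p * ((u * r).val % Q) := by
    conv_lhs => rw [← Nat.div_add_mod (u * r).val Q]
    rw [Nat.mul_add, ← mul_assoc]
  have hRp' : p * (u * r').val = p * Q * ((u * r').val / Q) + p * ((u * r').val % Q) := by
    conv_lhs => rw [← Nat.div_add_mod (u * r').val Q]
    rw [Nat.mul_add, ← mul_assoc]
  have hkp : p * ((u * r).val % Q) + p * ((u * s).val % Q) + p * ((u * t).val % Q) = p * Q * k := by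
    rw [← Nat.mul_add, ← Nat.mul_add, hk, mul_assoc]
  have hkp' : p * ((u * r').val % Q) + p * ((u * s').val % Q) + p * ((u * t').val % Q) = p * Q * k' := by
    rw [← Nat.mul_add, ← Nat.mul_add, hk', mul_assoc]
  set D := (u * r).val / Q with hD
  set D' := (u * r').val / Q with hD'
  -- `N(D + k) + E′ = N(D′ + k′) + E`
  have hfin : p * Q * (D + k) + E' = p * Q * (D' + k') + E := by linarith
  refine ⟨?_, fun hpQ => ?_⟩
  · rcases hE with ⟨rfl, rfl⟩ | ⟨hE1, hE2, hE1', hE2'⟩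
    · have h1 : p * Q * (D + k) = p * Q * (D' + k') := by linarith
      have h2 := Nat.eq_of_mul_eq_mul_left hN0 h1
      omega
    · have h1 : p * Q * (D + k) ≤ p * Q * (D' + k' + 1) := by linarith
      have h2 : p * Q * (D' + k') ≤ p * Q * (D + k + 1) := by linarith
      have h3 := Nat.le_of_mul_le_mul_left h1 hN0
      have h4 := Nat.le_of_mul_le_mul_left h2 hN0
      omega
  · obtain ⟨hE1, hE1'⟩ := hE0 hpQ
    subst hE1 hE1'
    have h1 : p * Q * (D + k) = p * Q * (D' + k') := by linarith
    have h2 := Nat.eq_of_mul_eq_mul_left hN0 h1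
    omega

/-- **CASE 2 FOR EVERY `p > 5`, BY THE PRINTED ROAD** ("By the lemma applied with `x = r, y = r′`, if we multiply through by a suitable
`u ∈ (ℤ/Nℤ)*`, without loss of generality we may assume that `|⌊r/(N/p)⌋ − ⌊r′/(N/p)⌋| ≥ ν + 2`, which contradicts (6)", p. 1195): at
`N = pQ` prime to `6`, `p ≥ 7` prime, for admissible primitive `τ, τ′` with `H_τ = H_{τ′}`: `p ∣ ⟨r⟩, ⟨r′⟩ ⟹` **`r = r′`** — §5's Lemma
(`exists_isUnit_div_separation`, `≥ 3`) against (6) (`div_dist_le_of_fermatCMType_eq`, `≤ 2`).  (A second proof of §2 and of the siblings'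
Case-2 theorems for `p ≥ 7`, now uniform in `p` and `ν`.) [cite: KoblitzRohrlich1978, §3 Proposition, Case 2 (pp. 1195–1196)] -/
theorem eq_of_fermatCMType_eq_of_dvd_of_dvd_printed (hp : p.Prime) (hp7 : 7 ≤ p) (hN2 : Nat.Coprime 2 (p * Q))
    (hN3 : Nat.Coprime 3 (p * Q)) {r s t r' s' t' : ZMod (p * Q)} (hr : r ≠ 0) (hrst : r + s + t = 0) (hr' : r' ≠ 0)
    (hrst' : r' + s' + t' = 0) (hprim : ∀ q : ℕ, q.Prime → q ∣ p * Q → ¬(q ∣ r.val ∧ q ∣ s.val ∧ q ∣ t.val))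
    (hprim' : ∀ q : ℕ, q.Prime → q ∣ p * Q → ¬(q ∣ r'.val ∧ q ∣ s'.val ∧ q ∣ t'.val)) (hpr : p ∣ r.val) (hpr' : p ∣ r'.val)
    (hEq : fermatCMType (p * Q) r s t = fermatCMType (p * Q) r' s' t') : r = r' := by
  by_contra hne
  obtain ⟨u, hu, hsep⟩ := exists_isUnit_div_separation hp7 hN2 hN3 hne
  obtain ⟨⟨h1, h2⟩, -⟩ := div_dist_le_of_fermatCMType_eq hp hr hrst hr' hrst' hprim hprim' hpr hpr' hEq hu
  omega

variable {N : ℕ} [NeZero N]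

omit [NeZero (p * Q)] in
/-- **A boundary entry at ANY prime `p ≥ 7` matches, at every level `N` prime to `6`** (no condition at `5`): `p ∣ N` prime, `p ≥ 7`, `p ∣ ⟨r⟩`,
admissible primitive `τ, τ′` (six non-zero entries), `H_τ = H_{τ′}` ⟹ **`r = r′ ∨ r = s′ ∨ r = t′`** (`p = 7`: §3; `p ≥ 11`: sibling §5).
[cite: KoblitzRohrlich1978, §3 Proposition, Cases 2–3 (pp. 1195–1197)] -/
theorem eq_or_eq_or_eq_of_fermatCMType_eq_of_dvd_of_seven_le (hN2 : Nat.Coprime 2 N) (hN3 : Nat.Coprime 3 N) {p : ℕ}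
    (hp : p.Prime) (hp7 : 7 ≤ p) (hpN : p ∣ N) {r s t r' s' t' : ZMod N}
    (hr : r ≠ 0) (hs : s ≠ 0) (ht : t ≠ 0) (hrst : r + s + t = 0) (hr' : r' ≠ 0) (hs' : s' ≠ 0) (ht' : t' ≠ 0) (hrst' : r' + s' + t' = 0)
    (hprim : ∀ q : ℕ, q.Prime → q ∣ N → ¬(q ∣ r.val ∧ q ∣ s.val ∧ q ∣ t.val))
    (hprim' : ∀ q : ℕ, q.Prime → q ∣ N → ¬(q ∣ r'.val ∧ q ∣ s'.val ∧ q ∣ t'.val))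
    (hpr : p ∣ r.val) (hEq : fermatCMType N r s t = fermatCMType N r' s' t') : r = r' ∨ r = s' ∨ r = t' := by
  by_cases h7 : p = 7
  · subst h7
    obtain ⟨Q, rfl⟩ := hpN
    exact eq_or_eq_or_eq_of_fermatCMType_eq_of_seven_dvd hN2 hN3 hr hs ht hrst hr' hs' ht' hrst' hprim hprim' hpr hEq
  exact eq_or_eq_or_eq_of_fermatCMType_eq_of_dvd_level hp (by omega) hpN (Or.inr (eleven_le_of_ne_bs hp (by omega) (by omega) h7))
    hN2 hN3 hr hrst hr' hs' ht' hrst' hprim hprim' hpr hEq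

omit [NeZero (p * Q)] in
/-- One side of the reduction at `p = 5`, `5 ∥ N`: `5 ∣ ⟨r⟩, ⟨r′⟩`, `r ≠ r′` ⟹ `g.c.d.(⟨r⟩, N) = 5`.
[cite: KoblitzRohrlich1978, §3 Proposition, Case 2 at `p = 5` (p. 1196)] -/
private theorem gcd_eq_five_bs (hN2 : Nat.Coprime 2 N) (hN3 : Nat.Coprime 3 N) (h5N : 5 ∣ N) (h25 : ¬5 * 5 ∣ N)
    {r s t r' s' t' : ZMod N} (hr : r ≠ 0) (hs : s ≠ 0) (ht : t ≠ 0) (hrst : r + s + t = 0)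
    (hr' : r' ≠ 0) (hs' : s' ≠ 0) (ht' : t' ≠ 0) (hrst' : r' + s' + t' = 0)
    (hprim : ∀ q : ℕ, q.Prime → q ∣ N → ¬(q ∣ r.val ∧ q ∣ s.val ∧ q ∣ t.val))
    (hprim' : ∀ q : ℕ, q.Prime → q ∣ N → ¬(q ∣ r'.val ∧ q ∣ s'.val ∧ q ∣ t'.val))
    (h5r : 5 ∣ r.val) (h5r' : 5 ∣ r'.val) (hEq : fermatCMType N r s t = fermatCMType N r' s' t') (hne : r ≠ r') :
    Nat.gcd r.val N = 5 := by
  have h5p : (5 : ℕ).Prime := by norm_num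
  have h5s' : ¬5 ∣ s'.val := fun h => hprim' 5 h5p h5N ⟨h5r', h, dvd_val_of_add_eq_zero_bs h5N hrst' h5r' h⟩
  have h5t' : ¬5 ∣ t'.val := fun h =>
    hprim' 5 h5p h5N ⟨h5r', dvd_val_of_add_eq_zero_bs h5N (show r' + t' + s' = 0 by rw [← hrst']; ring) h5r' h, h⟩
  -- no prime `q ≠ 5` divides `g = g.c.d.(⟨r⟩, N)`: it would be `≥ 7` and put `r` among `r′, s′, t′`
  have hq : ∀ q : ℕ, q.Prime → q ∣ Nat.gcd r.val N → q = 5 := by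
    intro q hq hqg
    by_contra hq5
    have hqN : q ∣ N := dvd_trans hqg (Nat.gcd_dvd_right _ _)
    have hq5' : 5 ≤ q := five_le_of_prime_dvd_bs hN2 hN3 hq hqN
    have hq6 : q ≠ 6 := fun h => by rw [h] at hq; exact absurd hq (by decide)
    rcases eq_or_eq_or_eq_of_fermatCMType_eq_of_dvd_of_seven_le hN2 hN3 hq (by omega) hqN hr hs ht hrst hr' hs' ht' hrst' hprim
        hprim' (dvd_trans hqg (Nat.gcd_dvd_left _ _)) hEq with h | h | h
    · exact hne h
    · exact h5s' (h ▸ h5r)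
    · exact h5t' (h ▸ h5r)
  have h5g : 5 ∣ Nat.gcd r.val N := Nat.dvd_gcd h5r h5N
  obtain ⟨m, hm⟩ := h5g
  have hm1 : m = 1 := by
    refine Nat.eq_one_iff_not_exists_prime_dvd.2 fun q hq' hqm => ?_
    have hqg : q ∣ Nat.gcd r.val N := by rw [hm]; exact dvd_mul_of_dvd_right hqm 5
    have := hq q hq' hqg
    subst this
    exact h25 (dvd_trans (by rw [hm]; exact Nat.mul_dvd_mul_left 5 hqm) (Nat.gcd_dvd_right r.val N))
  rw [hm, hm1]

omit [NeZero (p * Q)] in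
/-- **The reduction of Case 2 at `p = 5`, `5 ∥ N`** ("Now suppose `N = 5N₀, 5 ∤ N₀, 5 | r, r′`. If there is another prime `p > 5` with `p | N`
and `p | r` or `p | r′`, we can use either Case 1 or Case 2 for `p > 5` above or Case 3 below. So suppose g.c.d.`(N, r) = `g.c.d.`(N, r′) = 5`",
p. 1196): at `N` prime to `6` with `5 ∣ N`, `25 ∤ N`, for admissible primitive `τ, τ′` (six non-zero entries) with `H_τ = H_{τ′}` and `5 ∣ ⟨r⟩,
⟨r′⟩`: EITHER `r = r′` OR **`g.c.d.(⟨r⟩, N) = g.c.d.(⟨r′⟩, N) = 5`** (the other primes of the g.c.d.'s are `≥ 7` and are matched by the preceding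
theorem).  The remaining sub-case — K–R's use of the Lemma's second part and of (7) — is NOT typed here.
[cite: KoblitzRohrlich1978, §3 Proposition, Case 2 at `p = 5` (p. 1196)] -/
theorem eq_or_gcd_eq_five_of_fermatCMType_eq (hN2 : Nat.Coprime 2 N) (hN3 : Nat.Coprime 3 N) (h5N : 5 ∣ N) (h25 : ¬5 * 5 ∣ N)
    {r s t r' s' t' : ZMod N} (hr : r ≠ 0) (hs : s ≠ 0) (ht : t ≠ 0) (hrst : r + s + t = 0)
    (hr' : r' ≠ 0) (hs' : s' ≠ 0) (ht' : t' ≠ 0) (hrst' : r' + s' + t' = 0)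
    (hprim : ∀ q : ℕ, q.Prime → q ∣ N → ¬(q ∣ r.val ∧ q ∣ s.val ∧ q ∣ t.val))
    (hprim' : ∀ q : ℕ, q.Prime → q ∣ N → ¬(q ∣ r'.val ∧ q ∣ s'.val ∧ q ∣ t'.val))
    (h5r : 5 ∣ r.val) (h5r' : 5 ∣ r'.val) (hEq : fermatCMType N r s t = fermatCMType N r' s' t') :
    r = r' ∨ (Nat.gcd r.val N = 5 ∧ Nat.gcd r'.val N = 5) := by
  by_cases hne : r = r'
  · exact Or.inl hne
  exact Or.inr ⟨gcd_eq_five_bs hN2 hN3 h5N h25 hr hs ht hrst hr' hs' ht' hrst' hprim hprim' h5r h5r' hEq hne,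
    gcd_eq_five_bs hN2 hN3 h5N h25 hr' hs' ht' hrst' hr hs ht hrst hprim' hprim h5r' h5r hEq.symm (Ne.symm hne)⟩

end PrintedRoad

/-! ## §7 (v4) K–R's LEMMA, SECOND PART (p. 1195): `5 ∤ N`, `y` a unit, `y ≠ 1, 2, (N+1)/2` ⟹ a unit `u` with
`|⌊5⟨u⟩/N⌋ − ⌊5⟨uy⟩/N⌋| ≥ 3` (the digits are now fifths of `[0, N)`, `N/5 ∉ ℤ`) -/

section LemmaSecondPart

variable {N : ℕ} [NeZero N]

omit [NeZero N] in
/-- Transfer of a natural-number witness: `u < N` a unit with the digit inequality for `⟨uy⟩ = (u·⟨y⟩) mod N`. [folklore] -/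
private theorem part_two_of_nat_bs {y : ZMod N} (u : ℕ) (huN : u < N) (hU : IsUnit ((u : ℕ) : ZMod N))
    (h : 5 * (u * y.val % N) / N + 3 ≤ 5 * u / N ∨ 5 * u / N + 3 ≤ 5 * (u * y.val % N) / N) :
    ∃ U : ZMod N, IsUnit U ∧ (5 * (U * y).val / N + 3 ≤ 5 * U.val / N ∨ 5 * U.val / N + 3 ≤ 5 * (U * y).val / N) :=
  ⟨u, hU, by rwa [ZMod.val_mul, ZMod.val_natCast, Nat.mod_eq_of_lt huN]⟩

omit [NeZero N] in
/-- `1, …, 6` are prime to an `N` prime to `30`. [folklore] -/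
private theorem coprime_small_bs (hN2 : Nat.Coprime 2 N) (hN3 : Nat.Coprime 3 N) (hN5 : Nat.Coprime 5 N) {k : ℕ} (hk1 : 1 ≤ k)
    (hk6 : k ≤ 6) : Nat.Coprime k N := by
  interval_cases k
  · exact Nat.coprime_one_left N
  · exact hN2
  · exact hN3
  · exact (show (4 : ℕ) = 2 * 2 by norm_num) ▸ Nat.Coprime.mul_left hN2 hN2
  · exact hN5
  · exact (show (6 : ℕ) = 2 * 3 by norm_num) ▸ Nat.Coprime.mul_left hN2 hN3

/-- **The inverse trick**: if `m·y = w` (`m ∈ {1, 2}` a unit), `u·w = jN + mc` with `1 ≤ c ≤ 6`, `j < w`, `3w ≤ 5j`, then `u` is a unit with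
`uy = c`, so `⌊5⟨uy⟩/N⌋ = 0` and `⌊5⟨u⟩/N⌋ ≥ 3` (`N > 30`) — our rendering of "`u₀ = 5u/r′` … prime to `N`" (p. 1196) for small
quotients. [cite: KoblitzRohrlich1978, §3 Case 2, Lemma (p. 1195) and its use (p. 1196)] -/
private theorem inv_trick_bs (hN : 30 < N) {y : ZMod N} {m w c j u : ℕ} (hm : IsUnit ((m : ℕ) : ZMod N))
    (hc : IsUnit ((c : ℕ) : ZMod N)) (hc1 : 1 ≤ c) (hc6 : c ≤ 6) (hm2 : m ≤ 2) (hmy : ((m : ℕ) : ZMod N) * y = ((w : ℕ) : ZMod N))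
    (hu : u * w = j * N + m * c) (hj : j < w) (h35 : 3 * w ≤ 5 * j) :
    ∃ U : ZMod N, IsUnit U ∧ (5 * (U * y).val / N + 3 ≤ 5 * U.val / N ∨ 5 * U.val / N + 3 ≤ 5 * (U * y).val / N) := by
  have hN0 : 0 < N := by omega
  have hw0 : 0 < w := by omega
  have hmc : m * c ≤ 12 := by nlinarith
  have huN : u < N := by
    have h1 : (j + 1) * N ≤ w * N := Nat.mul_le_mul_right N hj
    rw [Nat.add_mul, one_mul] at h1
    have h2 : u * w < N * w := by rw [mul_comm N w]; omega
    exact Nat.lt_of_mul_lt_mul_right h2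
  have hUw : ((u : ℕ) : ZMod N) * ((w : ℕ) : ZMod N) = ((m * c : ℕ) : ZMod N) := by
    rw [← Nat.cast_mul, hu, Nat.cast_add, Nat.cast_mul j N, ZMod.natCast_self, mul_zero, zero_add]
  have hUy : ((u : ℕ) : ZMod N) * y = ((c : ℕ) : ZMod N) := by
    have h1 : ((m : ℕ) : ZMod N) * (((u : ℕ) : ZMod N) * y) = ((m : ℕ) : ZMod N) * ((c : ℕ) : ZMod N) := by
      rw [mul_left_comm, hmy, hUw, Nat.cast_mul]
    exact hm.mul_left_cancel h1
  have hUunit : IsUnit ((u : ℕ) : ZMod N) :=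
    isUnit_of_mul_isUnit_left (by rw [hUw, Nat.cast_mul]; exact hm.mul hc)
  refine ⟨(u : ℕ), hUunit, Or.inl ?_⟩
  rw [hUy, ZMod.val_natCast, ZMod.val_natCast, Nat.mod_eq_of_lt (by omega : c < N), Nat.mod_eq_of_lt huN,
    Nat.div_eq_of_lt (by omega : 5 * c < N), zero_add]
  refine (Nat.le_div_iff_mul_le hN0).2 ?_
  have h1 : 3 * w * N ≤ 5 * j * N := Nat.mul_le_mul_right N h35
  have h2 : 3 * N * w ≤ 5 * u * w := by nlinarith
  exact Nat.le_of_mul_le_mul_right h2 hw0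

omit [NeZero N] in
/-- **A {2,3}-smooth multiplier into the fourth and fifth fifths**: for `5 ≤ v < N/10` a {2,3}-smooth `s` with `3N ≤ 5sv` and `sv < N`
(the sibling `exists_smooth_mem_middle` with `y = ⌊3N/2v⌋ + 1`: `s ∈ [2y/5, 3y/5]`). [cite: KoblitzRohrlich1978, §3 Case 1 (pp. 1194–1195), Case 2 Lemma (p. 1195)] -/
private theorem smooth_window_bs {v : ℕ} (hv5 : 5 ≤ v) (h10 : 10 * v < N) :
    ∃ s i j : ℕ, s = 2 ^ i * 3 ^ j ∧ 3 * N ≤ 5 * (s * v) ∧ s * v < N := by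
  have hv0 : 0 < 2 * v := by omega
  set q := 3 * N / (2 * v) with hq
  have hdm : 2 * v * q + 3 * N % (2 * v) = 3 * N := Nat.div_add_mod (3 * N) (2 * v)
  have hml : 3 * N % (2 * v) < 2 * v := Nat.mod_lt _ hv0
  have hq15 : 15 ≤ q := (Nat.le_div_iff_mul_le hv0).2 (by omega)
  obtain ⟨s, i, j, hs, h1, h2⟩ := exists_smooth_mem_middle (y := q + 1) (by omega)
  have hA : q * (2 * v) ≤ 3 * N := Nat.div_mul_le_self _ _
  refine ⟨s, i, j, hs, ?_, ?_⟩
  · have h3 : v * (2 * (q + 1)) ≤ v * (5 * s) := Nat.mul_le_mul_left v h1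
    nlinarith
  · have hB : 5 * s * v ≤ (3 * q + 3) * v := Nat.mul_le_mul_right v (by omega)
    nlinarith [hA, hB]

set_option synthInstance.maxHeartbeats 400000 in
set_option synthInstance.maxSize 100000 in
omit [NeZero N] in
/-- The table for `v ∈ {3, 4}`: `c ≡ −jN (mod v)` with `⌊5j/v⌋ ≥ 3`, `c ≤ 6`. [folklore] -/
private theorem table_small_bs : ∀ w < 5, 3 ≤ w → ∀ ρ < w, Nat.gcd ρ w = 1 →
    ∃ c, c < 7 ∧ 1 ≤ c ∧ ∃ j, j < w ∧ 3 * w ≤ 5 * j ∧ (j * ρ + c) % w = 0 := by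
  decide

set_option synthInstance.maxHeartbeats 400000 in
set_option synthInstance.maxSize 100000 in
omit [NeZero N] in
/-- The table for `w = 2⟨y⟩ − N ∈ {3, 5, 7, 9}`: `2c ≡ −jN (mod w)` with `⌊5j/w⌋ ≥ 3`, `c ≤ 6`. [folklore] -/
private theorem table_half_bs : ∀ w < 10, (w = 3 ∨ w = 5 ∨ w = 7 ∨ w = 9) → ∀ ρ < w, Nat.gcd ρ w = 1 →
    ∃ c, c < 7 ∧ 1 ≤ c ∧ ∃ j, j < w ∧ 3 * w ≤ 5 * j ∧ (j * ρ + 2 * c) % w = 0 := by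
  decide

set_option synthInstance.maxHeartbeats 400000 in
set_option synthInstance.maxSize 100000 in
omit [NeZero N] in
/-- The levels `7 ≤ N < 31` prime to `30` by enumeration (`N ∈ {7, 11, 13, 17, 19, 23, 29}`). [folklore] -/
private theorem part_two_small_levels_bs : ∀ n < 31, 7 ≤ n → Nat.gcd 2 n = 1 → Nat.gcd 3 n = 1 → Nat.gcd 5 n = 1 →
    ∀ y < n, Nat.gcd y n = 1 → y ≠ 1 → y ≠ 2 → 2 * y % n ≠ 1 →
      ∃ u, u < n ∧ Nat.gcd u n = 1 ∧ (5 * (u * y % n) / n + 3 ≤ 5 * u / n ∨ 5 * u / n + 3 ≤ 5 * (u * y % n) / n) := by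
  decide

omit [NeZero N] in
/-- From `w ∣ jρ + e` with `ρ = N mod w`: `w ∣ jN + e`, so `u = (jN + e)/w` has `uw = jN + e`. [folklore] -/
private theorem exists_mul_eq_of_mod_bs {w j e : ℕ} (h : (j * (N % w) + e) % w = 0) :
    ∃ u : ℕ, u * w = j * N + e := by
  have h1 : w ∣ j * N + e := by
    have h2 : j * N + e ≡ j * (N % w) + e [MOD w] := Nat.ModEq.add_right e (Nat.ModEq.mul_left j (Nat.mod_modEq N w).symm)
    exact (Nat.modEq_zero_iff_dvd).1 (h2.trans (Nat.modEq_zero_iff_dvd.2 (Nat.dvd_of_mod_eq_zero h)))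
  obtain ⟨u, hu⟩ := h1
  exact ⟨u, by rw [hu, mul_comm]⟩

/-- **K–R's LEMMA, SECOND PART** ("If `x = 1`, `y ≠ 2, (N+1)/2`, and `5 ∤ N`, then there exists `u ∈ (ℤ/Nℤ)*` such that
`|⌊⟨ux⟩/(N/5)⌋ − ⌊⟨uy⟩/(N/5)⌋| ≥ 3`", p. 1195, proof omitted there; typed for `y` a UNIT, the case of its use on p. 1196 — "Here `r′/5 ∈
(ℤ/Nℤ)*`"): at `N` prime to `30`, for a unit `y ≠ 1, 2` with `2y ≠ 1`, a unit `u` with **`⌊5⟨u⟩/N⌋ ≥ ⌊5⟨uy⟩/N⌋ + 3` or `⌊5⟨uy⟩/N⌋ ≥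
⌊5⟨u⟩/N⌋ + 3`**.  Proof (ours): with `v = ⟨y⟩`: `v ∈ {3, 4}` — `u = c·v⁻¹` for a `c ≤ 6` with `⟨u⟩ ≥ 3N/5` (`table_small_bs`); `5 ≤ v <
N/10` — a {2,3}-smooth `u` with `uv ∈ [3N/5, N)`; `N/10 < v < N/2` — `u = 6, 4, 3, 2`; `v > N/2`, `w = 2v − N` (odd, `≥ 3`): `w ≤ 9` —
`u = c·y⁻¹ = 2c·w⁻¹` (`table_half_bs`); `10 ≤ w < N/10` — `u = 2s`, `s` smooth with `sw ∈ [3N/5, N)`; `N/10 < w < N/5` — `u = 5`; `w > N/5` —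
`u = 1`; the levels `N < 31` by enumeration.  (An exhaustive check for `N ≤ 400` confirms the statement for all `y`, unit or not.)
[cite: KoblitzRohrlich1978, §3 Case 2, Lemma (p. 1195)] -/
theorem exists_isUnit_div_separation_part_two (hN2 : Nat.Coprime 2 N) (hN3 : Nat.Coprime 3 N) (hN5 : Nat.Coprime 5 N)
    {y : ZMod N} (hy : IsUnit y) (h1 : y ≠ 1) (h2 : y ≠ 2) (h2' : 2 * y ≠ 1) :
    ∃ u : ZMod N, IsUnit u ∧ (5 * (u * y).val / N + 3 ≤ 5 * u.val / N ∨ 5 * u.val / N + 3 ≤ 5 * (u * y).val / N) := by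
  have hN0 : 0 < N := Nat.pos_of_ne_zero (NeZero.ne N)
  -- `N ≥ 7`
  have hN1 : N ≠ 1 := fun h => h1 (by
    haveI : Subsingleton (ZMod N) := Fintype.card_le_one_iff_subsingleton.mp (by rw [ZMod.card]; omega)
    exact Subsingleton.elim _ _)
  have hN7 : 7 ≤ N := by
    by_contra h
    have h' : N = 2 ∨ N = 3 ∨ N = 4 ∨ N = 5 ∨ N = 6 := by omega
    rcases h' with h' | h' | h' | h' | h'
    · exact absurd (Nat.Coprime.eq_one_of_dvd hN2 ⟨1, by omega⟩) (by norm_num)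
    · exact absurd (Nat.Coprime.eq_one_of_dvd hN3 ⟨1, by omega⟩) (by norm_num)
    · exact absurd (Nat.Coprime.eq_one_of_dvd hN2 ⟨2, by omega⟩) (by norm_num)
    · exact absurd (Nat.Coprime.eq_one_of_dvd hN5 ⟨1, by omega⟩) (by norm_num)
    · exact absurd (Nat.Coprime.eq_one_of_dvd hN2 ⟨3, by omega⟩) (by norm_num)
  set v := y.val with hvdef
  have hvN : v < N := ZMod.val_lt y
  have hcopv : Nat.Coprime v N := (isUnit_iff_val_coprime_bs y).1 hy
  have hyv : y = ((v : ℕ) : ZMod N) := (ZMod.natCast_zmod_val y).symm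
  have hv0 : v ≠ 0 := fun h => by
    rw [h] at hcopv
    exact hN1 (Nat.Coprime.eq_one_of_dvd (Nat.coprime_comm.1 hcopv) (dvd_zero N))
  have hv1 : v ≠ 1 := fun h => h1 (by rw [hyv, h, Nat.cast_one])
  have hv2 : v ≠ 2 := fun h => h2 (by rw [hyv, h, Nat.cast_ofNat])
  have h2y : 2 * y = ((2 * v : ℕ) : ZMod N) := by rw [Nat.cast_mul, Nat.cast_ofNat, ← hyv]
  have hv2' : 2 * v % N ≠ 1 := fun h => h2' (by
    rw [h2y, ← ZMod.natCast_zmod_val (((2 * v : ℕ) : ZMod N)), ZMod.val_natCast, h, Nat.cast_one])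
  -- small levels by enumeration
  by_cases hsmall : N < 31
  · obtain ⟨u, huN, hcop, h⟩ := part_two_small_levels_bs N hsmall hN7 hN2 hN3 hN5 v hvN hcopv hv1 hv2 hv2'
    exact part_two_of_nat_bs u huN ((ZMod.isUnit_iff_coprime u N).2 hcop) h
  have hN31 : 31 ≤ N := by omega
  have hunit : ∀ {k : ℕ}, 1 ≤ k → k ≤ 6 → IsUnit ((k : ℕ) : ZMod N) := fun hk1 hk6 =>
    (ZMod.isUnit_iff_coprime _ N).2 (coprime_small_bs hN2 hN3 hN5 hk1 hk6)
  -- `v ∈ {3, 4}`: the inverse trick with `m = 1`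
  by_cases hv34 : v = 3 ∨ v = 4
  · have hvlt : v < 5 := by omega
    have hv3 : 3 ≤ v := by omega
    have hcopρ : Nat.gcd (N % v) v = 1 := by rw [← Nat.gcd_rec]; exact hcopv
    obtain ⟨c, hc7, hc1, j, hj, h35, hmod⟩ := table_small_bs v hvlt hv3 (N % v) (Nat.mod_lt N (by omega)) hcopρ
    obtain ⟨u, hu⟩ := exists_mul_eq_of_mod_bs (N := N) hmod
    exact inv_trick_bs (by omega) (m := 1) (hunit le_rfl (by norm_num)) (hunit hc1 (by omega)) hc1 (by omega) (by norm_num)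
      (by rw [Nat.cast_one, one_mul, ← hyv]) (by rw [hu, one_mul]) hj h35
  have hv5 : 5 ≤ v := by omega
  -- `5 ≤ v < N/10`: a smooth multiplier
  by_cases h10 : 10 * v < N
  · obtain ⟨s, i, j, hs, h3, h4⟩ := smooth_window_bs (N := N) hv5 h10
    have hsN : s < N := by nlinarith
    have hcop : Nat.Coprime s N := hs ▸ Nat.Coprime.mul_left (Nat.Coprime.pow_left i hN2) (Nat.Coprime.pow_left j hN3)
    refine part_two_of_nat_bs s hsN ((ZMod.isUnit_iff_coprime s N).2 hcop) (Or.inr ?_)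
    rw [Nat.mod_eq_of_lt h4, Nat.div_eq_of_lt (by nlinarith : 5 * s < N), zero_add]
    exact (Nat.le_div_iff_mul_le hN0).2 (by linarith)
  -- `N/10 < v < N/2`: `u = 6, 4, 3, 2`
  by_cases h6 : 6 * v < N
  · refine part_two_of_nat_bs 6 (by omega) (hunit (by norm_num) le_rfl) (Or.inr ?_)
    rw [Nat.mod_eq_of_lt (by omega : 6 * v < N), Nat.div_eq_of_lt (by omega : 5 * 6 < N), zero_add]
    exact (Nat.le_div_iff_mul_le hN0).2 (by omega)
  by_cases h5 : 5 * v < N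
  · refine part_two_of_nat_bs 4 (by omega) (hunit (by norm_num) (by norm_num)) (Or.inr ?_)
    rw [Nat.mod_eq_of_lt (by omega : 4 * v < N), Nat.div_eq_of_lt (by omega : 5 * 4 < N), zero_add]
    exact (Nat.le_div_iff_mul_le hN0).2 (by omega)
  by_cases h3 : 3 * v < N
  · refine part_two_of_nat_bs 3 (by omega) (hunit (by norm_num) (by norm_num)) (Or.inr ?_)
    rw [Nat.mod_eq_of_lt (by omega : 3 * v < N), Nat.div_eq_of_lt (by omega : 5 * 3 < N), zero_add]
    exact (Nat.le_div_iff_mul_le hN0).2 (by omega)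
  by_cases h2v : 2 * v < N
  · refine part_two_of_nat_bs 2 (by omega) (hunit (by norm_num) (by norm_num)) (Or.inr ?_)
    rw [Nat.mod_eq_of_lt (by omega : 2 * v < N), Nat.div_eq_of_lt (by omega : 5 * 2 < N), zero_add]
    exact (Nat.le_div_iff_mul_le hN0).2 (by omega)
  -- `v > N/2`: `w = 2v − N` is odd and `≥ 3`
  have hodd : N % 2 = 1 := Nat.odd_iff.1 (Nat.Coprime.odd_of_left hN2) -- placeholder, fixed below if needed
  set w := 2 * v - N with hwdef
  have h2vN : 2 * v ≠ N := fun h => by omega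
  have hw : 2 * v = w + N := by omega
  have hw1 : w ≠ 1 := fun h => hv2' (by rw [hw, h, Nat.add_mod_right, Nat.mod_eq_of_lt (by omega)])
  have hwodd : w % 2 = 1 := by omega
  have hw3 : 3 ≤ w := by omega
  have h2yw : ((2 : ℕ) : ZMod N) * y = ((w : ℕ) : ZMod N) := by
    rw [Nat.cast_ofNat, h2y, hw, Nat.cast_add, ZMod.natCast_self, add_zero]
  have hcopw : Nat.Coprime w N := by
    have hu2y : IsUnit (((2 : ℕ) : ZMod N) * y) := (hunit (by norm_num) (by norm_num)).mul hy
    rw [h2yw] at hu2y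
    have := (ZMod.isUnit_iff_coprime w N).1 hu2y
    exact this
  by_cases hw9 : w ≤ 9
  · -- `w ∈ {3, 5, 7, 9}`: the inverse trick with `m = 2`
    have hwlt : w < 10 := by omega
    have hwin : w = 3 ∨ w = 5 ∨ w = 7 ∨ w = 9 := by omega
    have hcopρ : Nat.gcd (N % w) w = 1 := by rw [← Nat.gcd_rec]; exact hcopw
    obtain ⟨c, hc7, hc1, j, hj, h35, hmod⟩ := table_half_bs w hwlt hwin (N % w) (Nat.mod_lt N (by omega)) hcopρ
    obtain ⟨u, hu⟩ := exists_mul_eq_of_mod_bs (N := N) hmod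
    exact inv_trick_bs (by omega) (m := 2) (hunit (by norm_num) (by norm_num)) (hunit hc1 (by omega)) hc1 (by omega) le_rfl
      h2yw hu hj h35
  by_cases h10w : 10 * w < N
  · -- `10 ≤ w < N/10`: `u = 2s`
    obtain ⟨s, i, j, hs, h3, h4⟩ := smooth_window_bs (N := N) (v := w) (by omega) h10w
    have hsN : 10 * s < N := by nlinarith
    have hcop : Nat.Coprime (2 * s) N :=
      Nat.Coprime.mul_left hN2 (hs ▸ Nat.Coprime.mul_left (Nat.Coprime.pow_left i hN2) (Nat.Coprime.pow_left j hN3))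
    refine part_two_of_nat_bs (2 * s) (by omega) ((ZMod.isUnit_iff_coprime _ N).2 hcop) (Or.inr ?_)
    have e : 2 * s * v % N = s * w := by
      rw [show 2 * s * v = s * w + s * N by rw [show 2 * s * v = s * (2 * v) by ring, hw]; ring, Nat.add_mul_mod_self_right,
        Nat.mod_eq_of_lt h4]
    rw [e, Nat.div_eq_of_lt (by omega : 5 * (2 * s) < N), zero_add]
    exact (Nat.le_div_iff_mul_le hN0).2 (by linarith)
  by_cases h5v : 5 * v < 3 * N
  · -- `N/10 < w`, `v < 3N/5`: `u = 5`
    refine part_two_of_nat_bs 5 (by omega) (hunit (by norm_num) (by norm_num)) (Or.inr ?_)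
    have e : 5 * v % N = 5 * v - 2 * N := by
      rw [show 5 * v = (5 * v - 2 * N) + 2 * N by omega, Nat.add_mul_mod_self_right, Nat.mod_eq_of_lt (by omega)]
      omega
    rw [e, Nat.div_eq_of_lt (by omega : 5 * 5 < N), zero_add]
    exact (Nat.le_div_iff_mul_le hN0).2 (by omega)
  · -- `v > 3N/5`: `u = 1`
    refine part_two_of_nat_bs 1 (by omega) (hunit le_rfl (by norm_num)) (Or.inr ?_)
    rw [one_mul, Nat.mod_eq_of_lt hvN, Nat.div_eq_of_lt (by omega : 5 * 1 < N), zero_add]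
    exact (Nat.le_div_iff_mul_le hN0).2 (by omega)

end LemmaSecondPart

/-! ## §8 (v5) CASE 2 AT `p = 5`, `5 ∥ N`, IN FULL (K–R p. 1196): the Lemma's second part against (6), and the sub-case `r ≡ 2^{±1}r′`
via (7); hence CASE 2 OF THE PROPOSITION AT EVERY LEVEL PRIME TO `6` -/

section FiveExact

variable {p Q : ℕ} [NeZero (p * Q)]

/-- Membership in `H_{(a,b,c)}` (unfolding the tree's `fermatCMType`). [cite: KoblitzRohrlich1978, §1 (p. 1184)] -/
private theorem mem_fermatCMType_iff_bs {m : ℕ} [NeZero m] (a b c x : ZMod m) :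
    x ∈ fermatCMType m a b c ↔ x.val.Coprime m ∧ (x * a).val + (x * b).val + (x * c).val = m := by
  simp only [fermatCMType, mem_filter, mem_univ, true_and]

/-- For a triple with `a + b + c = 0` and any multiplier `h`: `⟨ha⟩ + ⟨hb⟩ + ⟨hc⟩ = k·m`, `k ≤ 2`. [cite: KoblitzRohrlich1978, §1 (p. 1184)] -/
private theorem exists_val_sum_eq_mul_bs {m : ℕ} [NeZero m] {a b c : ZMod m} (habc : a + b + c = 0) (h : ZMod m) :
    ∃ k, k ≤ 2 ∧ (h * a).val + (h * b).val + (h * c).val = k * m := by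
  have hsum0 : (((h * a).val + (h * b).val + (h * c).val : ℕ) : ZMod m) = 0 := by
    push_cast
    rw [ZMod.natCast_zmod_val, ZMod.natCast_zmod_val, ZMod.natCast_zmod_val, ← mul_add, ← mul_add, habc, mul_zero]
  obtain ⟨k, hk⟩ := (ZMod.natCast_eq_zero_iff _ _).mp hsum0
  have hxlt := ZMod.val_lt (h * a)
  have hylt := ZMod.val_lt (h * b)
  have hzlt := ZMod.val_lt (h * c)
  refine ⟨k, ?_, by rw [hk, mul_comm]⟩
  by_contra hk3
  push Not at hk3
  have := Nat.mul_le_mul_left m hk3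
  omega

/-- `H_{uτ} = H_{uτ′}` from `H_τ = H_{τ′}` for a unit `u` (`H_{uτ} = u⁻¹H_τ`, tree `mem_fermatCMType_mul_iff_of_isUnit`).
[cite: KoblitzRohrlich1978, §1 (p. 1184)] -/
private theorem fermatCMType_mul_eq_bs {m : ℕ} [NeZero m] {u : ZMod m} (hu : IsUnit u) {a b c a' b' c' : ZMod m}
    (h : fermatCMType m a b c = fermatCMType m a' b' c') :
    fermatCMType m (u * a) (u * b) (u * c) = fermatCMType m (u * a') (u * b') (u * c') := by
  ext x
  rw [mem_fermatCMType_mul_iff_of_isUnit hu, mem_fermatCMType_mul_iff_of_isUnit hu, h]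

/-- `2⟨x⟩ = ⟨2x⟩` or `2⟨x⟩ = ⟨2x⟩ + N`. [folklore] -/
private theorem two_mul_val_bs {m : ℕ} [NeZero m] (x : ZMod m) : 2 * x.val = (2 * x).val ∨ 2 * x.val = (2 * x).val + m := by
  rw [two_mul x]
  rcases Nat.lt_or_ge (x.val + x.val) m with h | h
  · left; rw [ZMod.val_add_of_lt h]; ring
  · right; rw [← ZMod.val_add_val_of_le h]; ring

/-- **The residue/digit relation behind (5)–(7)**: in the Case-2 setting, for every unit `u` there are `k, k′ ∈ {1, 2}` (`r₀ + s₀ + t₀ = kQ`,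
`r₀′ + s₀′ + t₀′ = k′Q`) and the non-unit contributions `E, E′` of the sibling's `orbit_sum_compare` with `N(⌊⟨ur⟩/Q⌋ + k) + E′ =
N(⌊⟨ur′⟩/Q⌋ + k′) + E`. [cite: KoblitzRohrlich1978, §3 Proposition, Case 2 (pp. 1195–1196, (5)–(7))] -/
private theorem relation_bs (hp : p.Prime) {r s t r' s' t' : ZMod (p * Q)} (hr : r ≠ 0) (hrst : r + s + t = 0) (hr' : r' ≠ 0)
    (hrst' : r' + s' + t' = 0) (hprim : ∀ q : ℕ, q.Prime → q ∣ p * Q → ¬(q ∣ r.val ∧ q ∣ s.val ∧ q ∣ t.val))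
    (hprim' : ∀ q : ℕ, q.Prime → q ∣ p * Q → ¬(q ∣ r'.val ∧ q ∣ s'.val ∧ q ∣ t'.val)) (hpr : p ∣ r.val) (hpr' : p ∣ r'.val)
    (hEq : fermatCMType (p * Q) r s t = fermatCMType (p * Q) r' s' t') {u : ZMod (p * Q)} (hu : IsUnit u) :
    ∃ k k' E E' : ℕ, (1 ≤ k ∧ k ≤ 2) ∧ (1 ≤ k' ∧ k' ≤ 2) ∧
      (u * r).val % Q + (u * s).val % Q + (u * t).val % Q = Q * k ∧
      (u * r').val % Q + (u * s').val % Q + (u * t').val % Q = Q * k' ∧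
      p * Q * ((u * r).val / Q + k) + E' = p * Q * ((u * r').val / Q + k') + E ∧
      ((E = 0 ∧ E' = 0) ∨ (p * Q ≤ E ∧ E ≤ 2 * (p * Q) ∧ p * Q ≤ E' ∧ E' ≤ 2 * (p * Q))) := by
  have hQ2 : 2 ≤ Q := two_le_of_dvd_val_bs hr hpr
  have hps : ¬p ∣ s.val := fun h => hprim p hp (dvd_mul_right p Q) ⟨hpr, h, (dvd_val_iff_of_add_eq_zero hrst hpr).1 h⟩
  have hpt : ¬p ∣ t.val := fun h => hps ((dvd_val_iff_of_add_eq_zero hrst hpr).2 h)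
  have hps' : ¬p ∣ s'.val := fun h => hprim' p hp (dvd_mul_right p Q) ⟨hpr', h, (dvd_val_iff_of_add_eq_zero hrst' hpr').1 h⟩
  have hpt' : ¬p ∣ t'.val := fun h => hps' ((dvd_val_iff_of_add_eq_zero hrst' hpr').2 h)
  obtain ⟨E, E', hcmp, hE, -⟩ := orbit_sum_compare hp hr hrst hr' hrst' hprim hprim' hEq hu
  simp only [sum_add_distrib] at hcmp
  have hTr := sum_val_orbit_mul_of_dvd u r hpr
  have hTr' := sum_val_orbit_mul_of_dvd u r' hpr'
  have hTs := two_mul_sum_val_orbit_mul hp u s (not_dvd_val_mul_bs hp hu s hps)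
  have hTt := two_mul_sum_val_orbit_mul hp u t (not_dvd_val_mul_bs hp hu t hpt)
  have hTs' := two_mul_sum_val_orbit_mul hp u s' (not_dvd_val_mul_bs hp hu s' hps')
  have hTt' := two_mul_sum_val_orbit_mul hp u t' (not_dvd_val_mul_bs hp hu t' hpt')
  obtain ⟨k, hk1, hk2, hk⟩ := exists_residue_sum_eq_bs hrst hprim hQ2 hu
  obtain ⟨k', hk1', hk2', hk'⟩ := exists_residue_sum_eq_bs hrst' hprim' hQ2 hu
  have hRp : p * (u * r).val = p * Q * ((u * r).val / Q) + p * ((u * r).val % Q) := by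
    conv_lhs => rw [← Nat.div_add_mod (u * r).val Q]
    rw [Nat.mul_add, ← mul_assoc]
  have hRp' : p * (u * r').val = p * Q * ((u * r').val / Q) + p * ((u * r').val % Q) := by
    conv_lhs => rw [← Nat.div_add_mod (u * r').val Q]
    rw [Nat.mul_add, ← mul_assoc]
  have hkp : p * ((u * r).val % Q) + p * ((u * s).val % Q) + p * ((u * t).val % Q) = p * Q * k := by
    rw [← Nat.mul_add, ← Nat.mul_add, hk, mul_assoc]
  have hkp' : p * ((u * r').val % Q) + p * ((u * s').val % Q) + p * ((u * t').val % Q) = p * Q * k' := by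
    rw [← Nat.mul_add, ← Nat.mul_add, hk', mul_assoc]
  refine ⟨k, k', E, E', ⟨hk1, hk2⟩, ⟨hk1', hk2'⟩, hk, hk', by linarith, hE⟩

end FiveExact

section FiveExactCore

variable {Q : ℕ} [NeZero (5 * Q)]

/-- In the normalised sub-case `r = 5`, `r′ = (N+5)/2` (`N = 5Q`, `Q > 5`): (7) `s₀ + t₀ = 2Q − 5` and `r₀′ + s₀′ + t₀′ = Q`
("By (5) we have `N₀ ≥ |r + s₀ + t₀ − r′ − s₀′ − t₀′| = |r₀ + s₀ + t₀ − r₀′ − s₀′ − t₀′ − 2N₀|`. Thus, (7) `r₀ + s₀ + t₀ = 2N₀`, `r₀′ + s₀′ +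
t₀′ = N₀`", p. 1196). [cite: KoblitzRohrlich1978, §3 Proposition, Case 2 at `p = 5` (p. 1196, (7))] -/
private theorem residues_normalised_bs (hQ5 : 5 < Q) {r s t r' s' t' : ZMod (5 * Q)} (hr : r ≠ 0) (hrst : r + s + t = 0)
    (hr' : r' ≠ 0) (hrst' : r' + s' + t' = 0) (hprim : ∀ q : ℕ, q.Prime → q ∣ 5 * Q → ¬(q ∣ r.val ∧ q ∣ s.val ∧ q ∣ t.val))
    (hprim' : ∀ q : ℕ, q.Prime → q ∣ 5 * Q → ¬(q ∣ r'.val ∧ q ∣ s'.val ∧ q ∣ t'.val))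
    (hEq : fermatCMType (5 * Q) r s t = fermatCMType (5 * Q) r' s' t') (hr5 : r.val = 5) (hr'v : 2 * r'.val = 5 * Q + 5) :
    s.val % Q + t.val % Q = 2 * Q - 5 ∧ r'.val % Q + s'.val % Q + t'.val % Q = Q := by
  have h5 : (5 : ℕ).Prime := by norm_num
  obtain ⟨k, k', E, E', ⟨hk1, hk2⟩, ⟨hk1', hk2'⟩, hk, hk', hrel, hE⟩ :=
    relation_bs (p := 5) h5 hr hrst hr' hrst' hprim hprim' (by rw [hr5]) ⟨(Q + 1) / 2, by omega⟩ hEq isUnit_one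
  simp only [one_mul] at hk hk' hrel
  have hD : r.val / Q = 0 := Nat.div_eq_of_lt (by omega)
  have hD' : r'.val / Q = 2 := Nat.div_eq_of_lt_le (by omega) (by omega)
  rw [hD, hD'] at hrel
  have hr₀ : r.val % Q = 5 := by rw [hr5]; exact Nat.mod_eq_of_lt hQ5
  have hr'₀ : r'.val % Q = (Q + 5) / 2 := by
    have e : r'.val = (Q + 5) / 2 + 2 * Q := by omega
    rw [e, Nat.add_mul_mod_self_right, Nat.mod_eq_of_lt (by omega)]
  -- `k = 2`, `k′ = 1`
  have hkk : k = 2 ∧ k' = 1 := by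
    rcases hE with ⟨rfl, rfl⟩ | ⟨hE1, hE2, hE1', hE2'⟩
    · interval_cases k <;> interval_cases k' <;> omega
    · interval_cases k <;> interval_cases k' <;> omega
  obtain ⟨rfl, rfl⟩ := hkk
  constructor <;> omega

/-- The unit `u = 1 + iN₀ ∈ P` with `⟨us⟩ = N − a` ("Multiplying through by a suitable `u ∈ P*`, without loss of generality we may assume that
`τ = (5, N − a, N − b)`", p. 1196; `u` is a unit because `5 ∤ a`). [cite: KoblitzRohrlich1978, §3 Proposition, Case 2 at `p = 5` (p. 1196)] -/
private theorem exists_unit_P_bs (hQ1 : 1 < Q) {s : ZMod (5 * Q)} (h5s : ¬5 ∣ s.val) {a : ℕ} (ha : s.val % Q + a = Q) (ha1 : 1 ≤ a)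
    (ha4 : a ≤ 4) : ∃ (i : ℕ) (u : ZMod (5 * Q)), u = 1 + (i : ZMod (5 * Q)) * (Q : ZMod (5 * Q)) ∧ IsUnit u ∧ (u * s).val = 5 * Q - a := by
  have h5 : (5 : ℕ).Prime := by norm_num
  have hρ : s.val % 5 ≠ 0 := fun h => h5s (Nat.dvd_of_mod_eq_zero h)
  obtain ⟨i, hi5, hi⟩ := exists_five_dvd_add_mul_bs (s.val / Q + 1) s.val hρ
  set u : ZMod (5 * Q) := 1 + (i : ZMod (5 * Q)) * (Q : ZMod (5 * Q)) with hudef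
  have hus : (u * s).val = 5 * Q - a := by
    have h1 := val_orbit_mul_eq (p := 5) (by norm_num) 1 s i
    rw [one_mul, one_mul] at h1
    rw [h1]
    have h2 : (s.val / Q + i * s.val) % 5 = 4 := by omega
    rw [h2]
    omega
  have hucast : u = ((1 + i * Q : ℕ) : ZMod (5 * Q)) := by rw [hudef]; push_cast; ring
  have huval : u.val = 1 + i * Q := by rw [hucast, ZMod.val_natCast, Nat.mod_eq_of_lt (by nlinarith)]
  refine ⟨i, u, rfl, ?_, hus⟩
  rw [hucast, ZMod.isUnit_iff_coprime]
  refine Nat.Coprime.mul_right ?_ ?_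
  · -- `5 ∤ 1 + iQ`: otherwise `5 ∣ ⟨us⟩ = N − a`
    refine ((Nat.Prime.coprime_iff_not_dvd h5).2 fun hd => ?_).symm
    have h1 : 5 ∣ (u * s).val := by
      rw [ZMod.val_mul, huval, Nat.dvd_mod_iff (dvd_mul_right 5 Q)]
      exact dvd_mul_of_dvd_left hd _
    rw [hus] at h1
    omega
  · rw [Nat.coprime_add_mul_right_left]; exact Nat.coprime_one_left Q

/-- With `⟨r⟩ = 5`, `⟨x⟩ = N − a` and `r + x + z = 0`: `⟨z⟩ = N − b`, `b = 5 − a`. [folklore] -/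
private theorem val_third_bs (hQ1 : 1 < Q) {r x z : ZMod (5 * Q)} (h : r + x + z = 0) (hr5 : r.val = 5) {a : ℕ} (hx : x.val = 5 * Q - a)
    (ha1 : 1 ≤ a) (ha4 : a ≤ 4) : z.val = 5 * Q - (5 - a) := by
  have e : z = -(r + x) := by rw [← add_eq_zero_iff_eq_neg.1]; rw [show z + (r + x) = r + x + z by ring, h]
  have h1 : (r + x).val = 5 - a := by
    have := ZMod.val_add_val_of_le (a := r) (b := x) (by rw [hr5, hx]; omega)
    rw [hr5, hx] at this
    omega
  have hne0 : r + x ≠ 0 := fun h0 => by rw [h0, ZMod.val_zero] at h1; omega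
  rw [e, ZMod.neg_val, if_neg hne0, h1]

/-- `2 ∉ H_{(5, N − a, N − b)}`: `⟨10⟩ + ⟨2(N − a)⟩ + ⟨2(N − b)⟩ = 2N` ("Since `2 ∉ H_τ`", p. 1196).
[cite: KoblitzRohrlich1978, §3 Proposition, Case 2 at `p = 5` (p. 1196)] -/
private theorem two_notin_bs (hQ5 : 5 < Q) {r x z : ZMod (5 * Q)} (hr5 : r.val = 5) {a : ℕ} (hx : x.val = 5 * Q - a)
    (hz : z.val = 5 * Q - (5 - a)) (ha1 : 1 ≤ a) (ha4 : a ≤ 4) : (2 : ZMod (5 * Q)) ∉ fermatCMType (5 * Q) r x z := by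
  rw [mem_fermatCMType_iff_bs]
  rintro ⟨-, hsum⟩
  have h2 := two_mul_val_bs r
  have h3 := two_mul_val_bs x
  have h4 := two_mul_val_bs z
  have h5 := ZMod.val_lt ((2 : ZMod (5 * Q)) * r)
  have h6 := ZMod.val_lt ((2 : ZMod (5 * Q)) * x)
  have h7 := ZMod.val_lt ((2 : ZMod (5 * Q)) * z)
  omega

/-- The final count ("Say `a′` is even. Then `τ′ = ((N + 5)/2, N − a′/2, (N − b′)/2)`, and `r₀′ + s₀′ + t₀′ = 2N₀`, contradicting (7)",
p. 1196): `⟨2x⟩ = N − a′` (`a′` even), `⟨2z⟩ = N − b′`, `a′ + b′ = 5`, `2⟨r′⟩ = N + 5` and `r₀′ + x₀ + z₀ = Q` are incompatible.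
[cite: KoblitzRohrlich1978, §3 Proposition, Case 2 at `p = 5` (p. 1196)] -/
private theorem final_count_bs (hQ5 : 5 < Q) (hQodd : Q % 2 = 1) {r' x z : ZMod (5 * Q)} (hr'v : 2 * r'.val = 5 * Q + 5) {a' b' : ℕ}
    (hxa : ((2 : ZMod (5 * Q)) * x).val + a' = 5 * Q) (hzb : ((2 : ZMod (5 * Q)) * z).val + b' = 5 * Q) (ha' : a' % 2 = 0)
    (ha1 : 1 ≤ a') (hb1 : 1 ≤ b') (hab : a' + b' = 5) (hQsum : r'.val % Q + x.val % Q + z.val % Q = Q) : False := by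
  have hxv : x.val = 5 * Q - a' / 2 := by
    have := ZMod.val_lt x
    rcases two_mul_val_bs x with h | h <;> omega
  have hzv : 2 * z.val = 5 * Q - b' := by
    have := ZMod.val_lt z
    rcases two_mul_val_bs z with h | h <;> omega
  have hx₀ : x.val % Q = Q - a' / 2 := by
    rw [hxv, show 5 * Q - a' / 2 = (Q - a' / 2) + 4 * Q by omega, Nat.add_mul_mod_self_right, Nat.mod_eq_of_lt (by omega)]
  have hz₀ : z.val % Q = (Q - b') / 2 := by
    rw [show z.val = (Q - b') / 2 + 2 * Q by omega, Nat.add_mul_mod_self_right, Nat.mod_eq_of_lt (by omega)]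
  have hr'₀ : r'.val % Q = (Q + 5) / 2 := by
    rw [show r'.val = (Q + 5) / 2 + 2 * Q by omega, Nat.add_mul_mod_self_right, Nat.mod_eq_of_lt (by omega)]
  rw [hx₀, hz₀, hr'₀] at hQsum
  omega

/-- **The sub-case `r ≡ 2r′`, normalised** ("we may assume `r = 5`, `r′ = (N + 5)/2`. … Say `τ = (5, iN₀ − a, jN₀ − b)`, where `a, b > 0`,
`a + b = 5`. Multiplying through by a suitable `u ∈ P*`, without loss of generality we may assume `τ = (5, N − a, N − b)` … Since `2 ∉ H_τ =
H_{τ′}`, and `⟨2r′⟩ = 5`, we must have `2τ′ = (5, N − a′, N − b′)`, where `a′, b′ > 0`, `a′ + b′ = 5`. Say `a′` is even. Then `τ′ = ((N + 5)/2,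
N − a′/2, (N − b′)/2)`, and `r₀′ + s₀′ + t₀′ = 2N₀`, contradicting (7)", p. 1196): at `N = 5Q` prime to `6` with `Q > 5`, admissible primitive
`τ, τ′` with `H_τ = H_{τ′}`, `⟨r⟩ = 5` and `2r′ = r` is IMPOSSIBLE. [cite: KoblitzRohrlich1978, §3 Proposition, Case 2 at `p = 5` (p. 1196)] -/
private theorem false_of_normalised_bs (hN2 : Nat.Coprime 2 (5 * Q)) (hQ5 : 5 < Q) {r s t r' s' t' : ZMod (5 * Q)}
    (hr : r ≠ 0) (hrst : r + s + t = 0) (hr' : r' ≠ 0) (hrst' : r' + s' + t' = 0) (hprim : ∀ q : ℕ, q.Prime → q ∣ 5 * Q → ¬(q ∣ r.val ∧ q ∣ s.val ∧ q ∣ t.val))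
    (hprim' : ∀ q : ℕ, q.Prime → q ∣ 5 * Q → ¬(q ∣ r'.val ∧ q ∣ s'.val ∧ q ∣ t'.val))
    (hEq : fermatCMType (5 * Q) r s t = fermatCMType (5 * Q) r' s' t') (hr5 : r.val = 5) (h2r' : 2 * r' = r) : False := by
  have h5 : (5 : ℕ).Prime := by norm_num
  have hQodd : Q % 2 = 1 := by have := Nat.odd_iff.1 (Nat.Coprime.odd_of_left hN2); omega
  -- `2⟨r′⟩ = N + 5`
  have hr'v : 2 * r'.val = 5 * Q + 5 := by
    have h1 : (2 * r').val = 5 := by rw [h2r', hr5]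
    have h2 := ZMod.val_lt r'
    rcases two_mul_val_bs r' with h | h <;> omega
  have h5r : 5 ∣ r.val := by rw [hr5]
  have h5r' : 5 ∣ r'.val := ⟨(Q + 1) / 2, by omega⟩
  have h5s : ¬5 ∣ s.val := fun h => hprim 5 h5 (dvd_mul_right 5 Q) ⟨h5r, h, (dvd_val_iff_of_add_eq_zero hrst h5r).1 h⟩
  -- (7): `s₀ + t₀ = 2Q − 5`; `a = Q − s₀ ∈ [1, 4]`
  obtain ⟨hst, -⟩ := residues_normalised_bs hQ5 hr hrst hr' hrst' hprim hprim' hEq hr5 hr'v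
  have hs₀ := Nat.mod_lt s.val (by omega : 0 < Q)
  have ht₀ := Nat.mod_lt t.val (by omega : 0 < Q)
  obtain ⟨i, u, hui, hu, hus⟩ := exists_unit_P_bs (by omega) h5s (a := Q - s.val % Q) (by omega) (by omega) (by omega)
  set a := Q - s.val % Q with ha
  have ha1 : 1 ≤ a := by omega
  have ha4 : a ≤ 4 := by omega
  have hur : u * r = r := by have := orbit_mul_eq_of_dvd (p := 5) 1 r h5r i; rwa [one_mul, one_mul, ← hui] at this
  have hur' : u * r' = r' := by have := orbit_mul_eq_of_dvd (p := 5) 1 r' h5r' i; rwa [one_mul, one_mul, ← hui] at this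
  -- the new pair `τ₁ = (r, us, ut)`, `τ₁′ = (r′, us′, ut′)`
  have hEq₁ : fermatCMType (5 * Q) r (u * s) (u * t) = fermatCMType (5 * Q) r' (u * s') (u * t') := by
    have := fermatCMType_mul_eq_bs hu hEq; rwa [hur, hur'] at this
  have hrst₁ : r + u * s + u * t = 0 := by rw [← hur, ← mul_add, ← mul_add, hrst, mul_zero]
  have hrst₁' : r' + u * s' + u * t' = 0 := by rw [← hur', ← mul_add, ← mul_add, hrst', mul_zero]
  have hdv : ∀ {q : ℕ}, q ∣ 5 * Q → ∀ x : ZMod (5 * Q), q ∣ (u * x).val ↔ q ∣ x.val := fun hq x => dvd_val_mul_iff_of_isUnit_bs hq hu x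
  have hprim₁ : ∀ q : ℕ, q.Prime → q ∣ 5 * Q → ¬(q ∣ r.val ∧ q ∣ (u * s).val ∧ q ∣ (u * t).val) := fun q hq hqN h =>
    hprim q hq hqN ⟨h.1, (hdv hqN s).1 h.2.1, (hdv hqN t).1 h.2.2⟩
  have hprim₁' : ∀ q : ℕ, q.Prime → q ∣ 5 * Q → ¬(q ∣ r'.val ∧ q ∣ (u * s').val ∧ q ∣ (u * t').val) := fun q hq hqN h =>
    hprim' q hq hqN ⟨h.1, (hdv hqN s').1 h.2.1, (hdv hqN t').1 h.2.2⟩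
  -- (7) for the new pair: `r₀′ + (us′)₀ + (ut′)₀ = Q`
  obtain ⟨-, hsum'⟩ := residues_normalised_bs hQ5 hr hrst₁ hr' hrst₁' hprim₁ hprim₁' hEq₁ hr5 hr'v
  -- `⟨ut⟩ = N − b`; `2 ∉ H_{τ₁} = H_{τ₁′}`
  have hut : (u * t).val = 5 * Q - (5 - a) := val_third_bs (by omega) hrst₁ hr5 hus ha1 ha4
  have h2notin := two_notin_bs hQ5 hr5 hus hut ha1 ha4
  rw [hEq₁, mem_fermatCMType_iff_bs, not_and] at h2notin
  have h2unit : IsUnit (2 : ZMod (5 * Q)) := by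
    have := (ZMod.isUnit_iff_coprime 2 (5 * Q)).2 hN2; rwa [Nat.cast_ofNat] at this
  have hsum2 := h2notin ((isUnit_iff_val_coprime_bs _).1 h2unit)
  -- hence `⟨2r′⟩ + ⟨2us′⟩ + ⟨2ut′⟩ = 2N` with `⟨2r′⟩ = 5`: `a′ = N − ⟨2us′⟩`, `b′ = N − ⟨2ut′⟩`, `a′ + b′ = 5`
  obtain ⟨k, hk2, hk⟩ := exists_val_sum_eq_mul_bs hrst₁' (2 : ZMod (5 * Q))
  have h2r'v : ((2 : ZMod (5 * Q)) * r').val = 5 := by rw [h2r', hr5]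
  rw [h2r'v] at hk hsum2
  have hA := ZMod.val_lt ((2 : ZMod (5 * Q)) * (u * s'))
  have hB := ZMod.val_lt ((2 : ZMod (5 * Q)) * (u * t'))
  have hk2' : k = 2 := by interval_cases k <;> omega
  subst hk2'
  -- one of `a′, b′` is even; the final count contradicts (7)
  by_cases hpar : (5 * Q - ((2 : ZMod (5 * Q)) * (u * s')).val) % 2 = 0
  · exact final_count_bs hQ5 hQodd hr'v (x := u * s') (z := u * t') (a' := 5 * Q - ((2 : ZMod (5 * Q)) * (u * s')).val)
      (b' := 5 * Q - ((2 : ZMod (5 * Q)) * (u * t')).val) (by omega) (by omega) hpar (by omega) (by omega) (by omega) hsum'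
  · exact final_count_bs hQ5 hQodd hr'v (x := u * t') (z := u * s') (a' := 5 * Q - ((2 : ZMod (5 * Q)) * (u * t')).val)
      (b' := 5 * Q - ((2 : ZMod (5 * Q)) * (u * s')).val) (by omega) (by omega) (by omega) (by omega) (by omega) (by omega) (by omega)

/-- The sub-case `r = 2r′` in general position: normalise by the unit `u₀` with `⟨u₀r⟩ = g.c.d.(⟨r⟩, N) = 5`.
[cite: KoblitzRohrlich1978, §3 Proposition, Case 2 at `p = 5` (p. 1196)] -/
private theorem false_of_eq_two_mul_bs (hN2 : Nat.Coprime 2 (5 * Q)) (hQ5 : 5 < Q) {r s t r' s' t' : ZMod (5 * Q)}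
    (hr : r ≠ 0) (hrst : r + s + t = 0) (hr' : r' ≠ 0) (hrst' : r' + s' + t' = 0) (hprim : ∀ q : ℕ, q.Prime → q ∣ 5 * Q → ¬(q ∣ r.val ∧ q ∣ s.val ∧ q ∣ t.val))
    (hprim' : ∀ q : ℕ, q.Prime → q ∣ 5 * Q → ¬(q ∣ r'.val ∧ q ∣ s'.val ∧ q ∣ t'.val))
    (hEq : fermatCMType (5 * Q) r s t = fermatCMType (5 * Q) r' s' t') (hg : Nat.gcd r.val (5 * Q) = 5) (h2 : r = 2 * r') : False := by
  obtain ⟨u₀, hu₀, hu₀r⟩ := exists_isUnit_val_mul_eq_gcd hr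
  rw [hg] at hu₀r
  have hne : ∀ {x : ZMod (5 * Q)}, x ≠ 0 → u₀ * x ≠ 0 := fun hx h => hx (hu₀.mul_right_eq_zero.1 h)
  have hdv : ∀ {q : ℕ}, q ∣ 5 * Q → ∀ x : ZMod (5 * Q), q ∣ (u₀ * x).val ↔ q ∣ x.val := fun hq x =>
    dvd_val_mul_iff_of_isUnit_bs hq hu₀ x
  exact false_of_normalised_bs hN2 hQ5 (hne hr) (by rw [← mul_add, ← mul_add, hrst, mul_zero]) (hne hr')
    (by rw [← mul_add, ← mul_add, hrst', mul_zero])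
    (fun q hq hqN h => hprim q hq hqN ⟨(hdv hqN r).1 h.1, (hdv hqN s).1 h.2.1, (hdv hqN t).1 h.2.2⟩)
    (fun q hq hqN h => hprim' q hq hqN ⟨(hdv hqN r').1 h.1, (hdv hqN s').1 h.2.1, (hdv hqN t').1 h.2.2⟩)
    (fermatCMType_mul_eq_bs hu₀ hEq) hu₀r (by rw [h2]; ring)

/-- **KOBLITZ–ROHRLICH §3 PROPOSITION, CASE 2 AT `p = 5` WITH `5 ∥ N`, IN FULL** ("Now suppose `N = 5N₀, 5 ∤ N₀, 5 | r, r′`. … So suppose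
g.c.d.`(N, r) = `g.c.d.`(N, r′) = 5`.  If `r/r′ ≢ 2^{±1} mod N₀`, then we use the above lemma (with `N₀, r/r′` in place of `N, y`) to find `u`
prime to `N₀` such that `3 ≤ |⌊⟨ur/r′⟩_{N₀}/(N₀/5)⌋ − ⌊⟨u⟩_{N₀}/(N₀/5)⌋| = |⌊⟨u₀r⟩/(N/5)⌋ − ⌊⟨u₀r′⟩/(N/5)⌋|`.  Here `r′/5 ∈ (ℤ/Nℤ)*`. …
which contradicts (6).  It remains to consider the case `r/r′ ≡ 2^{±1} mod N₀` …", p. 1196): at `N = 5Q` prime to `6` with `5 ∤ Q`, for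
admissible primitive `τ, τ′` (six non-zero entries) with `H_τ = H_{τ′}`: `5 ∣ ⟨r⟩, ⟨r′⟩ ⟹` **`r = r′`** — §6's reduction to g.c.d. `= 5`,
§7's Lemma (second part) at level `Q` with `y = (r/5)(r′/5)⁻¹`, transported to a unit `U` of level `N` with `⟨Ur′⟩ = 5⟨u⟩_Q`, `⟨Ur⟩ =
5⟨uy⟩_Q` (`ZMod.unitsMap_surjective`), against §6's (6); the sub-cases `r = 2r′`, `r′ = 2r` by (7) (`false_of_eq_two_mul_bs`).
[cite: KoblitzRohrlich1978, §3 Proposition, Case 2 at `p = 5` (p. 1196)] -/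
theorem eq_of_fermatCMType_eq_of_five_dvd_of_dvd (hN2 : Nat.Coprime 2 (5 * Q)) (hN3 : Nat.Coprime 3 (5 * Q)) (h5Q : ¬5 ∣ Q)
    {r s t r' s' t' : ZMod (5 * Q)} (hr : r ≠ 0) (hs : s ≠ 0) (ht : t ≠ 0) (hrst : r + s + t = 0)
    (hr' : r' ≠ 0) (hs' : s' ≠ 0) (ht' : t' ≠ 0) (hrst' : r' + s' + t' = 0)
    (hprim : ∀ q : ℕ, q.Prime → q ∣ 5 * Q → ¬(q ∣ r.val ∧ q ∣ s.val ∧ q ∣ t.val))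
    (hprim' : ∀ q : ℕ, q.Prime → q ∣ 5 * Q → ¬(q ∣ r'.val ∧ q ∣ s'.val ∧ q ∣ t'.val))
    (h5r : 5 ∣ r.val) (h5r' : 5 ∣ r'.val) (hEq : fermatCMType (5 * Q) r s t = fermatCMType (5 * Q) r' s' t') : r = r' := by
  by_contra hne
  have h5 : (5 : ℕ).Prime := by norm_num
  have hN0 : 0 < 5 * Q := Nat.pos_of_ne_zero (NeZero.ne _)
  have hQ0 : 0 < Q := by omega
  haveI : NeZero Q := ⟨hQ0.ne'⟩
  have h25 : ¬5 * 5 ∣ 5 * Q := fun h => h5Q ((Nat.mul_dvd_mul_iff_left (by norm_num : 0 < 5)).1 h)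
  have hQ2 : Nat.Coprime 2 Q := Nat.Coprime.coprime_dvd_right (dvd_mul_left Q 5) hN2
  have hQ3 : Nat.Coprime 3 Q := Nat.Coprime.coprime_dvd_right (dvd_mul_left Q 5) hN3
  have hQ5 : Nat.Coprime 5 Q := (Nat.Prime.coprime_iff_not_dvd h5).2 h5Q
  have hQ1 : Q ≠ 1 := fun h => by
    -- at `Q = 1`, `⟨r⟩ < 5` is a multiple of `5`, so `r = 0`
    have h1 : r.val < 5 * Q := ZMod.val_lt r
    have h2 : 0 < r.val := Nat.pos_of_ne_zero fun h0 => hr ((ZMod.val_eq_zero r).1 h0)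
    have h3 := Nat.le_of_dvd h2 h5r
    omega
  have hQ7 : 7 ≤ Q := seven_le_of_dvd_bs hQ0 hQ2 hQ3 hQ5 (dvd_refl Q) hQ1
  -- g.c.d.`(N, r) = `g.c.d.`(N, r′) = 5`
  obtain ⟨hg, hg'⟩ := (eq_or_gcd_eq_five_of_fermatCMType_eq hN2 hN3 (dvd_mul_right 5 Q) h25 hr hs ht hrst hr' hs' ht' hrst' hprim
    hprim' h5r h5r' hEq).resolve_left hne
  -- the sub-cases `r = 2r′`, `r′ = 2r`
  by_cases h2 : r = 2 * r'
  · exact false_of_eq_two_mul_bs hN2 (by omega) hr hrst hr' hrst' hprim hprim' hEq hg h2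
  by_cases h2' : r' = 2 * r
  · exact false_of_eq_two_mul_bs hN2 (by omega) hr' hrst' hr hrst hprim' hprim hEq.symm hg' h2'
  -- `ρ = ⟨r⟩/5`, `ρ′ = ⟨r′⟩/5`: units modulo `Q`
  set ρ := r.val / 5 with hρdef
  set ρ' := r'.val / 5 with hρ'def
  have hrρ : r.val = 5 * ρ := (Nat.mul_div_cancel' h5r).symm
  have hrρ' : r'.val = 5 * ρ' := (Nat.mul_div_cancel' h5r').symm
  have hρQ : ρ < Q := by have := ZMod.val_lt r; omega
  have hρ'Q : ρ' < Q := by have := ZMod.val_lt r'; omega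
  have hcopρ : Nat.Coprime ρ Q := by
    have h1 : Nat.gcd (5 * ρ) (5 * Q) = 5 := by rw [← hrρ]; exact hg
    rw [Nat.gcd_mul_left] at h1
    have : Nat.gcd ρ Q = 1 := by omega
    exact this
  have hcopρ' : Nat.Coprime ρ' Q := by
    have h1 : Nat.gcd (5 * ρ') (5 * Q) = 5 := by rw [← hrρ']; exact hg'
    rw [Nat.gcd_mul_left] at h1
    have : Nat.gcd ρ' Q = 1 := by omega
    exact this
  have hρu : IsUnit ((ρ : ℕ) : ZMod Q) := (ZMod.isUnit_iff_coprime ρ Q).2 hcopρ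
  have hρ'u : IsUnit ((ρ' : ℕ) : ZMod Q) := (ZMod.isUnit_iff_coprime ρ' Q).2 hcopρ'
  have hρv : ((ρ : ℕ) : ZMod Q).val = ρ := by rw [ZMod.val_natCast, Nat.mod_eq_of_lt hρQ]
  have hρ'v : ((ρ' : ℕ) : ZMod Q).val = ρ' := by rw [ZMod.val_natCast, Nat.mod_eq_of_lt hρ'Q]
  obtain ⟨ι, hι⟩ := hρ'u.exists_right_inv
  have hιu : IsUnit ι := isUnit_of_mul_isUnit_right (by rw [hι]; exact isUnit_one)
  set y : ZMod Q := ((ρ : ℕ) : ZMod Q) * ι with hydef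
  have hyu : IsUnit y := hρu.mul hιu
  -- `r = c·r′` in `ZMod (5Q)` from `ρ = c·ρ′` in `ZMod Q`
  have hlift : ∀ c : ℕ, ((ρ : ℕ) : ZMod Q) = (c : ZMod Q) * ((ρ' : ℕ) : ZMod Q) → r = (c : ZMod (5 * Q)) * r' := by
    intro c hc
    have h1 : ρ ≡ c * ρ' [MOD Q] := by rw [← ZMod.natCast_eq_natCast_iff, Nat.cast_mul]; exact hc
    have h2 : 5 * ρ ≡ 5 * (c * ρ') [MOD 5 * Q] := Nat.ModEq.mul_left' 5 h1
    rw [← ZMod.natCast_zmod_val r, ← ZMod.natCast_zmod_val r', hrρ, hrρ', show (c : ZMod (5 * Q)) * ((5 * ρ' : ℕ) : ZMod (5 * Q)) =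
      ((5 * (c * ρ') : ℕ) : ZMod (5 * Q)) by push_cast; ring]
    exact (ZMod.natCast_eq_natCast_iff _ _ _).2 h2
  have hy1 : y ≠ 1 := fun h => hne (by
    have h1 : ((ρ : ℕ) : ZMod Q) = (1 : ℕ) * ((ρ' : ℕ) : ZMod Q) := by
      rw [Nat.cast_one, one_mul, ← mul_one ((ρ : ℕ) : ZMod Q), ← hι, ← mul_assoc, mul_comm ((ρ : ℕ) : ZMod Q) ((ρ' : ℕ) : ZMod Q),
        mul_assoc, ← hydef, h, mul_one]
    have := hlift 1 h1; rwa [Nat.cast_one, one_mul] at this)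
  have hy2 : y ≠ 2 := fun h => h2 (by
    have h1 : ((ρ : ℕ) : ZMod Q) = (2 : ℕ) * ((ρ' : ℕ) : ZMod Q) := by
      rw [← mul_one ((ρ : ℕ) : ZMod Q), ← hι, ← mul_assoc, mul_comm ((ρ : ℕ) : ZMod Q) ((ρ' : ℕ) : ZMod Q), mul_assoc, ← hydef, h,
        Nat.cast_ofNat, mul_comm]
    have := hlift 2 h1; rwa [Nat.cast_ofNat] at this)
  have hy2' : 2 * y ≠ 1 := fun h => h2' (by
    -- `2ρ = ρ′` modulo `Q`, hence `r′ = 2r`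
    have h1 : ((ρ' : ℕ) : ZMod Q) = (2 : ℕ) * ((ρ : ℕ) : ZMod Q) := by
      have e : 2 * ((ρ : ℕ) : ZMod Q) * ι = 1 := by rw [mul_assoc, ← hydef]; exact h
      have e2 : 2 * ((ρ : ℕ) : ZMod Q) * ι * ((ρ' : ℕ) : ZMod Q) = ((ρ' : ℕ) : ZMod Q) := by rw [e, one_mul]
      rw [mul_assoc, mul_comm ι, hι, mul_one] at e2
      rw [Nat.cast_ofNat]; exact e2.symm
    have h1' : ρ' ≡ 2 * ρ [MOD Q] := by rw [← ZMod.natCast_eq_natCast_iff, Nat.cast_mul]; exact h1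
    have h2'' : 5 * ρ' ≡ 5 * (2 * ρ) [MOD 5 * Q] := Nat.ModEq.mul_left' 5 h1'
    rw [← ZMod.natCast_zmod_val r, ← ZMod.natCast_zmod_val r', hrρ, hrρ', show (2 : ZMod (5 * Q)) * ((5 * ρ : ℕ) : ZMod (5 * Q)) =
      ((5 * (2 * ρ) : ℕ) : ZMod (5 * Q)) by push_cast; ring]
    exact (ZMod.natCast_eq_natCast_iff _ _ _).2 h2'')
  -- the Lemma (second part) at level `Q`
  obtain ⟨u', hu', hsep⟩ := exists_isUnit_div_separation_part_two hQ2 hQ3 hQ5 hyu hy1 hy2 hy2'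
  -- transport: `U′ = u′ι`, lifted to a unit `U` of level `N`
  have hU'u : IsUnit (u' * ι) := hu'.mul hιu
  have hTN : Q ∣ 5 * Q := dvd_mul_left Q 5
  obtain ⟨U, hU⟩ := ZMod.unitsMap_surjective hTN hU'u.unit
  have hUv : (U : ZMod (5 * Q)).val % Q = (u' * ι).val % Q := by
    have h1 : ZMod.castHom hTN (ZMod Q) (U : ZMod (5 * Q)) = (hU'u.unit : ZMod Q) := by rw [← hU]; rfl
    rw [IsUnit.unit_spec, ZMod.castHom_apply, ZMod.cast_eq_val] at h1
    have h2 := congrArg ZMod.val h1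
    rw [ZMod.val_natCast] at h2
    rw [h2, Nat.mod_eq_of_lt (ZMod.val_lt _)]
  have hUr' : ((U : ZMod (5 * Q)) * r').val = 5 * u'.val := by
    have e : u' = (u' * ι) * ((ρ' : ℕ) : ZMod Q) := by rw [mul_assoc, mul_comm ι, hι, mul_one]
    rw [ZMod.val_mul, e, ZMod.val_mul ((u' * ι)), hρ'v]
    exact mul_mod_descent_bs rfl hrρ' hUv
  have hUr : ((U : ZMod (5 * Q)) * r).val = 5 * (u' * y).val := by
    have e : u' * y = (u' * ι) * ((ρ : ℕ) : ZMod Q) := by rw [hydef]; ring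
    rw [ZMod.val_mul, e, ZMod.val_mul ((u' * ι)), hρv]
    exact mul_mod_descent_bs rfl hrρ hUv
  -- (6) at level `N = 5Q`: `|⌊⟨Ur⟩/Q⌋ − ⌊⟨Ur′⟩/Q⌋| ≤ 2`; the Lemma: `≥ 3`
  obtain ⟨⟨h61, h62⟩, -⟩ := div_dist_le_of_fermatCMType_eq h5 hr hrst hr' hrst' hprim hprim' h5r h5r' hEq U.isUnit
  rw [hUr, hUr'] at h61 h62
  omega

/-- **Case 2 at `p = 5`, `5 ∥ N`, general-level form**: `N` prime to `6`, `5 ∣ N`, `25 ∤ N`, admissible primitive `τ, τ′`, `H_τ = H_{τ′}`,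
`5 ∣ ⟨r⟩, ⟨r′⟩` ⟹ `r = r′`. [cite: KoblitzRohrlich1978, §3 Proposition, Case 2 at `p = 5` (p. 1196)] -/
theorem eq_of_fermatCMType_eq_of_five_dvd_of_dvd_level {N : ℕ} [NeZero N] (hN2 : Nat.Coprime 2 N) (hN3 : Nat.Coprime 3 N)
    (h5N : 5 ∣ N) (h25 : ¬5 * 5 ∣ N) {r s t r' s' t' : ZMod N} (hr : r ≠ 0) (hs : s ≠ 0) (ht : t ≠ 0) (hrst : r + s + t = 0)
    (hr' : r' ≠ 0) (hs' : s' ≠ 0) (ht' : t' ≠ 0) (hrst' : r' + s' + t' = 0)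
    (hprim : ∀ q : ℕ, q.Prime → q ∣ N → ¬(q ∣ r.val ∧ q ∣ s.val ∧ q ∣ t.val))
    (hprim' : ∀ q : ℕ, q.Prime → q ∣ N → ¬(q ∣ r'.val ∧ q ∣ s'.val ∧ q ∣ t'.val))
    (h5r : 5 ∣ r.val) (h5r' : 5 ∣ r'.val) (hEq : fermatCMType N r s t = fermatCMType N r' s' t') : r = r' := by
  obtain ⟨Q, rfl⟩ := h5N
  exact eq_of_fermatCMType_eq_of_five_dvd_of_dvd hN2 hN3 (fun h => h25 (Nat.mul_dvd_mul_left 5 h)) hr hs ht hrst hr' hs' ht' hrst'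
    hprim hprim' h5r h5r' hEq

/-- **CASE 2 OF THE PROPOSITION AT EVERY LEVEL PRIME TO `6`, EVERY BOUNDARY PRIME** ("Case 2. There exists a prime `p` dividing `N, r, r′`
but not dividing `sts′t′`; and `r ≠ r′`" is impossible): `N` prime to `6`, `p ∣ N` prime, admissible primitive `τ, τ′` (six non-zero
entries), `H_τ = H_{τ′}`, `p ∣ ⟨r⟩, ⟨r′⟩` ⟹ **`r = r′`** — `p = 5`: `5² ∣ N` by the sibling (`ν = 0`) or `5 ∥ N` by the preceding; `p = 7`: §2;
`p ≥ 11`: the sibling. [cite: KoblitzRohrlich1978, §3 Proposition, Case 2 (pp. 1195–1196)] -/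
theorem eq_of_fermatCMType_eq_of_dvd_of_dvd_all {N : ℕ} [NeZero N] (hN2 : Nat.Coprime 2 N) (hN3 : Nat.Coprime 3 N) {p : ℕ}
    (hp : p.Prime) (hpN : p ∣ N) {r s t r' s' t' : ZMod N} (hr : r ≠ 0) (hs : s ≠ 0) (ht : t ≠ 0) (hrst : r + s + t = 0)
    (hr' : r' ≠ 0) (hs' : s' ≠ 0) (ht' : t' ≠ 0) (hrst' : r' + s' + t' = 0)
    (hprim : ∀ q : ℕ, q.Prime → q ∣ N → ¬(q ∣ r.val ∧ q ∣ s.val ∧ q ∣ t.val))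
    (hprim' : ∀ q : ℕ, q.Prime → q ∣ N → ¬(q ∣ r'.val ∧ q ∣ s'.val ∧ q ∣ t'.val))
    (hpr : p ∣ r.val) (hpr' : p ∣ r'.val) (hEq : fermatCMType N r s t = fermatCMType N r' s' t') : r = r' := by
  have hp5 : 5 ≤ p := five_le_of_prime_dvd_bs hN2 hN3 hp hpN
  by_cases hp5' : p = 5
  · subst hp5'
    by_cases h25 : 5 * 5 ∣ N
    · obtain ⟨Q, rfl⟩ := hpN
      exact eq_of_fermatCMType_eq_of_dvd_of_dvd_of_sq_dvd_or_le hp le_rfl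
        (Or.inl ((Nat.mul_dvd_mul_iff_left (by norm_num : 0 < 5)).1 h25)) hN2 hN3 hr hrst hr' hrst' hprim hprim' hpr hpr' hEq
    · exact eq_of_fermatCMType_eq_of_five_dvd_of_dvd_level hN2 hN3 hpN h25 hr hs ht hrst hr' hs' ht' hrst' hprim hprim' hpr hpr' hEq
  by_cases hp7 : p = 7
  · subst hp7
    exact eq_of_fermatCMType_eq_of_seven_dvd_of_dvd_level hN2 hN3 hpN hr hs ht hrst hr' hs' ht' hrst' hprim hprim' hpr hpr' hEq
  obtain ⟨Q, rfl⟩ := hpN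
  exact eq_of_fermatCMType_eq_of_dvd_of_dvd_of_sq_dvd_or_le hp hp5 (Or.inr (eleven_le_of_ne_bs hp hp5 hp5' hp7)) hN2 hN3 hr hrst hr'
    hrst' hprim hprim' hpr hpr' hEq

/-- **At `5 ∥ N`, what remains is exactly K–R's omitted Case 3 at `p = 5`**: `N` prime to `6`, `5 ∣ N`, `25 ∤ N`, admissible primitive
`τ, τ′`, `H_τ = H_{τ′}`, `5 ∣ ⟨r⟩`; IF `5` divides one of `⟨r′⟩, ⟨s′⟩, ⟨t′⟩` (i.e. outside Case 3's configuration "`p | N, r`, `p ∤ str′s′t′`",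
whose treatment at `p = 5`, `5² ∤ N` K–R omit: "By a tedious examination … This part of the proof will be omitted", p. 1197), THEN
**`r = r′ ∨ r = s′ ∨ r = t′`** (Case 2 at `5`, the preceding theorems, applied to the suitably permuted `τ′`).
[cite: KoblitzRohrlich1978, §3 Proposition, Cases 2–3 at `p = 5` (pp. 1196–1197)] -/
theorem eq_or_eq_or_eq_of_fermatCMType_eq_of_five_dvd_of_dvd {N : ℕ} [NeZero N] (hN2 : Nat.Coprime 2 N) (hN3 : Nat.Coprime 3 N)
    (h5N : 5 ∣ N) (h25 : ¬5 * 5 ∣ N) {r s t r' s' t' : ZMod N} (hr : r ≠ 0) (hs : s ≠ 0) (ht : t ≠ 0) (hrst : r + s + t = 0)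
    (hr' : r' ≠ 0) (hs' : s' ≠ 0) (ht' : t' ≠ 0) (hrst' : r' + s' + t' = 0)
    (hprim : ∀ q : ℕ, q.Prime → q ∣ N → ¬(q ∣ r.val ∧ q ∣ s.val ∧ q ∣ t.val))
    (hprim' : ∀ q : ℕ, q.Prime → q ∣ N → ¬(q ∣ r'.val ∧ q ∣ s'.val ∧ q ∣ t'.val))
    (h5r : 5 ∣ r.val) (h5' : 5 ∣ r'.val ∨ 5 ∣ s'.val ∨ 5 ∣ t'.val) (hEq : fermatCMType N r s t = fermatCMType N r' s' t') :
    r = r' ∨ r = s' ∨ r = t' := by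
  rcases h5' with h | h | h
  · exact Or.inl (eq_of_fermatCMType_eq_of_five_dvd_of_dvd_level hN2 hN3 h5N h25 hr hs ht hrst hr' hs' ht' hrst' hprim hprim' h5r h hEq)
  · exact Or.inr (Or.inl (eq_of_fermatCMType_eq_of_five_dvd_of_dvd_level hN2 hN3 h5N h25 hr hs ht hrst hs' hr' ht'
      (by rw [add_comm s' r']; exact hrst') hprim (fun q hq hqN h' => hprim' q hq hqN ⟨h'.2.1, h'.1, h'.2.2⟩) h5r h
      (hEq.trans (fermatCMType_swap₁₂_bs r' s' t'))))
  · exact Or.inr (Or.inr (eq_of_fermatCMType_eq_of_five_dvd_of_dvd_level hN2 hN3 h5N h25 hr hs ht hrst ht' hs' hr'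
      (by rw [show t' + s' + r' = r' + s' + t' by ring]; exact hrst') hprim (fun q hq hqN h' => hprim' q hq hqN ⟨h'.2.2, h'.2.1, h'.1⟩)
      h5r h (hEq.trans (fermatCMType_swap₁₃_bs r' s' t'))))

end FiveExactCore

end CyclotomicFermatCMType

end Literature.AlgebraicGeometry.ComplexMultiplication
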